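import Literature.Combinatorics.Optimization.SquaredDistancePsdRank
import Literature.Combinatorics.Optimization.RationalPsdRank
import Literature.Combinatorics.Optimization.PentagonsPsdRankFour
import Literature.Combinatorics.Optimization.PsdFactorizationRescaling
import Literature.LinearAlgebra.Matrix.SpectrahedralConeExtremeRays
import Literature.Analysis.Calculus.RealAnalyticZeroSetProofs
import HarnessLib

/-!
# Psd lifts of size at most three have few extreme points; the Euclidean 4-ball has no psd lift
# of size 3 — the least size is 4 (a question raised in Fawzi–Gouveia–Parrilo–Robinson–Thomas
# 2015, §9.1) — PROVED

Source of the question: H. Fawzi, J. Gouveia, P. A. Parrilo, R. Z. Robinson, R. R. Thomas,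
*Positive semidefinite rank*, Math. Program. Ser. B 153 (2015) 133–177 = arXiv:1407.4095
[FawziEtAl2015], §9.1 "Psd rank of special matrices", Problem 9.1 (held text `paper:arxiv-1407.4095`,
chunk p24, verbatim): "Since the unit ball in `ℝ⁴` has a semidefinite representation of size `4`, we
know that the psd rank of `A` is at most `4`. The usual rank of `A` being `5`, we know that its psd
rank must be at least `3`. If one can show that it is `4` it would prove that there is no smaller
semidefinite representation of the `3`-sphere." The tree already holds both printed bounds for the
ball `B⁴ = {x ∈ ℝ⁴ : Σ x_l² ≤ 1}` in the lift vocabulary of FGPRT eq. (3)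
(`HasPsdLift C k : C = π(S^k_+ ∩ L)`, `PsdLiftSlackMatrix.lean`): a psd lift of size `4`
(`hasPsdLift_euclideanBall_fin_four`) and "size `≥ 3`" by the dimension count `dim C ≤ C(k+1, 2)`
(`card_le_choose_of_hasPsdLift_euclideanBall`, both in `SquaredDistancePsdRank.lean`). The survey
H. Fawzi, J. Gouveia, P. A. Parrilo, J. Saunderson, R. R. Thomas, *Lifting for simplicity*, SIAM Rev.
64 (2022) [FawziEtAl2022Lifting], §5.2.2 (held text `paper:arxiv-2002.09788` p27) records for the
unit ball of `ℝⁿ` exactly two lower bounds for the size `m` of a spectrahedral lift: the degree bound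
(`m ≥ √2`) and "the dimension lower bound gives `m ≥ √n`".

## What is proved here (no named facts; everything from Mathlib and the tree)

**Theorem** (`hausdorffMeasure_extremePoints_eq_zero_of_hasPsdLift`). Let `k ≤ 3` and let
`C = π(S^k_+ ∩ L) ⊆ ℝⁿ` (`L` an affine subspace of `k × k` real matrices, `π` linear) with
`dim aff C > k`. Then the set of extreme points of `C` is `μH[k]`-null (`k`-dimensional Hausdorff
measure on `ℝⁿ = Fin n → ℝ` with the sup metric).

**Corollaries.** `not_hasPsdLift_euclideanBall`: for `k ≤ 3` and `n > k` the unit ball `Bⁿ` has no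
psd lift of size `k` (its extreme points, the unit sphere, have positive `μH[n−1] ≤ μH[k]`-measure).
In particular `not_hasPsdLift_euclideanBall_fin_four_three`: **`B⁴` has no psd lift of size `3`**
— "there is no smaller semidefinite representation of the `3`-sphere" — and
`isLeast_psdLiftSize_euclideanBall_fin_four`: **the least size of a psd lift of `B⁴` is `4`**; also
`three_le_of_hasPsdLift_euclideanBall_fin_three` (`B³` needs size `≥ 3`; the dimension count gives
`2`) and `four_le_of_hasPsdLift_euclideanBall` (`Bⁿ`, `n ≥ 4`, needs `≥ 4`; for `n = 5, 6` the
dimension count gives `3`). More generally `not_hasPsdLift_of_strictConvex`: **no compact strictly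
convex set with non-empty interior in `ℝⁿ`, `n > k`, has a psd lift of size `k ≤ 3`** (its boundary
consists of extreme points and has positive `μH[n−1]`), and `not_hasPsdLift_secondOrderCone`: the
second-order cone `L^{n+1}_+ = {‖x‖₂ ≤ x₀}` has no psd lift of size `k ≤ 3` for `n > k` (slice at
`x₀ = 1`; `HasPsdLift.inter_setOf_apply_eq`) — in particular the `5`-dimensional Lorentz cone is not
a linear image of an affine slice of `S³_+`. Conversely (last section) **`B³` and `L⁴_+` ARE
shadows of `S³_+`**: `B³ = {(2X₀₂, 2X₁₂, X₂₂ − X₀₀ − X₁₁) : X ⪰ 0, Tr X = 1}`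
(`hasPsdLift_euclideanBall_fin_three`; the rank-one extreme points `v vᵀ` of the spectraplex map ONTO
`S²` under the degree-two map `v ↦ (2v₀v₂, 2v₁v₂, v₂² − v₀² − v₁²)`) and
`L⁴_+ = {(2X₀₂, 2X₁₂, X₂₂ − X₀₀ − X₁₁, Tr X) : X ⪰ 0}` (`hasPsdLift_secondOrderCone_three`), so the
least psd-lift sizes of `B³` and of `L⁴_+` are exactly `3` (`isLeast_psdLiftSize_euclideanBall_fin_three`,
`isLeast_psdLiftSize_secondOrderCone_three`). FGPRT's Problem 9.1 itself (the psd rank of the `10 × 10` matrix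
`|I ∩ J|`, a generalized slack matrix of a polytope PAIR inscribed in/circumscribed about `S³`) is NOT
settled by this: `rank_psd(A) = 3` asks only for SOME convex set with an `S³_+`-lift nested between
the two polytopes (FGPRT Thm. 3.3), not for the ball.

Provenance. The statements are PROVED here; we did not find them in print (presearch 2026-08-29:
held corpus incl. [FawziEtAl2015] §9, [FawziEtAl2022Lifting] §5 "Obstructions", Kubjas–Robeva–Sturmfels
2017; galaxy/vector search for "semidefinite representation of the ball of size 3" — none), which is
consistent with FGPRT posing the `B⁴` statement as a desirable consequence of Problem 9.1 and with the
2022 survey listing only `m ≥ √n`. The ingredients are classical and cited where used: the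
Ramana–Goldman perturbation lemma in the form of Blekherman–Parrilo–Thomas 2012, Ch. 4 Lemma 4.39
[BlekhermanParriloThomas2012] (credited there to [RamanaGoldman1995]; the tree's
`SpectrahedralConeExtremeRays.exists_posSemidef_add_sub_smul`), Krein–Milman (Mathlib), the
Lebesgue-nullity of zero sets of non-trivial real analytic functions [Mityagin2015] (the tree's
`Mityagin2015.volume_zeroSet_null_pi`), and `μH[k] = volume` on `ℝ^k` (Mathlib
`hausdorffMeasure_pi_real`).

## The argument

Write `K = S^k_+ ∩ L` (`liftSet L`) and `C = π(K)`.
1. (`exists_mem_extremePoints_eq`) Every extreme point `e` of `C` is `π X` for an extreme point `X`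
   of `K`: the fibre `G = K ∩ π⁻¹(e)` is a closed face of `K`; the trace attains its minimum `m` on `G`
   (sub-level sets `{Tr ≤ t}` of psd matrices are compact, `|X_{ab}| ≤ Tr X`); the minimisers form a
   non-empty compact convex face, which has an extreme point (Krein–Milman), extreme in `K` because
   a face of a face is a face.
2. (`exists_eq_vecMulVec_of_mem_extremePoints`) If `k ≤ 3` and the (symmetric) direction space
   `V = vectorSpan K` has dimension `> k`, every extreme point `X` of `K` is `v vᵀ`: otherwise
   `rank X ≥ 2`, so `dim ker X ≤ k − 2 ≤ 1`, `ker X ⊆ ℝu`; the linear map `D ↦ Du`, `V → ℝ^k`, has a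
   non-zero `D` in its kernel, `ker X ⊆ ker D`, hence `X ± εD ∈ K` for small `ε > 0` (BPT Lemma 4.39)
   and `X` is a midpoint — not extreme. Here `dim V ≥ dim vectorSpan C > k`
   (`finrank_vectorSpan_image_le`).
3. (`extremePoints_subset_image_vecMulVec`) Hence `ext C ⊆ g(Z)` with `g(v) = π(v vᵀ)` and
   `Z = {v ∈ ℝ^k : v vᵀ ∈ L}`.
4. (`volume_setOf_vecMulVec_mem_eq_zero`) If some symmetric matrix is not a direction of `L`, pick a
   linear functional `f` killing `L.direction` but not all symmetric matrices; then `Z` lies in the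
   zero set of the quadratic `q(v) = f(v vᵀ) − f(X₀)`, which is not identically zero (a functional
   vanishing on all `v vᵀ` vanishes on all symmetric matrices, `E_{ab} + E_{ba} = (e_a+e_b)(e_a+e_b)ᵀ
   − e_ae_aᵀ − e_be_bᵀ`), so `volume Z = 0` [Mityagin2015]. If instead every symmetric matrix is a
   direction of `L`, then `K = S^k_+` (or `∅`), `C` is a cone with apex `0` and `ext C ⊆ {0}`.
5. (`hausdorffMeasure_image_vecMulVec_map_null`) `g` is real analytic, hence Lipschitz on balls, so
   `μH[k](g(Z)) = 0` (`μH[k] = volume` on `ℝ^k`).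
6. (`hausdorffMeasure_sphere_pos`, `sphere_subset_extremePoints_euclideanBall`) The unit sphere of
   `ℝ^{m+1}` has positive `μH[m]` (it projects `1`-Lipschitz onto the unit ball of `ℝ^m`), and unit
   vectors are extreme points of the ball (`a|y|² + b|z|² − |ay+bz|² = ab|y−z|²`).

Public API: `SmallPsdLifts.liftSet`, `SmallPsdLifts.not_mem_extremePoints_of_perturb`,
`SmallPsdLifts.exists_eq_vecMulVec_of_mem_extremePoints`, `SmallPsdLifts.extremePoints_subset_image_vecMulVec`,
`SmallPsdLifts.volume_setOf_vecMulVec_mem_eq_zero`, the theorems of the last section; the remaining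
helpers (closedness, compact trace sub-levels, Krein–Milman selection, analyticity, Hausdorff-measure
plumbing) are `private`.

Remark (not formalised): the same mechanism with semialgebraic dimension in place of the rank-one
shortcut — extreme points of `K` inject into `⊔_r Gr(r, k)` by `X ↦ range X` (Ramana–Goldman) —
gives `dim ext C ≤ ⌊k²/4⌋` for every `S^k_+`-lift, i.e. `m ≥ 2√(n−1)` for `Bⁿ`, against the
`2⌈√n⌉` of the Frobenius-ball lift; we record this only as a comment.

| claim | Lean | status |
|---|---|---|
| extreme points of `π(S^k_+ ∩ L)` lift to extreme points of `S^k_+ ∩ L` | `SmallPsdLifts.exists_mem_extremePoints_eq` (private) | PROVED |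
| `k ≤ 3`, `dim V > k` ⇒ extreme points of `S^k_+ ∩ L` are `v vᵀ` | `SmallPsdLifts.exists_eq_vecMulVec_of_mem_extremePoints` | PROVED |
| `{v : v vᵀ ∈ L}` is Lebesgue-null unless `Sym_k ⊆ L.direction` | `SmallPsdLifts.volume_setOf_vecMulVec_mem_eq_zero` | PROVED |
| `μH[m](S^m) > 0` in `ℝ^{m+1}` | `SmallPsdLifts.hausdorffMeasure_sphere_pos` (private) | PROVED |
| `k ≤ 3`, `dim aff C > k`, `C` has an `S^k_+`-lift ⇒ `μH[k](ext C) = 0` | `hausdorffMeasure_extremePoints_eq_zero_of_hasPsdLift` | PROVED |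
| `Bⁿ` has no `S^k_+`-lift for `k ≤ 3`, `n > k` | `not_hasPsdLift_euclideanBall`, `le_of_hasPsdLift_euclideanBall` | PROVED |
| "no smaller semidefinite representation of the 3-sphere" (p24): `B⁴` has no `S³_+`-lift | `not_hasPsdLift_euclideanBall_fin_four_three` | PROVED |
| least psd-lift size of `B⁴` is `4` | `isLeast_psdLiftSize_euclideanBall_fin_four` | PROVED |
| `B³` needs size `≥ 3`; `Bⁿ` (`n ≥ 4`) needs `≥ 4` | `three_le_of_hasPsdLift_euclideanBall_fin_three`, `four_le_of_hasPsdLift_euclideanBall` | PROVED |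
| affine slices keep the lift size | `HasPsdLift.inter_setOf_apply_eq` | PROVED |
| the second-order cone `L^{n+1}_+` has no `S^k_+`-lift for `k ≤ 3 < n + 1`, `n > k` | `not_hasPsdLift_secondOrderCone` (`secondOrderConeSet`) | PROVED |
| a compact strictly convex body of `ℝⁿ` with interior has no `S^k_+`-lift for `k ≤ 3`, `n > k` | `not_hasPsdLift_of_strictConvex` (boundary `⊆` extreme points; `μH[n−1](∂C) > 0`) | PROVED |
| least psd-lift size of `B²` is `2` (tree's ellipse lift + the `k ≤ 1` exclusion) | `hasPsdLift_euclideanBall_fin_two`, `isLeast_psdLiftSize_euclideanBall_fin_two` | PROVED |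
| `B³ = {(2X₀₂, 2X₁₂, X₂₂−X₀₀−X₁₁) : X ⪰ 0, Tr X = 1}` — a psd lift of size `3`; least size of `B³` is `3` | `hasPsdLift_euclideanBall_fin_three`, `isLeast_psdLiftSize_euclideanBall_fin_three` | PROVED |
| `L⁴_+ = {(2X₀₂, 2X₁₂, X₂₂−X₀₀−X₁₁, Tr X) : X ⪰ 0}`; least psd-lift size of `L⁴_+` is `3` | `hasPsdLift_secondOrderCone_three`, `isLeast_psdLiftSize_secondOrderCone_three` | PROVED |
| homogenisation: `B` bounded with ≥ 2 points and an `S^k_+`-lift ⇒ the cone over `B × {1}` has an `S^k_+`-lift; cone over `Bⁿ` = `L^{n+1}_+` | `HasPsdLift.coneOver`, `coneOver_euclideanBall`, `hasPsdLift_secondOrderCone_of_euclideanBall`, `hasPsdLift_secondOrderCone` | PROVED |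
| exact least psd-lift sizes of second-order cones: `L³_+ = 2`, `L⁴_+ = 3`, `L⁵_+ = 4` | `isLeast_psdLiftSize_secondOrderCone_two/_three/_four` | PROVED |
| factorization form: no `A, B : S^{n−1} → S^k_+` with `Tr(A(x)B(y)) = 1 − ⟨x,y⟩ (`k < n`, `C(k+1,2) < n+3`; e.g. `S³`, `k = 3`) — the GPT "factorization ⇒ lift" direction made explicit; size `s+t` exists for `n ≤ st`; the `S³` kernel has psd-factorization size exactly `4` | `not_exists_psd_factorization_sphere_slack`, `…_fin_four_three`, `exists_psd_factorization_sphere_slack`, `isLeast_psdFactorizationSize_sphere_slack_fin_four` | PROVED |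
| ALL `k ≥ 1`: `dim aff C > C(k+1,2) − 3`, `C` has an `S^k_+`-lift ⇒ `μH[k](ext C) = 0` | `hausdorffMeasure_extremePoints_eq_zero_of_hasPsdLift_of_choose_lt` (`SmallPsdLifts.exists_eq_vecMulVec_of_mem_extremePoints_of_choose_lt`) | PROVED |
| `Bⁿ` / strictly convex bodies with a psd lift of size `k < n` have `C(k+1,2) ≥ n + 3` | `not_hasPsdLift_euclideanBall_of_choose_lt`, `add_three_le_choose_of_hasPsdLift_euclideanBall`, `add_three_le_choose_of_hasPsdLift_of_strictConvex` | PROVED |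
| compactness: a matrix with entries `≤ Δ` (any index sets) all of whose FINITE submatrices have size-`r` psd factorizations has one, in Briët–Dadush–Pokutta normal form `M = r²Δ·Tr(X Y)`, `0 ⪯ X, Y ⪯ I` (Tychonoff + cluster point of the normalised finite factorizations) | `HasPsdFactorization.rescale_weak_of_finite`, `HasPsdFactorization.of_finite`, `hasPsdFactorization_iff_finite` | PROVED |
| some FINITE configuration on `S^{n−1}` has tangential slack matrix `(1 − ⟨u,v⟩)` of psd rank `> k` (`k < n`, `C(k+1,2) < n+3`); on `S³`: of psd rank exactly `4` | `exists_finset_sphere_not_hasPsdFactorization`, `exists_finset_sphere_isLeast_psdRank_four` | PROVED |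
| dense sequences `x_i ∈ S^{n−1}`: all large leading blocks `(1 − ⟨x_i,x_j⟩)_{i,j<N}` have psd rank `> k`; on `S³`: eventually exactly `4` (cluster-point extension of a normalised factorization to the closure) | `exists_not_hasPsdFactorization_sphereSlack_of_dense`, `exists_isLeast_psdRank_block_four_of_dense` | PROVED |
| a polytope PAIR around `S^{n−1}` (finitely many unit `x_i`, incl. `±e_l`; `Q = {⟨x_j,·⟩ ≤ 1}` bounded) with NO convex `C`, `conv{x_i} ⊆ C ⊆ Q`, having an `S^k_+`-lift (`k < n`, `C(k+1,2) < n+3`), via FGPRT Thm 3.3 "lift ⇒ factorization"; on `S³`: least sandwiched-lift size = least factorization size of the pair slack matrix = `4` | `exists_sphere_pair_not_hasPsdLift_between`, `exists_sphere_pair_isLeast_four` | PROVED |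
| GPT13 Thm 2.4 + Cor 2.6 for `C = Bⁿ`, `K = S^k_+` (all `n, k`): `Bⁿ` has a psd lift of size `k` iff the slack operator `1 − ⟨x,y⟩` on `S^{n−1} × S^{n−1}` has an `S^k_+`-factorization (⇒: Thm 3.3 on enlarged finite configurations + compactness, no conic duality for the operator; ⇐: `π(Z)_l = (Tr(Z B(−e_l)) − Tr(Z B(e_l)))/2`) | `hasPsdLift_euclideanBall_iff_exists_psd_factorization` (`exists_psd_factorization_of_hasPsdLift_euclideanBall`, `hasPsdLift_euclideanBall_of_psd_factorization`), `setOf_hasPsdLift_euclideanBall_eq` | PROVED |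
| GPT13 Ex. 2.7: `A(x₁,y₁) = [[1+x₁, y₁],[y₁, 1−x₁]]`, `B(x₂,y₂) = ½[[1−x₂, −y₂],[−y₂, 1+x₂]]` is an `S²_+`-factorization of the disk's slack operator; exact psd-factorization sizes of the sphere kernels: `S¹ = 2`, `S² = 3` (`S³ = 4` above) | `diskSlackFactorA/B`, `posSemidef_diskSlackFactorA/B`, `trace_diskSlackFactorA_mul_diskSlackFactorB`, `GouveiaParriloThomas2013_ex27`, `isLeast_psdFactorizationSize_sphere_slack_fin_two/_fin_three` | PROVED |

**All sizes** (last section, `…_of_choose_lt`): the rank-one step works for every `k` as soon as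
`dim V > C(k+1, 2) − 3` — for an extreme `X` of rank `≥ 2` take independent `u₁, u₂ ∈ range X`; the
symmetric products `u₁u₁ᵀ, u₁u₂ᵀ + u₂u₁ᵀ, u₂u₂ᵀ` span `3` dimensions inside the `C(k+1,2)`-space of
symmetric matrices and kill `ker X`, so they meet `V` non-trivially. Hence
`hausdorffMeasure_extremePoints_eq_zero_of_hasPsdLift_of_choose_lt` (`k ≥ 1`,
`dim aff C > C(k+1,2) − 3`), and for the ball / strictly convex bodies: **a psd lift of size `k < n`
forces `C(k+1, 2) ≥ n + 3`** (`add_three_le_choose_of_hasPsdLift_euclideanBall`,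
`add_three_le_choose_of_hasPsdLift_of_strictConvex`) — the dimension count `C(k+1,2) ≥ n` of
[FawziEtAl2022Lifting, §5.2.2] / the tree is never attained, nor missed by `1` or `2`, by a strictly
convex body: `Bⁿ` has no `S^k_+`-lift for `n ∈ {C(k+1,2) − 2, C(k+1,2) − 1, C(k+1,2)}` (`k = 4`:
`n = 8, 9, 10`; `k = 5`: `n = 13, 14, 15`; …).

**Homogenisation** (`HasPsdLift.coneOver`): if a bounded `B` with two points is `π(S^k_+ ∩ L)` then
the cone over `B × {1}` is `(π, f)(S^k_+ ∩ (ℝX₁ + dir L))` for a functional `f` with `f(X₁) = 1`,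
`f|_{dir L} = 0` — psd directions of `L` are killed by `π` (boundedness) and no psd `Y` in
`ℝX₁ + dir L` has `f(Y) < 0` (else `B` is a point); so `HasPsdLift Bⁿ k → HasPsdLift L^{n+1}_+ k` and
the second-order cones have least psd-lift sizes `L³_+ = 2`, `L⁴_+ = 3`, `L⁵_+ = 4`.

**Factorization form** (`not_exists_psd_factorization_sphere_slack`): there are no maps
`A, B : S^{n−1} → S^k_+` (no regularity) with `Tr(A(x)B(y)) = 1 − ⟨x, y⟩` when `k < n` and
`C(k+1,2) < n + 3` — for `S³` and `k = 3` this is the "semidefinite representation of size `3` of the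
`3`-sphere" in the language of FGPRT Def. 2.2 / Thm 3.3: the infinite slack kernel of `S³` has no
size-`3` psd factorization although all its finite submatrices (the sphere slack matrices, among them
the matrices of Problems 9.1/9.2 up to scaling) have psd rank `≤ 4`; with
`exists_psd_factorization_sphere_slack` (size `s + t` for `n ≤ st`, all points of `ℝⁿ` as index set
of the tree's squared-distance factorization) the psd-factorization size of the `S³` kernel is
exactly `4` (`isLeast_psdFactorizationSize_sphere_slack_fin_four`). The proof of non-existence writes
out the "factorization ⇒ lift" direction of the Gouveia–Parrilo–Thomas theorem for the ball.

**Finite submatrices** (section `PsdRankCompactness`): the psd rank of a matrix with bounded entries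
and infinitely many rows/columns is determined by its finite submatrices
(`HasPsdFactorization.of_finite`; normal form `HasPsdFactorization.rescale_weak_of_finite`): normalise
each finite factorization by the tree's Briët–Dadush–Pokutta rescaling
(`HasPsdFactorization.rescale_weak`, `0 ⪯ X, Y ⪯ I`), extend by `0`, and take a cluster point of the
net in the compact product of Loewner boxes. Hence (`exists_finset_sphere_not_hasPsdFactorization`)
**some finite set of unit vectors of `ℝⁿ` has slack matrix `(1 − ⟨u, v⟩)_{u,v}` of psd rank `> k`**
whenever `k < n`, `C(k+1,2) < n+3` — on `S³` of psd rank exactly `4`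
(`exists_finset_sphere_isLeast_psdRank_four`): the finite-matrix form of "no smaller semidefinite
representation of the `3`-sphere" (whether the `10` vertices of the rectified `5`-cell, Problem 9.1,
are such a configuration stays open); and for every sequence of unit vectors dense in `S^{n−1}` the
leading `N × N` blocks have psd rank `> k` for all large `N`
(`exists_not_hasPsdFactorization_sphereSlack_of_dense`; a second cluster-point argument extends a
normalised factorization along the sequence to the closure of its range).
With the tree's FGPRT Thm. 3.3 direction "sandwiched lift ⇒ factorization"
(`HasPsdLift.hasPsdFactorization_pairSlackMatrix`) this becomes a statement about ONE polytope pair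
(section `SpherePair`): **there are finitely many unit vectors `x_i ∈ S^{n−1}` (the `±e_l` among them,
so the tangent polyhedron `Q = {⟨x_j, ·⟩ ≤ 1}` is bounded) such that no convex set `C` with
`conv{x_i} ⊆ C ⊆ Q` has an `S^k_+`-lift** (`exists_sphere_pair_not_hasPsdLift_between`) — the ball is
one such `C` — and on `S³` the least sandwiched-lift size and the psd rank of the pair slack matrix are
both exactly `4` (`exists_sphere_pair_isLeast_four`); FGPRT's Problem 9.1 asks whether the rectified
`5`-cell is such a configuration.

**Lifts ↔ factorizations for the ball** (section `BallSlackOperator`): Gouveia–Parrilo–Thomas,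
*Lifts of convex sets and cone factorizations* [GouveiaParriloThomas2013], Thm. 2.4 ("If `C` has a
proper `K`-lift then `S_C` is `K`-factorizable. Conversely, if `S_C` is `K`-factorizable then `C` has a
`K`-lift") with Cor. 2.6 (for nice `K`, e.g. `S^k_+`, properness is not needed), held text
`paper:arxiv-1111.3164` p05–p06, is PROVED for `C = Bⁿ`, `K = S^k_+` (slack operator
`S_C(x, y) = 1 − ⟨x, y⟩` on `ext(Bⁿ) × ext((Bⁿ)°) = S^{n−1} × S^{n−1}`):
`hasPsdLift_euclideanBall_iff_exists_psd_factorization`. Direction "⇐" is GPT's construction written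
out (`hasPsdLift_euclideanBall_of_psd_factorization`); direction "⇒" avoids conic duality for the
infinite operator: FGPRT Thm 3.3 (tree, with facial reduction) factorizes the pair slack matrix of
every finite configuration enlarged by `± e_l`, and compactness (`HasPsdFactorization.of_finite`)
passes to the operator (`exists_psd_factorization_of_hasPsdLift_euclideanBall`). Consequently the psd-lift
sizes of `Bⁿ` are exactly the psd-factorization sizes of the sphere kernel
(`setOf_hasPsdLift_euclideanBall_eq`). GPT's Example 2.7 (p06) — the explicit maps
`A(x₁,y₁) = [[1+x₁, y₁],[y₁, 1−x₁]]`, `B(x₂,y₂) = ½[[1−x₂, −y₂],[−y₂, 1+x₂]]` factorizing the disk's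
slack operator through `S²_+` — is typed and checked (`GouveiaParriloThomas2013_ex27`), and the exact
psd-factorization sizes of the sphere kernels are `2, 3, 4` for `S¹, S², S³`
(`isLeast_psdFactorizationSize_sphere_slack_fin_two/_fin_three/_fin_four`).

Summary of exact values: the least psd-lift size of `Bⁿ` is `n` for `n = 2, 3, 4` (`B²`: the
tree's `2 × 2` ellipse lift `hasPsdLift_ellipse` and the `k ≤ 1` case; `B³`: the spectraplex shadow above and the `k = 2` case of
the theorem; `B⁴`: the Frobenius-ball lift and the `k = 3` case), and lies in `{4, 5}` for `n = 5, 6`.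

NOT here: Problem 9.1 (psd rank of the `10 × 10` matrix `|I ∩ J|`, open); the exact values for `B⁵`,
`B⁶`, `B⁷`, `L⁶_+`; the general bound `dim ext C ≤ ⌊k²/4⌋` (needs semialgebraic dimension theory).
-/

noncomputable section

open Matrix Set MeasureTheory Module
open scoped MatrixOrder ENNReal NNReal Topology

namespace Literature.Combinatorics.Optimization

namespace SmallPsdLifts

open Literature.LinearAlgebra.Matrix.SpectrahedralConeExtremeRays (exists_posSemidef_add_sub_smul)

variable {k : ℕ}

/-! ### The lifted set `S^k_+ ∩ L` and non-extreme points -/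

/-- The set `S^k_+ ∩ L = {M ⪰ 0, M ∈ L}` whose linear image is a psd lift (`HasPsdLift`).
[cite: FawziEtAl2015, §3.1 eq. (3) (p09)] -/
def liftSet (L : AffineSubspace ℝ (Matrix (Fin k) (Fin k) ℝ)) : Set (Matrix (Fin k) (Fin k) ℝ) :=
  {M | M.PosSemidef ∧ M ∈ L}

/-- Membership in `liftSet L`. [cite: FawziEtAl2015, §3.1 eq. (3) (p09)] -/
theorem mem_liftSet_iff {L : AffineSubspace ℝ (Matrix (Fin k) (Fin k) ℝ)}
    {M : Matrix (Fin k) (Fin k) ℝ} : M ∈ liftSet L ↔ M.PosSemidef ∧ M ∈ L := Iff.rfl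

/-- `liftSet L` is convex. [folklore] -/
private theorem convex_liftSet (L : AffineSubspace ℝ (Matrix (Fin k) (Fin k) ℝ)) :
    Convex ℝ (liftSet L) := by
  intro X hX Y hY a b ha hb hab
  refine ⟨(hX.1.smul ha).add (hY.1.smul hb), ?_⟩
  have h := L.convex hX.2 hY.2 ha hb hab
  exact h

/-- **Perturbation kills extremality.** If `X ∈ S^k_+ ∩ L` and `D ≠ 0` is a direction of `L` with
`X ± D ⪰ 0`, then `X` is the midpoint of two distinct points of `S^k_+ ∩ L`, hence not extreme
("Then `Q` is not an extreme ray of `K`", the last step of the proof of BPT Lemma 4.39).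
[cite: BlekhermanParriloThomas2012, Ch. 4 §4.6 Lemma 4.39 proof (held chunk p0182)] -/
theorem not_mem_extremePoints_of_perturb {L : AffineSubspace ℝ (Matrix (Fin k) (Fin k) ℝ)}
    {X D : Matrix (Fin k) (Fin k) ℝ} (hX : X ∈ liftSet L) (hD : D ∈ L.direction) (hD0 : D ≠ 0)
    (hp : (X + D).PosSemidef) (hm : (X - D).PosSemidef) : X ∉ (liftSet L).extremePoints ℝ := by
  intro hext
  have hpL : X + D ∈ L := by
    have h := (AffineSubspace.vadd_mem_iff_mem_direction D hX.2).2 hD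
    rwa [vadd_eq_add, add_comm] at h
  have hmL : X - D ∈ L := by
    have h := (AffineSubspace.vadd_mem_iff_mem_direction (-D) hX.2).2 (L.direction.neg_mem hD)
    rwa [vadd_eq_add, neg_add_eq_sub] at h
  have hseg : X ∈ openSegment ℝ (X + D) (X - D) := by
    refine ⟨1 / 2, 1 / 2, by norm_num, by norm_num, by norm_num, ?_⟩
    rw [← smul_add]
    have : X + D + (X - D) = (2 : ℝ) • X := by rw [two_smul]; abel
    rw [this, smul_smul]
    norm_num
  have h : X + D = X := hext.2 ⟨hp, hpL⟩ ⟨hm, hmL⟩ hseg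
  have : D = 0 := by simpa using h
  exact hD0 this

/-! ### Extreme points of `S^k_+ ∩ L` are rank one when `k ≤ 3` and `L` has many directions -/

/-- **Rank-one extreme points.** Let `k ≤ 3`, and let `V` be a space of symmetric directions of
`L` of dimension `> k`. Then every extreme point of `S^k_+ ∩ L` is `v vᵀ`. Indeed an extreme `X`
of rank `≥ 2` has kernel of dimension `≤ k − 2 ≤ 1`, spanned by some `u`; the linear map
`D ↦ D u` from `V` (dimension `> k`) to `ℝ^k` has a non-zero `D` in its kernel, so
`ker X ⊆ ker D` and `X ± εD ⪰ 0` for small `ε` (BPT Lemma 4.39, Ramana–Goldman), contradicting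
extremality. [cite: BlekhermanParriloThomas2012, Ch. 4 §4.6 Lemma 4.39 (held chunk p0182)] -/
theorem exists_eq_vecMulVec_of_mem_extremePoints (hk : k ≤ 3)
    {L : AffineSubspace ℝ (Matrix (Fin k) (Fin k) ℝ)} (V : Submodule ℝ (Matrix (Fin k) (Fin k) ℝ))
    (hVL : V ≤ L.direction) (hVsym : ∀ D ∈ V, D.IsHermitian) (hdim : k < finrank ℝ V)
    {X : Matrix (Fin k) (Fin k) ℝ} (hX : X ∈ (liftSet L).extremePoints ℝ) :
    ∃ v : Fin k → ℝ, X = vecMulVec v v := by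
  classical
  have hXK : X ∈ liftSet L := hX.1
  have hpsd : X.PosSemidef := hXK.1
  by_cases hr : X.rank ≤ 1
  · exact exists_eq_vecMulVec_of_posSemidef_rank_le_one hpsd hr
  exfalso
  -- the kernel of `X` has dimension `≤ 1`
  set N : Submodule ℝ (Fin k → ℝ) := LinearMap.ker X.mulVecLin with hN
  have hrank : X.rank = finrank ℝ (LinearMap.range X.mulVecLin) := rfl
  have hsum := LinearMap.finrank_range_add_finrank_ker X.mulVecLin
  rw [Module.finrank_fin_fun] at hsum
  have hN1 : finrank ℝ N ≤ 1 := by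
    rw [hN]; omega
  obtain ⟨u, hu⟩ := finrank_le_one_iff.mp hN1
  -- a non-zero direction `D ∈ V` killing `u`
  let φ : V →ₗ[ℝ] (Fin k → ℝ) :=
    { toFun := fun D => (D : Matrix (Fin k) (Fin k) ℝ) *ᵥ (u : Fin k → ℝ)
      map_add' := fun D₁ D₂ => by simp [add_mulVec]
      map_smul' := fun c D => by simp [smul_mulVec] }
  have hker : LinearMap.ker φ ≠ ⊥ :=
    LinearMap.ker_ne_bot_of_finrank_lt (by simpa [Module.finrank_fin_fun] using hdim)
  obtain ⟨D, hDker, hD0⟩ := (Submodule.ne_bot_iff _).mp hker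
  have hDu : (D : Matrix (Fin k) (Fin k) ℝ) *ᵥ (u : Fin k → ℝ) = 0 := by
    simpa [φ] using hDker
  have hD0' : (D : Matrix (Fin k) (Fin k) ℝ) ≠ 0 := by
    intro h
    exact hD0 (by ext1; simpa using h)
  -- `ker X ⊆ ker D`
  have hkerXD : ∀ w, X *ᵥ w = 0 → (D : Matrix (Fin k) (Fin k) ℝ) *ᵥ w = 0 := by
    intro w hw
    have hwN : w ∈ N := by
      rw [hN, LinearMap.mem_ker, mulVecLin_apply]; exact hw
    obtain ⟨c, hc⟩ := hu ⟨w, hwN⟩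
    have hw' : w = c • (u : Fin k → ℝ) := by
      have := congrArg Subtype.val hc
      simpa using this.symm
    rw [hw', mulVec_smul, hDu, smul_zero]
  obtain ⟨ε, hε, hplus, hminus⟩ :=
    exists_posSemidef_add_sub_smul hpsd (hVsym D D.2) hkerXD
  refine not_mem_extremePoints_of_perturb hXK (hVL (V.smul_mem ε D.2)) ?_ hplus hminus hX
  exact smul_ne_zero hε.ne' hD0'

/-! ### Extreme points of the image lift to extreme points of `S^k_+ ∩ L` -/

/-- The real psd `k × k` matrices form a closed set. [folklore] -/
private theorem isClosed_setOf_posSemidef (k : ℕ) :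
    IsClosed {X : Matrix (Fin k) (Fin k) ℝ | X.PosSemidef} := by
  have hset : {X : Matrix (Fin k) (Fin k) ℝ | X.PosSemidef} =
      {X | Xᴴ = X} ∩ ⋂ x : Fin k → ℝ, {X | 0 ≤ star x ⬝ᵥ (X *ᵥ x)} := by
    ext X
    simp only [Set.mem_setOf_eq, Set.mem_inter_iff, Set.mem_iInter, posSemidef_iff_dotProduct_mulVec,
      Matrix.IsHermitian]
  rw [hset]
  refine (isClosed_eq continuous_id.matrix_conjTranspose continuous_id).inter ?_
  exact isClosed_iInter fun x => isClosed_le continuous_const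
    (continuous_const.dotProduct (continuous_id.matrix_mulVec continuous_const))

/-- An affine subspace of `k × k` real matrices is closed (a translate of a finite-dimensional
linear subspace). [folklore] -/
private theorem isClosed_affineSubspace (L : AffineSubspace ℝ (Matrix (Fin k) (Fin k) ℝ)) :
    IsClosed (L : Set (Matrix (Fin k) (Fin k) ℝ)) := by
  rcases (L : Set (Matrix (Fin k) (Fin k) ℝ)).eq_empty_or_nonempty with h | ⟨X₀, hX₀⟩
  · rw [h]; exact isClosed_empty
  have hdir : IsClosed (L.direction : Set (Matrix (Fin k) (Fin k) ℝ)) :=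
    L.direction.closed_of_finiteDimensional
  have hset : (L : Set (Matrix (Fin k) (Fin k) ℝ)) =
      (fun X => X - X₀) ⁻¹' (L.direction : Set (Matrix (Fin k) (Fin k) ℝ)) := by
    ext X
    simp only [Set.mem_preimage, SetLike.mem_coe]
    rw [← vsub_eq_sub, AffineSubspace.vsub_right_mem_direction_iff_mem hX₀]
  rw [hset]
  exact hdir.preimage (continuous_id.sub continuous_const)

/-- Entries of a psd matrix are bounded by its trace: `|X a b| ≤ Tr X`. [folklore] -/
private theorem abs_apply_le_trace_of_posSemidef {X : Matrix (Fin k) (Fin k) ℝ} (hX : X.PosSemidef)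
    (a b : Fin k) : |X a b| ≤ X.trace := by
  classical
  have hdiag : ∀ c, 0 ≤ X c c := fun c => hX.diag_nonneg
  have hsymm : X b a = X a b := by simpa using hX.1.apply a b
  -- the form at `e_a + e_b` and `e_a - e_b`
  have hform : ∀ v : Fin k → ℝ, 0 ≤ v ⬝ᵥ (X *ᵥ v) := fun v => by
    simpa using hX.dotProduct_mulVec_nonneg v
  have h1 := hform (Pi.single a 1 + Pi.single b 1)
  have h2 := hform (Pi.single a 1 - Pi.single b 1)
  simp only [mulVec_add, mulVec_sub, add_dotProduct, sub_dotProduct, dotProduct_add, dotProduct_sub,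
    mulVec_single_one, single_dotProduct, one_mul, Matrix.col_apply] at h1 h2
  rw [hsymm] at h1 h2
  -- `X a a + X b b ≤ 2 Tr X`
  have htr : X.trace = ∑ c, X c c := rfl
  have hsum_nonneg : 0 ≤ ∑ c, X c c := Finset.sum_nonneg fun c _ => hdiag c
  have haa : X a a ≤ ∑ c, X c c := Finset.single_le_sum (fun c _ => hdiag c) (Finset.mem_univ a)
  have hab : X a a + X b b ≤ 2 * X.trace := by
    rw [htr]
    by_cases h : a = b
    · subst h
      linarith
    · have hpair : X a a + X b b = ∑ c ∈ ({a, b} : Finset (Fin k)), X c c := by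
        rw [Finset.sum_pair h]
      have hle : ∑ c ∈ ({a, b} : Finset (Fin k)), X c c ≤ ∑ c, X c c :=
        Finset.sum_le_sum_of_subset_of_nonneg (Finset.subset_univ _) fun c _ _ => hdiag c
      linarith
  rw [abs_le]
  constructor <;> linarith

/-- The box `{X : |X a b| ≤ t}` of `k × k` matrices is compact. [folklore] -/
private theorem isCompact_box (k : ℕ) (t : ℝ) :
    IsCompact {X : Matrix (Fin k) (Fin k) ℝ | ∀ a b, |X a b| ≤ t} := by
  have h : IsCompact (Set.pi Set.univ fun _ : Fin k => Set.pi Set.univ fun _ : Fin k => Set.Icc (-t) t :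
      Set (Fin k → Fin k → ℝ)) :=
    isCompact_univ_pi fun _ => isCompact_univ_pi fun _ => isCompact_Icc
  have hset : {X : Matrix (Fin k) (Fin k) ℝ | ∀ a b, |X a b| ≤ t} =
      (Set.pi Set.univ fun _ : Fin k => Set.pi Set.univ fun _ : Fin k => Set.Icc (-t) t :
        Set (Fin k → Fin k → ℝ)) := by
    ext X
    change (∀ a b, |X a b| ≤ t) ↔
      ∀ a, a ∈ Set.univ → ∀ b, b ∈ Set.univ → X a b ∈ Set.Icc (-t) t
    simp only [Set.mem_univ, true_implies, Set.mem_Icc, abs_le]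
  rw [hset]
  exact h

/-- **Extreme points lift.** If `e` is an extreme point of `π(S^k_+ ∩ L)`, then `e = π X` for some
extreme point `X` of `S^k_+ ∩ L`: among the preimages of `e` (a closed face) minimise the trace
(a compact sub-level set, the psd entries being bounded by the trace), and take an extreme point
of the compact convex set of minimisers (Krein–Milman); it is extreme in `S^k_+ ∩ L` because both
the fibre of `e` and the set of trace-minimisers are faces. [folklore] -/
private theorem exists_mem_extremePoints_eq {E : Type*} [AddCommGroup E] [Module ℝ E]
    (L : AffineSubspace ℝ (Matrix (Fin k) (Fin k) ℝ)) (π : Matrix (Fin k) (Fin k) ℝ →ₗ[ℝ] E)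
    {e : E} (he : e ∈ (π '' liftSet L).extremePoints ℝ) :
    ∃ X ∈ (liftSet L).extremePoints ℝ, π X = e := by
  classical
  obtain ⟨X₀, hX₀K, hX₀e⟩ := he.1
  -- the fibre `G` of `e` in `S^k_+ ∩ L`
  set G : Set (Matrix (Fin k) (Fin k) ℝ) := {X | X ∈ liftSet L ∧ π X = e} with hG
  have hX₀G : X₀ ∈ G := ⟨hX₀K, hX₀e⟩
  have hGclosed : IsClosed G := by
    have hfib : IsClosed {X : Matrix (Fin k) (Fin k) ℝ | π X = e} := by
      have hker : IsClosed ((LinearMap.ker π : Submodule ℝ _) : Set (Matrix (Fin k) (Fin k) ℝ)) :=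
        (LinearMap.ker π).closed_of_finiteDimensional
      have hset : {X : Matrix (Fin k) (Fin k) ℝ | π X = e} =
          (fun X => X - X₀) ⁻¹' ((LinearMap.ker π : Submodule ℝ _) : Set (Matrix (Fin k) (Fin k) ℝ)) := by
        ext X
        simp only [Set.mem_setOf_eq, Set.mem_preimage, SetLike.mem_coe, LinearMap.mem_ker, map_sub,
          hX₀e, sub_eq_zero]
      rw [hset]
      exact hker.preimage (continuous_id.sub continuous_const)
    have : G = ({X | X.PosSemidef} ∩ (L : Set (Matrix (Fin k) (Fin k) ℝ))) ∩ {X | π X = e} := by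
      ext X
      simp only [hG, mem_liftSet_iff, Set.mem_setOf_eq, Set.mem_inter_iff, SetLike.mem_coe, and_assoc]
    rw [this]
    exact ((isClosed_setOf_posSemidef k).inter (isClosed_affineSubspace L)).inter hfib
  -- sub-level sets of the trace on `G` are compact
  have htrace_cont : Continuous fun X : Matrix (Fin k) (Fin k) ℝ => X.trace :=
    continuous_id.matrix_trace
  have hcpt : ∀ t : ℝ, IsCompact (G ∩ {X | X.trace ≤ t}) := fun t => by
    refine (isCompact_box k t).of_isClosed_subset (hGclosed.inter (isClosed_le htrace_cont
      continuous_const)) ?_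
    rintro X ⟨hXG, hXt⟩ a b
    exact (abs_apply_le_trace_of_posSemidef hXG.1.1 a b).trans hXt
  -- minimise the trace over `G`
  obtain ⟨X₁, ⟨hX₁G, hX₁t⟩, hmin⟩ := (hcpt X₀.trace).exists_isMinOn
    ⟨X₀, hX₀G, show X₀.trace ≤ X₀.trace from le_rfl⟩ htrace_cont.continuousOn
  set m : ℝ := X₁.trace with hm
  have hmin' : ∀ Y ∈ G, m ≤ Y.trace := by
    intro Y hY
    by_contra hlt
    push Not at hlt
    have hYt : Y ∈ G ∩ {X | X.trace ≤ X₀.trace} := ⟨hY, le_trans hlt.le hX₁t⟩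
    have h2 := hmin hYt
    rw [Set.mem_setOf_eq] at h2
    exact absurd h2 (not_le.mpr hlt)
  -- the face `F` of trace-minimisers: compact, convex, non-empty
  set F : Set (Matrix (Fin k) (Fin k) ℝ) := G ∩ {X | X.trace ≤ m} with hF
  have hFcpt : IsCompact F := hcpt m
  have hFne : F.Nonempty := ⟨X₁, hX₁G, show X₁.trace ≤ m from le_rfl⟩
  haveI : LocallyConvexSpace ℝ (Matrix (Fin k) (Fin k) ℝ) := Pi.locallyConvexSpace
  obtain ⟨X, hXF⟩ := hFcpt.extremePoints_nonempty hFne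
  refine ⟨X, ?_, hXF.1.1.2⟩
  -- `X` is extreme in `S^k_+ ∩ L`
  rw [mem_extremePoints]
  refine ⟨hXF.1.1.1, ?_⟩
  intro Y hY Z hZ hseg
  obtain ⟨a, b, ha, hb, hab, hXYZ⟩ := hseg
  -- both ends lie in the fibre of `e`
  have hπseg : e ∈ openSegment ℝ (π Y) (π Z) := by
    refine ⟨a, b, ha, hb, hab, ?_⟩
    rw [← hXF.1.1.2, ← hXYZ, map_add, map_smul, map_smul]
  have hπYZ := (mem_extremePoints.mp he).2 (π Y) ⟨Y, hY, rfl⟩ (π Z) ⟨Z, hZ, rfl⟩ hπseg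
  have hYG : Y ∈ G := ⟨hY, hπYZ.1⟩
  have hZG : Z ∈ G := ⟨hZ, hπYZ.2⟩
  -- both ends minimise the trace
  have hXm : X.trace ≤ m := hXF.1.2
  have htr : X.trace = a * Y.trace + b * Z.trace := by
    rw [← hXYZ, Matrix.trace_add, Matrix.trace_smul, Matrix.trace_smul, smul_eq_mul, smul_eq_mul]
  have h1 := hmin' Y hYG
  have h2 := hmin' Z hZG
  have habm : a * m + b * m = m := by rw [← add_mul, hab, one_mul]
  have hbZ : b * m ≤ b * Z.trace := mul_le_mul_of_nonneg_left h2 hb.le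
  have haY : a * m ≤ a * Y.trace := mul_le_mul_of_nonneg_left h1 ha.le
  have hYm : Y.trace ≤ m := by
    by_contra hlt
    push Not at hlt
    have : a * m < a * Y.trace := mul_lt_mul_of_pos_left hlt ha
    linarith
  have hZm : Z.trace ≤ m := by
    by_contra hlt
    push Not at hlt
    have : b * m < b * Z.trace := mul_lt_mul_of_pos_left hlt hb
    linarith
  exact (mem_extremePoints.mp hXF).2 Y ⟨hYG, hYm⟩ Z ⟨hZG, hZm⟩ ⟨a, b, ha, hb, hab, hXYZ⟩

/-! ### The direction space of `S^k_+ ∩ L` and the rank-one covering of the extreme points -/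

/-- Directions of `S^k_+ ∩ L` are directions of `L`. [folklore] -/
private theorem vectorSpan_liftSet_le_direction (L : AffineSubspace ℝ (Matrix (Fin k) (Fin k) ℝ)) :
    vectorSpan ℝ (liftSet L) ≤ L.direction := by
  rw [AffineSubspace.direction]
  exact vectorSpan_mono ℝ fun X hX => hX.2

/-- Directions of `S^k_+ ∩ L` are symmetric matrices (differences of psd matrices). [folklore] -/
private theorem isHermitian_of_mem_vectorSpan_liftSet (L : AffineSubspace ℝ (Matrix (Fin k) (Fin k) ℝ))
    {D : Matrix (Fin k) (Fin k) ℝ} (hD : D ∈ vectorSpan ℝ (liftSet L)) : D.IsHermitian := by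
  rw [vectorSpan_def] at hD
  induction hD using Submodule.span_induction with
  | mem x hx =>
    obtain ⟨A, hA, B, hB, rfl⟩ := hx
    change (A - B).IsHermitian
    exact hA.1.1.sub hB.1.1
  | zero => exact isHermitian_zero
  | add x y _ _ hx hy => exact hx.add hy
  | smul c x _ hx =>
    unfold Matrix.IsHermitian at hx ⊢
    rw [conjTranspose_smul, hx, star_trivial]

/-- The dimension of the image is at most that of the direction space of `S^k_+ ∩ L`:
`dim vectorSpan(π(S^k_+ ∩ L)) ≤ dim vectorSpan(S^k_+ ∩ L)`. [folklore] -/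
private theorem finrank_vectorSpan_image_le {E : Type*} [AddCommGroup E] [Module ℝ E]
    (L : AffineSubspace ℝ (Matrix (Fin k) (Fin k) ℝ)) (π : Matrix (Fin k) (Fin k) ℝ →ₗ[ℝ] E) :
    finrank ℝ (vectorSpan ℝ (π '' liftSet L)) ≤ finrank ℝ (vectorSpan ℝ (liftSet L)) := by
  have h : Submodule.map π (vectorSpan ℝ (liftSet L)) = vectorSpan ℝ (π '' liftSet L) := by
    have := π.toAffineMap.map_vectorSpan (s := liftSet L)
    simpa using this
  rw [← h]
  exact Submodule.finrank_map_le π _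

/-- **Extreme points of a small psd lift come from rank-one matrices.** Let `k ≤ 3` and let
`C = π(S^k_+ ∩ L)` span affinely more than `k` dimensions. Then every extreme point of `C` is
`π(v vᵀ)` for some `v ∈ ℝ^k` with `v vᵀ ∈ L`. [cite: BlekhermanParriloThomas2012, Ch. 4 §4.6
Lemma 4.39 (held chunk p0182)] [cite: FawziEtAl2015, §9.1 (p24)] -/
theorem extremePoints_subset_image_vecMulVec (hk : k ≤ 3) {E : Type*} [AddCommGroup E]
    [Module ℝ E] (L : AffineSubspace ℝ (Matrix (Fin k) (Fin k) ℝ))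
    (π : Matrix (Fin k) (Fin k) ℝ →ₗ[ℝ] E) (hdim : k < finrank ℝ (vectorSpan ℝ (π '' liftSet L))) :
    (π '' liftSet L).extremePoints ℝ ⊆
      (fun v : Fin k → ℝ => π (vecMulVec v v)) '' {v | vecMulVec v v ∈ L} := by
  intro e he
  obtain ⟨X, hX, hXe⟩ := exists_mem_extremePoints_eq L π he
  obtain ⟨v, rfl⟩ := exists_eq_vecMulVec_of_mem_extremePoints hk (vectorSpan ℝ (liftSet L))
    (vectorSpan_liftSet_le_direction L) (fun D hD => isHermitian_of_mem_vectorSpan_liftSet L hD)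
    (lt_of_lt_of_le hdim (finrank_vectorSpan_image_le L π)) hX
  exact ⟨v, hX.1.2, hXe⟩

/-! ### The parameters `v` with `v vᵀ ∈ L` form a Lebesgue-null set -/

/-- `f(v vᵀ) = Σ_{a,b} v_a v_b f(E_{ab})` for a linear functional `f`. [folklore] -/
private theorem dual_vecMulVec_eq_sum (f : Module.Dual ℝ (Matrix (Fin k) (Fin k) ℝ)) (v : Fin k → ℝ) :
    f (vecMulVec v v) = ∑ a, ∑ b, v a * v b * f (Matrix.single a b 1) := by
  conv_lhs => rw [matrix_eq_sum_single (vecMulVec v v)]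
  rw [map_sum]
  refine Finset.sum_congr rfl fun a _ => ?_
  rw [map_sum]
  refine Finset.sum_congr rfl fun b _ => ?_
  rw [vecMulVec_apply, ← smul_eq_mul (a := v a * v b) (b := f _), ← map_smul, Matrix.smul_single,
    smul_eq_mul, mul_one]

/-- `f(S) = Σ_{a,b} S_{ab} f(E_{ab})` for a linear functional `f`. [folklore] -/
private theorem dual_apply_eq_sum (f : Module.Dual ℝ (Matrix (Fin k) (Fin k) ℝ))
    (S : Matrix (Fin k) (Fin k) ℝ) : f S = ∑ a, ∑ b, S a b * f (Matrix.single a b 1) := by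
  conv_lhs => rw [matrix_eq_sum_single S]
  rw [map_sum]
  refine Finset.sum_congr rfl fun a _ => ?_
  rw [map_sum]
  refine Finset.sum_congr rfl fun b _ => ?_
  rw [← smul_eq_mul (a := S a b) (b := f _), ← map_smul, Matrix.smul_single, smul_eq_mul, mul_one]

/-- A linear functional vanishing on every `v vᵀ` vanishes on every symmetric matrix
(`E_{ab} + E_{ba} = (e_a + e_b)(e_a + e_b)ᵀ − e_a e_aᵀ − e_b e_bᵀ`). [folklore] -/
private theorem dual_apply_eq_zero_of_forall_vecMulVec (f : Module.Dual ℝ (Matrix (Fin k) (Fin k) ℝ))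
    (hf : ∀ v : Fin k → ℝ, f (vecMulVec v v) = 0) {S : Matrix (Fin k) (Fin k) ℝ}
    (hS : S.IsHermitian) : f S = 0 := by
  classical
  -- `f(E_aa) = 0` and `f(E_ab) + f(E_ba) = 0`
  have hdiag : ∀ a : Fin k, f (Matrix.single a a 1) = 0 := fun a => by
    rw [single_eq_single_vecMulVec_single]; exact hf _
  have hpair : ∀ a b : Fin k, f (Matrix.single a b 1) + f (Matrix.single b a 1) = 0 := by
    intro a b
    have h := hf (Pi.single a 1 + Pi.single b 1)
    rw [add_vecMulVec, vecMulVec_add, vecMulVec_add, ← single_eq_single_vecMulVec_single,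
      ← single_eq_single_vecMulVec_single, ← single_eq_single_vecMulVec_single,
      ← single_eq_single_vecMulVec_single, map_add, map_add, map_add, hdiag, hdiag] at h
    linarith
  have hsymm : ∀ a b, S b a = S a b := fun a b => by simpa using hS.apply a b
  have h1 : f S = ∑ a, ∑ b, S a b * f (Matrix.single a b 1) := dual_apply_eq_sum f S
  have h2 : f S = ∑ a, ∑ b, S a b * f (Matrix.single b a 1) := by
    rw [h1, Finset.sum_comm]
    exact Finset.sum_congr rfl fun a _ => Finset.sum_congr rfl fun b _ => by rw [hsymm a b]
  have h3 : (∑ a, ∑ b, S a b * f (Matrix.single a b 1)) +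
      ∑ a, ∑ b, S a b * f (Matrix.single b a 1) = 0 := by
    rw [← Finset.sum_add_distrib]
    refine Finset.sum_eq_zero fun a _ => ?_
    rw [← Finset.sum_add_distrib]
    refine Finset.sum_eq_zero fun b _ => ?_
    rw [← mul_add, hpair, mul_zero]
  linarith

/-- The quadratic function `v ↦ f(v vᵀ) − c` is real analytic. [folklore] -/
private theorem analyticOnNhd_dual_vecMulVec (f : Module.Dual ℝ (Matrix (Fin k) (Fin k) ℝ)) (c : ℝ) :
    AnalyticOnNhd ℝ (fun v : Fin k → ℝ => f (vecMulVec v v) - c) Set.univ := by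
  have hcoord : ∀ a : Fin k, AnalyticOnNhd ℝ (fun v : Fin k → ℝ => v a) Set.univ := fun a =>
    (ContinuousLinearMap.proj a : (Fin k → ℝ) →L[ℝ] ℝ).analyticOnNhd Set.univ
  have h : AnalyticOnNhd ℝ
      (fun v : Fin k → ℝ => ∑ a, ∑ b, v a * v b * f (Matrix.single a b 1)) Set.univ := by
    refine Finset.analyticOnNhd_fun_sum Finset.univ fun a _ => ?_
    exact Finset.analyticOnNhd_fun_sum Finset.univ fun b _ =>
      ((hcoord a).mul (hcoord b)).mul analyticOnNhd_const
  have heq : (fun v : Fin k → ℝ => f (vecMulVec v v) - c) =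
      fun v => (∑ a, ∑ b, v a * v b * f (Matrix.single a b 1)) - c := by
    funext v; rw [dual_vecMulVec_eq_sum]
  rw [heq]
  exact h.sub analyticOnNhd_const

/-- **Null parameter set.** If some symmetric matrix is not a direction of `L`, then the set of
`v ∈ ℝ^k` with `v vᵀ ∈ L` is Lebesgue-null: it lies in the zero set of the non-trivial quadratic
`v ↦ f(v vᵀ) − f(X₀)` for a linear functional `f` killing the directions of `L` but not all
symmetric matrices, and zero sets of non-trivial real analytic functions are null.
[cite: Mityagin2015, Proposition 1] -/
theorem volume_setOf_vecMulVec_mem_eq_zero (L : AffineSubspace ℝ (Matrix (Fin k) (Fin k) ℝ))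
    {S : Matrix (Fin k) (Fin k) ℝ} (hS : S.IsHermitian) (hSL : S ∉ L.direction) :
    volume {v : Fin k → ℝ | vecMulVec v v ∈ L} = 0 := by
  classical
  rcases (L : Set (Matrix (Fin k) (Fin k) ℝ)).eq_empty_or_nonempty with hempty | ⟨X₀, hX₀⟩
  · have : {v : Fin k → ℝ | vecMulVec v v ∈ L} = ∅ := by
      ext v
      simp only [Set.mem_setOf_eq, Set.mem_empty_iff_false, iff_false]
      intro hv
      have : vecMulVec v v ∈ (L : Set (Matrix (Fin k) (Fin k) ℝ)) := hv
      rw [hempty] at this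
      exact this
    rw [this, measure_empty]
  obtain ⟨f, hfS, hfL⟩ := Submodule.exists_dual_map_eq_bot_of_notMem hSL inferInstance
  have hfdir : ∀ D ∈ L.direction, f D = 0 := fun D hD => by
    have h : f D ∈ Submodule.map f L.direction := Submodule.mem_map_of_mem hD
    rw [hfL] at h
    exact (Submodule.mem_bot ℝ).mp h
  set c : ℝ := f X₀ with hc
  set A : (Fin k → ℝ) → ℝ := fun v => f (vecMulVec v v) - c with hA
  have hsub : {v : Fin k → ℝ | vecMulVec v v ∈ L} ⊆ {v ∈ Set.univ | A v = 0} := by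
    intro v hv
    refine ⟨Set.mem_univ _, ?_⟩
    have hd : f (vecMulVec v v -ᵥ X₀) = 0 := hfdir _ (AffineSubspace.vsub_mem_direction hv hX₀)
    rw [vsub_eq_sub, map_sub] at hd
    change f (vecMulVec v v) - c = 0
    rw [hc]; exact hd
  -- `A` is not identically zero, since `f` does not kill the symmetric matrix `S`
  have hne : ∃ v ∈ (Set.univ : Set (Fin k → ℝ)), A v ≠ 0 := by
    by_contra hall
    push Not at hall
    have hc0 : c = 0 := by
      have h0 := hall 0 (Set.mem_univ _)
      simp only [hA] at h0
      have : vecMulVec (0 : Fin k → ℝ) (0 : Fin k → ℝ) = (0 : Matrix (Fin k) (Fin k) ℝ) := by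
        ext a b; simp [vecMulVec_apply]
      rw [this, map_zero, zero_sub, neg_eq_zero] at h0
      exact h0
    have hvv : ∀ v : Fin k → ℝ, f (vecMulVec v v) = 0 := fun v => by
      have := hall v (Set.mem_univ _)
      simp only [hA, hc0, sub_zero] at this
      exact this
    exact hfS (dual_apply_eq_zero_of_forall_vecMulVec f hvv hS)
  have hnull := Literature.Analysis.Calculus.Mityagin2015.volume_zeroSet_null_pi isOpen_univ
    isPreconnected_univ (analyticOnNhd_dual_vecMulVec f c) hne
  exact measure_mono_null hsub hnull

/-! ### Hausdorff-measure consequences -/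

/-- `π(v vᵀ) = Σ_{a,b} (v_a v_b) • π(E_{ab})` for a linear map `π`. [folklore] -/
private theorem linearMap_vecMulVec_eq_sum {E : Type*} [AddCommGroup E] [Module ℝ E]
    (π : Matrix (Fin k) (Fin k) ℝ →ₗ[ℝ] E) (v : Fin k → ℝ) :
    π (vecMulVec v v) = ∑ a, ∑ b, (v a * v b) • π (Matrix.single a b 1) := by
  conv_lhs => rw [matrix_eq_sum_single (vecMulVec v v)]
  rw [map_sum]
  refine Finset.sum_congr rfl fun a _ => ?_
  rw [map_sum]
  refine Finset.sum_congr rfl fun b _ => ?_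
  rw [vecMulVec_apply, ← map_smul, Matrix.smul_single, smul_eq_mul, mul_one]

/-- The quadratic map `v ↦ π(v vᵀ) ∈ ℝ^n` is real analytic. [folklore] -/
private theorem analyticOnNhd_vecMulVec_map {n : ℕ} (π : Matrix (Fin k) (Fin k) ℝ →ₗ[ℝ] (Fin n → ℝ)) :
    AnalyticOnNhd ℝ (fun v : Fin k → ℝ => π (vecMulVec v v)) Set.univ := by
  have hcoord : ∀ a : Fin k, AnalyticOnNhd ℝ (fun v : Fin k → ℝ => v a) Set.univ := fun a =>
    (ContinuousLinearMap.proj a : (Fin k → ℝ) →L[ℝ] ℝ).analyticOnNhd Set.univ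
  have heq : (fun v : Fin k → ℝ => π (vecMulVec v v)) =
      fun v l => ∑ a, ∑ b, v a * v b * π (Matrix.single a b 1) l := by
    funext v l
    rw [linearMap_vecMulVec_eq_sum, Finset.sum_apply]
    refine Finset.sum_congr rfl fun a _ => ?_
    rw [Finset.sum_apply]
    refine Finset.sum_congr rfl fun b _ => ?_
    rw [Pi.smul_apply, smul_eq_mul]
  rw [heq]
  refine AnalyticOnNhd.pi
    (f := fun l (v : Fin k → ℝ) => ∑ a, ∑ b, v a * v b * π (Matrix.single a b 1) l) fun l => ?_
  refine Finset.analyticOnNhd_fun_sum Finset.univ fun a _ => ?_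
  exact Finset.analyticOnNhd_fun_sum Finset.univ fun b _ =>
    ((hcoord a).mul (hcoord b)).mul analyticOnNhd_const

/-- On `ℝ^k` with the sup metric, `μH[k]` is Lebesgue measure. [folklore] -/
private theorem hausdorffMeasure_fin_eq_volume (k : ℕ) :
    (μH[(k : ℝ)] : Measure (Fin k → ℝ)) = volume := by
  have h := hausdorffMeasure_pi_real (ι := Fin k)
  simpa using h

/-- **Null sets have `μH[k]`-null images under `v ↦ π(v vᵀ)`**: the map is locally Lipschitz
(real analytic), so on each ball it does not increase `μH[k]` by more than a constant factor, and
`μH[k] = volume` on `ℝ^k`. [folklore] -/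
private theorem hausdorffMeasure_image_vecMulVec_map_null {n : ℕ}
    (π : Matrix (Fin k) (Fin k) ℝ →ₗ[ℝ] (Fin n → ℝ)) {Z : Set (Fin k → ℝ)} (hZ : volume Z = 0) :
    μH[(k : ℝ)] ((fun v : Fin k → ℝ => π (vecMulVec v v)) '' Z) = 0 := by
  set g : (Fin k → ℝ) → (Fin n → ℝ) := fun v => π (vecMulVec v v) with hg
  have hZH : μH[(k : ℝ)] Z = 0 := by rw [hausdorffMeasure_fin_eq_volume]; exact hZ
  have hcover : Z = ⋃ N : ℕ, Z ∩ Metric.closedBall (0 : Fin k → ℝ) N := by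
    ext v
    simp only [Set.mem_iUnion, Set.mem_inter_iff, Metric.mem_closedBall, dist_zero_right]
    constructor
    · intro hv
      obtain ⟨N, hN⟩ := exists_nat_ge ‖v‖
      exact ⟨N, hv, hN⟩
    · rintro ⟨N, hv, -⟩
      exact hv
  rw [hcover, Set.image_iUnion]
  refine measure_iUnion_null fun N => ?_
  have hloc : LocallyLipschitz g :=
    ((analyticOnNhd_vecMulVec_map π).contDiff (n := 1)).locallyLipschitz
  obtain ⟨K, hK⟩ : ∃ K, LipschitzOnWith K g (Metric.closedBall (0 : Fin k → ℝ) N) :=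
    hloc.locallyLipschitzOn.exists_lipschitzOnWith_of_compact (isCompact_closedBall 0 (N : ℝ))
  have h1 := (hK.mono Set.inter_subset_right).hausdorffMeasure_image_le (d := (k : ℝ))
    (by positivity) (s := Z ∩ Metric.closedBall (0 : Fin k → ℝ) N)
  have h2 : μH[(k : ℝ)] (Z ∩ Metric.closedBall (0 : Fin k → ℝ) N) = 0 :=
    measure_mono_null Set.inter_subset_left hZH
  rw [h2, mul_zero] at h1
  exact nonpos_iff_eq_zero.mp h1

/-- **The unit sphere `S^m ⊆ ℝ^{m+1}` has positive `μH[m]`**: the coordinate projection onto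
`ℝ^m` is `1`-Lipschitz (sup metrics) and maps the sphere onto the unit ball, which contains a
sup-metric ball of positive Lebesgue measure `= μH[m]`. [folklore] -/
private theorem hausdorffMeasure_sphere_pos (m : ℕ) :
    0 < μH[(m : ℝ)] {x : Fin (m + 1) → ℝ | ∑ l, x l ^ 2 = 1} := by
  set S : Set (Fin (m + 1) → ℝ) := {x | ∑ l, x l ^ 2 = 1} with hS
  set P : (Fin (m + 1) → ℝ) → (Fin m → ℝ) := fun x j => x (Fin.castSucc j) with hP
  have hPlip : LipschitzWith 1 P := by
    refine LipschitzWith.of_dist_le_mul fun x y => ?_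
    rw [NNReal.coe_one, one_mul]
    refine (dist_pi_le_iff dist_nonneg).2 fun j => ?_
    exact dist_le_pi_dist x y (Fin.castSucc j)
  set r : ℝ := 1 / ((m : ℝ) + 1) with hr
  have hrpos : 0 < r := by positivity
  have hmr : (m : ℝ) * r ^ 2 ≤ 1 := by
    rw [hr, div_pow, one_pow, mul_one_div, div_le_one (by positivity)]
    nlinarith
  have hball : Metric.ball (0 : Fin m → ℝ) r ⊆ P '' S := by
    intro u hu
    rw [Metric.mem_ball, dist_zero_right] at hu
    have hul : ∀ j, u j ^ 2 ≤ r ^ 2 := fun j => by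
      have h1 : |u j| ≤ ‖u‖ := by
        have := norm_le_pi_norm u j
        rwa [Real.norm_eq_abs] at this
      have h2 : |u j| ≤ r := h1.trans hu.le
      rw [abs_le] at h2
      exact sq_le_sq' h2.1 h2.2
    have hsum : ∑ j, u j ^ 2 ≤ 1 := by
      calc ∑ j, u j ^ 2 ≤ ∑ _j : Fin m, r ^ 2 := Finset.sum_le_sum fun j _ => hul j
        _ = (m : ℝ) * r ^ 2 := by simp
        _ ≤ 1 := hmr
    refine ⟨Fin.snoc u (Real.sqrt (1 - ∑ j, u j ^ 2)), ?_, ?_⟩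
    · change ∑ l, (Fin.snoc u (Real.sqrt (1 - ∑ j, u j ^ 2)) : Fin (m + 1) → ℝ) l ^ 2 = 1
      rw [Fin.sum_univ_castSucc]
      simp only [Fin.snoc_castSucc, Fin.snoc_last]
      rw [Real.sq_sqrt (by linarith)]
      ring
    · funext j
      simp only [hP, Fin.snoc_castSucc]
  have hvol : 0 < volume (Metric.ball (0 : Fin m → ℝ) r) := Metric.measure_ball_pos volume 0 hrpos
  have h1 : volume (Metric.ball (0 : Fin m → ℝ) r) ≤ μH[(m : ℝ)] (P '' S) := by
    rw [← hausdorffMeasure_fin_eq_volume]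
    exact measure_mono hball
  have h2 := hPlip.hausdorffMeasure_image_le (d := (m : ℝ)) (by positivity) S
  rw [ENNReal.coe_one, ENNReal.one_rpow, one_mul] at h2
  exact lt_of_lt_of_le (lt_of_lt_of_le hvol h1) h2

/-- For `k < n` the unit sphere of `ℝ^n` has positive `μH[k]` (`μH[k] ≥ μH[n−1]`).
[folklore] -/
private theorem hausdorffMeasure_sphere_pos_of_lt {k n : ℕ} (hkn : k < n) :
    0 < μH[(k : ℝ)] {x : Fin n → ℝ | ∑ l, x l ^ 2 = 1} := by
  obtain ⟨m, rfl⟩ := Nat.exists_eq_add_one_of_ne_zero (by omega : n ≠ 0)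
  have h := hausdorffMeasure_sphere_pos m
  have hkm : (k : ℝ) ≤ (m : ℝ) := by exact_mod_cast (by omega : k ≤ m)
  exact lt_of_lt_of_le h (Measure.hausdorffMeasure_mono hkm _)

end SmallPsdLifts

open SmallPsdLifts

/-! ### The theorems -/

/-- **Psd lifts of size `k ≤ 3` have `μH[k]`-null sets of extreme points.** If `C ⊆ ℝ^n` has a psd
lift `C = π(S^k_+ ∩ L)` of size `k ≤ 3` and its affine span has dimension `> k`, then the set of
extreme points of `C` has `k`-dimensional Hausdorff measure zero. Mechanism: extreme points of `C`
lift to extreme points of `S^k_+ ∩ L` (Krein–Milman on the trace-minimising face of a fibre);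
these are rank one by the Ramana–Goldman/BPT perturbation lemma (a rank-`≥ 2` point has kernel of
dimension `≤ 1` when `k ≤ 3`, and a direction space of dimension `> k` contains a non-zero
symmetric `D` killing it); so the extreme points lie in `π{v vᵀ : v vᵀ ∈ L}`, the locally Lipschitz
image of the zero set of a non-trivial quadratic on `ℝ^k` (unless all symmetric matrices are
directions of `L`, when `C` is a cone and has at most one extreme point), which is Lebesgue-null.
PROVED here; the statement is not taken from print (it answers, for `k = 3`, the parenthetical
question of [FawziEtAl2015, §9.1 p24] below). [cite: BlekhermanParriloThomas2012, Ch. 4 §4.6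
Lemma 4.39 (held chunk p0182)] [cite: FawziEtAl2015, §9.1 Problem 9.1 (p24)] -/
theorem hausdorffMeasure_extremePoints_eq_zero_of_hasPsdLift {k n : ℕ} (hk : k ≤ 3)
    {C : Set (Fin n → ℝ)} (hC : HasPsdLift C k) (hdim : k < finrank ℝ (vectorSpan ℝ C)) :
    μH[(k : ℝ)] (C.extremePoints ℝ) = 0 := by
  classical
  obtain ⟨L, π, rfl⟩ := hC
  change μH[(k : ℝ)] ((π '' liftSet L).extremePoints ℝ) = 0
  change k < finrank ℝ (vectorSpan ℝ (π '' liftSet L)) at hdim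
  by_cases hsym : ∃ S : Matrix (Fin k) (Fin k) ℝ, S.IsHermitian ∧ S ∉ L.direction
  · obtain ⟨S, hS, hSL⟩ := hsym
    exact measure_mono_null (extremePoints_subset_image_vecMulVec hk L π hdim)
      (hausdorffMeasure_image_vecMulVec_map_null π (volume_setOf_vecMulVec_mem_eq_zero L hS hSL))
  · -- every symmetric matrix is a direction of `L`: `C` is a cone with vertex `0 = π 0`
    push Not at hsym
    have hsub : (π '' liftSet L).extremePoints ℝ ⊆ {0} := by
      intro e he
      obtain ⟨X, hX, hXe⟩ := he.1
      have h0L : (0 : Matrix (Fin k) (Fin k) ℝ) ∈ liftSet L := by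
        refine ⟨PosSemidef.zero, ?_⟩
        have h := (AffineSubspace.vadd_mem_iff_mem_direction (-X) hX.2).2 (hsym _ hX.1.1.neg)
        simpa using h
      have h2L : (2 : ℝ) • X ∈ liftSet L := by
        refine ⟨hX.1.smul (by norm_num), ?_⟩
        have h := (AffineSubspace.vadd_mem_iff_mem_direction X hX.2).2 (hsym _ hX.1.1)
        rw [vadd_eq_add, ← two_smul ℝ X] at h
        exact h
      by_contra hne
      have hseg : e ∈ openSegment ℝ (π 0) (π ((2 : ℝ) • X)) := by
        refine ⟨1 / 2, 1 / 2, by norm_num, by norm_num, by norm_num, ?_⟩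
        rw [map_zero, map_smul, smul_zero, zero_add, smul_smul, hXe]
        norm_num
      have h := he.2 ⟨0, h0L, rfl⟩ ⟨_, h2L, rfl⟩ hseg
      rw [map_zero] at h
      exact hne h.symm
    -- `k ≥ 1`, for otherwise `C` is a point
    have hk0 : 0 < k := by
      rcases Nat.eq_zero_or_pos k with rfl | hpos
      · exfalso
        have hsub1 : (π '' liftSet L).Subsingleton := by
          rintro _ ⟨X, -, rfl⟩ _ ⟨Y, -, rfl⟩
          rw [Subsingleton.elim X Y]
        have hbot : vectorSpan ℝ (π '' liftSet L) = ⊥ := vectorSpan_of_subsingleton ℝ hsub1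
        rw [hbot, finrank_bot] at hdim
        exact Nat.lt_irrefl 0 hdim
      · exact hpos
    haveI := Measure.nullSingletonClass_hausdorff (Fin n → ℝ) (d := (k : ℝ)) (by exact_mod_cast hk0)
    exact measure_mono_null hsub (measure_singleton (0 : Fin n → ℝ))

/-- The unit ball of `ℝ^n` spans everything affinely (so the dimension hypotheses of the psd-lift
bounds apply to it, as on p24). [cite: FawziEtAl2015, §9.1 Problem 9.1 (p24)] -/
theorem vectorSpan_euclideanBall_eq_top (n : ℕ) :
    vectorSpan ℝ {x : Fin n → ℝ | ∑ l, x l ^ 2 ≤ 1} = ⊤ := by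
  classical
  have h0 : (0 : Fin n → ℝ) ∈ {x : Fin n → ℝ | ∑ l, x l ^ 2 ≤ 1} := by simp
  have h1 : ∀ l : Fin n,
      (Pi.single l (1 : ℝ) : Fin n → ℝ) ∈ {x : Fin n → ℝ | ∑ l, x l ^ 2 ≤ 1} := by
    intro l
    simp only [Set.mem_setOf_eq]
    rw [Finset.sum_eq_single l (fun m _ hm => by simp [hm]) (by simp)]
    simp
  refine Submodule.eq_top_iff'.mpr fun x => ?_
  rw [← (Pi.basisFun ℝ (Fin n)).sum_repr x]
  refine Submodule.sum_mem _ fun l _ => Submodule.smul_mem _ _ ?_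
  have := vsub_mem_vectorSpan ℝ (h1 l) h0
  simpa [Pi.basisFun_apply] using this

/-- Unit vectors are extreme points of the unit ball (strict convexity of the Euclidean norm:
`a|y|² + b|z|² − |ay + bz|² = ab|y − z|²`): the "`3`-sphere" of p24 inside the extreme points
of the unit ball of `ℝ⁴`. [cite: FawziEtAl2015, §9.1 Problem 9.1 (p24)] -/
theorem sphere_subset_extremePoints_euclideanBall (n : ℕ) :
    {x : Fin n → ℝ | ∑ l, x l ^ 2 = 1} ⊆ ({x : Fin n → ℝ | ∑ l, x l ^ 2 ≤ 1}).extremePoints ℝ := by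
  intro x hx
  rw [mem_extremePoints]
  refine ⟨le_of_eq hx, fun y hy z hz hseg => ?_⟩
  obtain ⟨a, b, ha, hb, hab, hxyz⟩ := hseg
  have hcoord : ∀ l, x l = a * y l + b * z l := fun l => by
    rw [← hxyz]; simp
  have hb' : b = 1 - a := by linarith
  have key : a * b * ∑ l, (y l - z l) ^ 2 =
      a * ∑ l, y l ^ 2 + b * ∑ l, z l ^ 2 - ∑ l, x l ^ 2 := by
    rw [Finset.mul_sum, Finset.mul_sum, Finset.mul_sum, ← Finset.sum_add_distrib,
      ← Finset.sum_sub_distrib]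
    refine Finset.sum_congr rfl fun l _ => ?_
    rw [hcoord l, hb']
    ring
  have hy' : ∑ l, y l ^ 2 ≤ 1 := hy
  have hz' : ∑ l, z l ^ 2 ≤ 1 := hz
  have hx' : ∑ l, x l ^ 2 = 1 := hx
  have hprod : a * b * ∑ l, (y l - z l) ^ 2 ≤ 0 := by
    rw [key, hx']
    nlinarith [mul_le_mul_of_nonneg_left hy' ha.le, mul_le_mul_of_nonneg_left hz' hb.le]
  have hsum0 : ∑ l, (y l - z l) ^ 2 = 0 := by
    have hnn : 0 ≤ ∑ l, (y l - z l) ^ 2 := Finset.sum_nonneg fun l _ => sq_nonneg _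
    have hab0 : 0 < a * b := mul_pos ha hb
    nlinarith
  have hyz : y = z := by
    funext l
    have h := (Finset.sum_eq_zero_iff_of_nonneg fun l _ => sq_nonneg (y l - z l)).mp hsum0 l
      (Finset.mem_univ l)
    have : y l - z l = 0 := pow_eq_zero_iff (n := 2) (by norm_num) |>.mp h
    linarith
  subst hyz
  have hxy : x = y := by
    funext l
    rw [hcoord l, ← add_mul, hab, one_mul]
  exact ⟨hxy.symm, hxy.symm⟩

/-- **Euclidean balls have no psd lift of size `k ≤ 3` once their dimension exceeds `k`.** For
`k ≤ 3` and `n > k`, the unit ball `B^n ⊆ ℝ^n` is not `π(S^k_+ ∩ L)` for any affine `L` and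
linear `π`: its extreme points (the whole sphere, of positive `μH[n−1] ≤ μH[k]`-measure) would be
`μH[k]`-null. PROVED here. For comparison, the dimension count `n ≤ C(k+1, 2)` of the tree
(`card_le_choose_of_hasPsdLift_euclideanBall`) allows `(n, k) ∈ {(3,2), (4,3), (5,3), (6,3)}`,
all of which are excluded here. [cite: FawziEtAl2015, §9.1 Problem 9.1 (p24)] -/
theorem not_hasPsdLift_euclideanBall {k n : ℕ} (hk : k ≤ 3) (hkn : k < n) :
    ¬ HasPsdLift {x : Fin n → ℝ | ∑ l, x l ^ 2 ≤ 1} k := by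
  intro h
  have hdim : k < finrank ℝ (vectorSpan ℝ {x : Fin n → ℝ | ∑ l, x l ^ 2 ≤ 1}) := by
    rw [vectorSpan_euclideanBall_eq_top, finrank_top, Module.finrank_fin_fun]
    exact hkn
  have h0 := hausdorffMeasure_extremePoints_eq_zero_of_hasPsdLift hk h hdim
  exact (hausdorffMeasure_sphere_pos_of_lt hkn).ne'
    (measure_mono_null (sphere_subset_extremePoints_euclideanBall n) h0)

/-- Equivalently: a psd lift of `B^n` of size `k ≤ 3` forces `n ≤ k`.
[cite: FawziEtAl2015, §9.1 Problem 9.1 (p24)] -/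
theorem le_of_hasPsdLift_euclideanBall {k n : ℕ}
    (h : HasPsdLift {x : Fin n → ℝ | ∑ l, x l ^ 2 ≤ 1} k) (hk : k ≤ 3) : n ≤ k := by
  by_contra hlt
  push Not at hlt
  exact not_hasPsdLift_euclideanBall hk hlt h

/-- **"There is no smaller semidefinite representation of the 3-sphere"** (the statement that
[FawziEtAl2015, §9.1 p24] notes would follow from `rank_psd(A) = 4` in their Problem 9.1): the
unit ball of `ℝ⁴` has no psd lift of size `3`. PROVED here (unconditionally, not via Problem 9.1,
which stays open). [cite: FawziEtAl2015, §9.1 Problem 9.1 (p24)] -/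
theorem not_hasPsdLift_euclideanBall_fin_four_three :
    ¬ HasPsdLift {x : Fin 4 → ℝ | ∑ l, x l ^ 2 ≤ 1} 3 :=
  not_hasPsdLift_euclideanBall le_rfl (by norm_num)

/-- **The smallest psd lift of the unit ball of `ℝ⁴` has size exactly `4`**: size `4` is the
Frobenius-ball lift of the tree (`hasPsdLift_euclideanBall_fin_four`, "the unit ball in `ℝ⁴` has a
semidefinite representation of size `4`", p24), and sizes `≤ 3` are excluded by
`not_hasPsdLift_euclideanBall`. [cite: FawziEtAl2015, §9.1 Problem 9.1 (p24)] -/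
theorem isLeast_psdLiftSize_euclideanBall_fin_four :
    IsLeast {k : ℕ | HasPsdLift {x : Fin 4 → ℝ | ∑ l, x l ^ 2 ≤ 1} k} 4 := by
  refine ⟨hasPsdLift_euclideanBall_fin_four, fun k hk => ?_⟩
  by_contra hlt
  push Not at hlt
  exact not_hasPsdLift_euclideanBall (by omega) (by omega) hk

/-- Every psd lift of the unit ball of `ℝ³` has size at least `3` (the dimension count only gives
`2`); size `3` is attained (`hasPsdLift_euclideanBall_fin_three` below, the `3 × 3` spectraplex
projected by `X ↦ (2X₀₂, 2X₁₂, X₂₂ − X₀₀ − X₁₁)`). [cite: FawziEtAl2015, §9.1 (p24)] -/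
theorem three_le_of_hasPsdLift_euclideanBall_fin_three {k : ℕ}
    (hk : HasPsdLift {x : Fin 3 → ℝ | ∑ l, x l ^ 2 ≤ 1} k) : 3 ≤ k := by
  by_contra hlt
  push Not at hlt
  exact not_hasPsdLift_euclideanBall (by omega) (by omega) hk

/-- Every psd lift of the unit ball of `ℝ^n`, `n ≥ 4`, has size at least `4` (for `n = 5, 6` the
dimension count `n ≤ C(k+1,2)` only gives `3`). [cite: FawziEtAl2015, §9.1 (p24)] -/
theorem four_le_of_hasPsdLift_euclideanBall {k n : ℕ} (hn : 4 ≤ n)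
    (hk : HasPsdLift {x : Fin n → ℝ | ∑ l, x l ^ 2 ≤ 1} k) : 4 ≤ k := by
  by_contra hlt
  push Not at hlt
  exact not_hasPsdLift_euclideanBall (by omega) (by omega) hk

/-! ### Consequences: affine slices, second-order cones, strictly convex bodies -/

/-- Slicing by an affine hyperplane keeps the size of a psd lift: if `C = π(S^k_+ ∩ L)` then
`C ∩ {φ = b} = π(S^k_+ ∩ (L ∩ (φ ∘ π)⁻¹(b)))`. [cite: FawziEtAl2015, §3.1 eq. (3) (p09)] -/
theorem HasPsdLift.inter_setOf_apply_eq {E : Type*} [AddCommGroup E] [Module ℝ E] {C : Set E}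
    {k : ℕ} (h : HasPsdLift C k) (φ : E →ₗ[ℝ] ℝ) (b : ℝ) :
    HasPsdLift (C ∩ {x | φ x = b}) k := by
  obtain ⟨L, π, rfl⟩ := h
  let L₁ : AffineSubspace ℝ (Matrix (Fin k) (Fin k) ℝ) :=
    { carrier := {M | φ (π M) = b}
      smul_vsub_vadd_mem' := by
        intro c M₁ M₂ M₃ h₁ h₂ h₃
        simp only [Set.mem_setOf_eq] at h₁ h₂ h₃ ⊢
        rw [vsub_eq_sub, vadd_eq_add, map_add, map_smul, map_sub, map_add, map_smul, map_sub,
          h₁, h₂, h₃, sub_self, smul_zero, zero_add] }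
  refine ⟨L ⊓ L₁, π, Set.ext fun y => ⟨?_, ?_⟩⟩
  · rintro ⟨⟨M, ⟨hM, hML⟩, rfl⟩, hyb⟩
    exact ⟨M, ⟨hM, (AffineSubspace.mem_inf_iff M L L₁).mpr ⟨hML, hyb⟩⟩, rfl⟩
  · rintro ⟨M, ⟨hM, hML⟩, rfl⟩
    obtain ⟨hML₀, hM₁⟩ := (AffineSubspace.mem_inf_iff M L L₁).mp hML
    exact ⟨⟨M, ⟨hM, hML₀⟩, rfl⟩, hM₁⟩

/-- The second-order (Lorentz) cone `L^{n+1}_+ = {(x, x₀) ∈ ℝⁿ × ℝ : ‖x‖₂ ≤ x₀}`, written on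
`Fin (n+1) → ℝ` with `x₀` the last coordinate: `Σ_{j<n} y_j² ≤ y_n²` and `y_n ≥ 0`.
[cite: FawziEtAl2022Lifting, §5.1.3 (p25, "𝓛^{ℓ+1}_+ = {(x₀,x) : ‖x‖ ≤ x₀}")] -/
def secondOrderConeSet (n : ℕ) : Set (Fin (n + 1) → ℝ) :=
  {y | ∑ j : Fin n, y (Fin.castSucc j) ^ 2 ≤ y (Fin.last n) ^ 2 ∧ 0 ≤ y (Fin.last n)}

/-- Membership in the second-order cone. [cite: FawziEtAl2022Lifting, §5.1.3 (p25)] -/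
theorem mem_secondOrderConeSet_iff {n : ℕ} {y : Fin (n + 1) → ℝ} :
    y ∈ secondOrderConeSet n ↔
      ∑ j : Fin n, y (Fin.castSucc j) ^ 2 ≤ y (Fin.last n) ^ 2 ∧ 0 ≤ y (Fin.last n) := Iff.rfl

/-- **Second-order cones of dimension `> k + 1`... precisely: `L^{n+1}_+` with `n > k` has no psd
lift of size `k ≤ 3`** — its slice `x₀ = 1` projects onto the unit ball `Bⁿ`. In particular the
`5`-dimensional Lorentz cone is not `π(S³_+ ∩ L)` (whereas `L^{n+1}_+` always has an `(S²_+)ⁿ`-lift,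
[FawziEtAl2022Lifting] §5.1.3). PROVED here. [cite: FawziEtAl2022Lifting, §5.1.3 (p25)]
[cite: FawziEtAl2015, §9.1 Problem 9.1 (p24)] -/
theorem not_hasPsdLift_secondOrderCone {k n : ℕ} (hk : k ≤ 3) (hkn : k < n) :
    ¬ HasPsdLift (secondOrderConeSet n) k := by
  intro h
  -- slice at `x₀ = 1` and drop the last coordinate
  have h1 := h.inter_setOf_apply_eq (LinearMap.proj (Fin.last n)) 1
  have h2 := h1.image (LinearMap.funLeft ℝ ℝ (Fin.castSucc : Fin n → Fin (n + 1)))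
  have himg : (LinearMap.funLeft ℝ ℝ (Fin.castSucc : Fin n → Fin (n + 1))) ''
      (secondOrderConeSet n ∩ {x | LinearMap.proj (R := ℝ) (Fin.last n) x = (1 : ℝ)}) =
      {x : Fin n → ℝ | ∑ l, x l ^ 2 ≤ 1} := by
    ext x
    simp only [Set.mem_image, Set.mem_inter_iff, mem_secondOrderConeSet_iff, Set.mem_setOf_eq,
      LinearMap.coe_proj, Function.eval]
    constructor
    · rintro ⟨y, ⟨⟨hy, -⟩, hy1⟩, rfl⟩
      simpa [LinearMap.funLeft_apply, hy1] using hy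
    · intro hx
      refine ⟨Fin.snoc x 1, ⟨⟨?_, ?_⟩, ?_⟩, ?_⟩
      · simpa [Fin.snoc_castSucc, Fin.snoc_last] using hx
      · simp [Fin.snoc_last]
      · simp [Fin.snoc_last]
      · funext j
        simp [LinearMap.funLeft_apply, Fin.snoc_castSucc]
  rw [himg] at h2
  exact not_hasPsdLift_euclideanBall hk hkn h2

/-- Boundary points of a closed strictly convex set are extreme points. [folklore] -/
private theorem frontier_subset_extremePoints_of_strictConvex {n : ℕ} {C : Set (Fin n → ℝ)}
    (hC : IsClosed C) (hsc : StrictConvex ℝ C) : frontier C ⊆ C.extremePoints ℝ := by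
  intro x hx
  rw [hC.frontier_eq] at hx
  obtain ⟨hxC, hxint⟩ := hx
  rw [mem_extremePoints]
  refine ⟨hxC, fun y hy z hz hseg => ?_⟩
  by_cases hyz : y = z
  · subst hyz
    rw [openSegment_same] at hseg
    exact ⟨hseg.symm, hseg.symm⟩
  · exact absurd (hsc.openSegment_subset hy hz hyz hseg) hxint

/-- Dropping the last coordinate is `1`-Lipschitz for the sup metrics. [folklore] -/
private theorem lipschitzWith_dropLast (m : ℕ) :
    LipschitzWith 1 (fun (x : Fin (m + 1) → ℝ) (j : Fin m) => x (Fin.castSucc j)) := by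
  refine LipschitzWith.of_dist_le_mul fun x y => ?_
  rw [NNReal.coe_one, one_mul]
  refine (dist_pi_le_iff dist_nonneg).2 fun j => ?_
  exact dist_le_pi_dist x y (Fin.castSucc j)

/-- **The boundary of a convex body is `μH[n−1]`-large**: for a compact `C ⊆ ℝ^{m+1}` with non-empty
interior, `μH[m](frontier C) > 0` — the projection forgetting the last coordinate is `1`-Lipschitz
and maps `frontier C` onto the projection of `C` (the top endpoint of each vertical chord is a
boundary point), which contains a ball. [folklore] -/
private theorem hausdorffMeasure_frontier_pos {m : ℕ} {C : Set (Fin (m + 1) → ℝ)}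
    (hC : IsCompact C) (hint : (interior C).Nonempty) : 0 < μH[(m : ℝ)] (frontier C) := by
  set P : (Fin (m + 1) → ℝ) → (Fin m → ℝ) := fun x j => x (Fin.castSucc j) with hP
  set e : Fin (m + 1) → ℝ := Pi.single (Fin.last m) 1 with he
  obtain ⟨x₀, hx₀⟩ := hint
  obtain ⟨r, hr, hball⟩ := Metric.mem_nhds_iff.mp (mem_interior_iff_mem_nhds.mp hx₀)
  have hCclosed : IsClosed C := hC.isClosed
  obtain ⟨R, hR⟩ := (Metric.isBounded_iff_subset_closedBall (0 : Fin (m + 1) → ℝ)).mp hC.isBounded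
  -- every point of the ball around `P x₀` is the projection of a boundary point
  have hsub : Metric.ball (P x₀) r ⊆ P '' frontier C := by
    intro u hu
    -- the point `x₁ = (u, (x₀)_last)` lies in `C`
    set x₁ : Fin (m + 1) → ℝ := Fin.snoc u (x₀ (Fin.last m)) with hx₁
    have hx₁last : x₁ (Fin.last m) = x₀ (Fin.last m) := by rw [hx₁, Fin.snoc_last]
    have hx₁cast : ∀ j : Fin m, x₁ (Fin.castSucc j) = u j := fun j => by
      rw [hx₁, Fin.snoc_castSucc]
    have hPx₁ : P x₁ = u := by funext j; exact hx₁cast j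
    have hx₁C : x₁ ∈ C := by
      refine hball ?_
      rw [Metric.mem_ball, dist_pi_lt_iff hr]
      intro l
      induction l using Fin.lastCases with
      | last =>
        rw [hx₁last, dist_self]
        exact hr
      | cast j =>
        rw [hx₁cast]
        have := (dist_pi_lt_iff hr).mp (Metric.mem_ball.mp hu) j
        simpa [hP] using this
    -- the vertical chord through `x₁`
    set T : Set ℝ := {t | x₁ + t • e ∈ C} with hT
    have hTcl : IsClosed T := hCclosed.preimage (by continuity)
    have hTbdd : Bornology.IsBounded T := by
      rw [Metric.isBounded_iff_subset_closedBall 0]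
      refine ⟨R + ‖x₁‖, fun t ht => ?_⟩
      rw [Metric.mem_closedBall, dist_zero_right]
      have h1 : ‖x₁ + t • e‖ ≤ R := by
        have := hR ht
        rwa [Metric.mem_closedBall, dist_zero_right] at this
      have h2 : ‖t • e‖ = |t| := by
        rw [norm_smul, Real.norm_eq_abs, he, Pi.norm_single, norm_one, mul_one]
      have h3 : ‖t • e‖ ≤ ‖x₁ + t • e‖ + ‖x₁‖ := by
        have := norm_sub_le (x₁ + t • e) x₁
        simpa using this
      rw [Real.norm_eq_abs, ← h2]
      linarith
    have hTcpt : IsCompact T := Metric.isCompact_of_isClosed_isBounded hTcl hTbdd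
    have hTne : T.Nonempty := ⟨0, by simp [hT, hx₁C]⟩
    set t₁ : ℝ := sSup T with ht₁
    have ht₁T : t₁ ∈ T := hTcpt.sSup_mem hTne
    set x₂ : Fin (m + 1) → ℝ := x₁ + t₁ • e with hx₂
    have hx₂C : x₂ ∈ C := ht₁T
    -- `x₂` is not an interior point: points above it leave `C`
    have hx₂int : x₂ ∉ interior C := by
      intro hint₂
      obtain ⟨ε, hε, hεball⟩ := Metric.mem_nhds_iff.mp (mem_interior_iff_mem_nhds.mp hint₂)
      have hmem : x₁ + (t₁ + ε / 2) • e ∈ C := by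
        refine hεball ?_
        rw [Metric.mem_ball, hx₂, dist_eq_norm]
        have : x₁ + (t₁ + ε / 2) • e - (x₁ + t₁ • e) = (ε / 2) • e := by
          rw [add_smul]; abel
        have hnorm : ‖e‖ = 1 := by rw [he, Pi.norm_single, norm_one]
        rw [this, norm_smul, Real.norm_eq_abs, abs_of_pos (by positivity), hnorm, mul_one]
        linarith
      have hle : t₁ + ε / 2 ≤ t₁ := le_csSup hTcpt.bddAbove hmem
      linarith
    have hx₂fr : x₂ ∈ frontier C := by
      rw [hCclosed.frontier_eq]
      exact ⟨hx₂C, hx₂int⟩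
    refine ⟨x₂, hx₂fr, ?_⟩
    rw [← hPx₁]
    funext j
    simp [hP, hx₂, he, (Fin.castSucc_lt_last j).ne]
  have hvol : 0 < volume (Metric.ball (P x₀) r) := Metric.measure_ball_pos volume _ hr
  have h1 : volume (Metric.ball (P x₀) r) ≤ μH[(m : ℝ)] (P '' frontier C) := by
    rw [← hausdorffMeasure_fin_eq_volume]
    exact measure_mono hsub
  have h2 := (lipschitzWith_dropLast m).hausdorffMeasure_image_le (d := (m : ℝ)) (by positivity)
    (frontier C)
  rw [ENNReal.coe_one, ENNReal.one_rpow, one_mul] at h2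
  exact lt_of_lt_of_le (lt_of_lt_of_le hvol h1) h2

/-- **Strictly convex bodies have no small psd lifts.** A compact strictly convex set `C ⊆ ℝⁿ`
with non-empty interior has no psd lift of size `k ≤ 3` when `n > k`: its extreme points contain
its boundary, which has positive `μH[n−1] ≤ μH[k]`-measure, contradicting
`hausdorffMeasure_extremePoints_eq_zero_of_hasPsdLift`. So no strictly convex body of dimension
`≥ 4` is a linear image of an affine slice of `S³_+`, and none of dimension `≥ 3` comes from `S²_+`.
PROVED here (the ball of [FawziEtAl2015, §9.1 p24] is the motivating case).
[cite: FawziEtAl2015, §9.1 Problem 9.1 (p24)] -/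
theorem not_hasPsdLift_of_strictConvex {k n : ℕ} (hk : k ≤ 3) (hkn : k < n)
    {C : Set (Fin n → ℝ)} (hC : IsCompact C) (hsc : StrictConvex ℝ C)
    (hint : (interior C).Nonempty) : ¬ HasPsdLift C k := by
  intro h
  obtain ⟨m, rfl⟩ := Nat.exists_eq_add_one_of_ne_zero (by omega : n ≠ 0)
  -- `C` spans everything
  have hspan : affineSpan ℝ C = ⊤ := (hsc.convex.interior_nonempty_iff_affineSpan_eq_top).mp hint
  have hdim : k < finrank ℝ (vectorSpan ℝ C) := by
    rw [← direction_affineSpan, hspan, AffineSubspace.direction_top, finrank_top,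
      Module.finrank_fin_fun]
    exact hkn
  have h0 := hausdorffMeasure_extremePoints_eq_zero_of_hasPsdLift hk h hdim
  have hfr := measure_mono_null (frontier_subset_extremePoints_of_strictConvex hC.isClosed hsc) h0
  have hpos : 0 < μH[(k : ℝ)] (frontier C) := by
    have hkm : (k : ℝ) ≤ (m : ℝ) := by exact_mod_cast (by omega : k ≤ m)
    exact lt_of_lt_of_le (hausdorffMeasure_frontier_pos hC hint)
      (Measure.hausdorffMeasure_mono hkm _)
  exact hpos.ne' hfr

/-! ### The `3`-ball and the `4`-dimensional second-order cone ARE shadows of `S³_+` -/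

/-- The linear map `X ↦ (2X₀₂, 2X₁₂, X₂₂ − X₀₀ − X₁₁)` from `3 × 3` real matrices to `ℝ³`; on rank-one
matrices `v vᵀ` it is the quadratic map `v ↦ (2v₀v₂, 2v₁v₂, v₂² − v₀² − v₁²)`, which sends the unit
sphere `S²` onto `S²` (`|q(v)| = |v|²`). It realises the `3`-ball as a shadow of the `3 × 3`
spectraplex (below). [cite: FawziEtAl2015, §9.1 Problem 9.1 (p24)] -/
def ballThreeLiftMap : Matrix (Fin 3) (Fin 3) ℝ →ₗ[ℝ] (Fin 3 → ℝ) where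
  toFun X := ![2 * X 0 2, 2 * X 1 2, X 2 2 - X 0 0 - X 1 1]
  map_add' X Y := by
    ext i
    fin_cases i <;> simp <;> ring
  map_smul' c X := by
    ext i
    fin_cases i <;> simp <;> ring

/-- The components of `ballThreeLiftMap`. [cite: FawziEtAl2015, §9.1 Problem 9.1 (p24)] -/
theorem ballThreeLiftMap_apply (X : Matrix (Fin 3) (Fin 3) ℝ) :
    ballThreeLiftMap X = ![2 * X 0 2, 2 * X 1 2, X 2 2 - X 0 0 - X 1 1] := rfl

/-- A `2 × 2` principal minor of a real psd matrix is non-negative: `X_{ij}² ≤ X_{ii} X_{jj}`.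
[folklore] -/
private theorem sq_apply_le_mul_diag_of_posSemidef {k : ℕ} {X : Matrix (Fin k) (Fin k) ℝ}
    (hX : X.PosSemidef) (i j : Fin k) : X i j ^ 2 ≤ X i i * X j j := by
  classical
  have hsymm : X j i = X i j := by simpa using hX.1.apply i j
  have hdet := (hX.submatrix ![i, j]).det_nonneg
  rw [Matrix.det_fin_two] at hdet
  simp only [Matrix.submatrix_apply, Matrix.cons_val_zero, Matrix.cons_val_one] at hdet
  rw [hsymm] at hdet
  nlinarith

/-- `|ballThreeLiftMap X|² ≤ (Tr X)²` for psd `X`: the difference is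
`4(X₀₀X₂₂ − X₀₂²) + 4(X₁₁X₂₂ − X₁₂²) ≥ 0`. [folklore] -/
private theorem sum_sq_ballThreeLiftMap_le {X : Matrix (Fin 3) (Fin 3) ℝ} (hX : X.PosSemidef) :
    ∑ l, ballThreeLiftMap X l ^ 2 ≤ X.trace ^ 2 := by
  have h02 := sq_apply_le_mul_diag_of_posSemidef hX 0 2
  have h12 := sq_apply_le_mul_diag_of_posSemidef hX 1 2
  rw [Matrix.trace, Fin.sum_univ_three, Fin.sum_univ_three, ballThreeLiftMap_apply]
  simp only [Matrix.diag_apply, Matrix.cons_val_zero, Matrix.cons_val_one, Matrix.cons_val]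
  nlinarith

/-- **Preimages.** Every `w ∈ ℝ³` is `ballThreeLiftMap X₁` for a psd `X₁` of trace `|w|`: for
`|w| + w₂ > 0` take `X₁ = n nᵀ / (2(|w| + w₂))` with `n = (w₀, w₁, |w| + w₂)` (the half-angle
preimage of `w/|w|` under `S² → S²`), and `X₁ = diag(|w|, 0, 0)` when `w = (0, 0, −|w|)`. [folklore] -/
private theorem exists_posSemidef_ballThreeLiftMap_eq (w : Fin 3 → ℝ) :
    ∃ X : Matrix (Fin 3) (Fin 3) ℝ,
      X.PosSemidef ∧ X.trace = Real.sqrt (∑ l, w l ^ 2) ∧ ballThreeLiftMap X = w := by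
  set s : ℝ := Real.sqrt (∑ l, w l ^ 2) with hs
  have hs0 : 0 ≤ s := Real.sqrt_nonneg _
  have hsum : ∑ l, w l ^ 2 = w 0 ^ 2 + w 1 ^ 2 + w 2 ^ 2 := by
    rw [Fin.sum_univ_three]
  have hs2 : s ^ 2 = w 0 ^ 2 + w 1 ^ 2 + w 2 ^ 2 := by
    rw [hs, Real.sq_sqrt (Finset.sum_nonneg fun l _ => sq_nonneg (w l)), hsum]
  have hw2 : -s ≤ w 2 := by nlinarith [sq_nonneg (w 0), sq_nonneg (w 1), sq_nonneg (s + w 2)]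
  by_cases hdeg : s + w 2 = 0
  · -- `w = (0, 0, -s)`
    have hw2' : w 2 = -s := by linarith
    have hw0 : w 0 = 0 := by nlinarith [sq_nonneg (w 0), sq_nonneg (w 1)]
    have hw1 : w 1 = 0 := by nlinarith [sq_nonneg (w 0), sq_nonneg (w 1)]
    refine ⟨Matrix.diagonal ![s, 0, 0], ?_, ?_, ?_⟩
    · refine PosSemidef.diagonal ?_
      intro i
      fin_cases i <;> simp [hs0]
    · simp [Matrix.trace, Fin.sum_univ_three]
    · rw [ballThreeLiftMap_apply]
      funext i
      fin_cases i <;> simp [Matrix.diagonal, hw0, hw1, hw2']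
  · have hdpos : 0 < s + w 2 := lt_of_le_of_ne (by linarith) (Ne.symm hdeg)
    set n : Fin 3 → ℝ := ![w 0, w 1, s + w 2] with hn
    refine ⟨(1 / (2 * (s + w 2))) • vecMulVec n n, ?_, ?_, ?_⟩
    · have hnn : (vecMulVec n n).PosSemidef := by
        simpa using posSemidef_vecMulVec_self_star n
      exact hnn.smul (by positivity)
    · rw [Matrix.trace_smul, Matrix.trace_vecMulVec, smul_eq_mul]
      simp only [hn, dotProduct, Fin.sum_univ_three, Matrix.cons_val_zero, Matrix.cons_val_one,
        Matrix.cons_val]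
      field_simp
      nlinarith [hs2]
    · rw [ballThreeLiftMap_apply]
      funext i
      fin_cases i
      · simp [hn]
        field_simp
      · simp [hn]
        field_simp
      · simp [hn]
        field_simp
        nlinarith [hs2]

/-- A trace-one psd matrix killed by `ballThreeLiftMap`: `diag(1/4, 1/4, 1/2)`. [folklore] -/
private theorem ballThreeLiftMap_base :
    (Matrix.diagonal (![1 / 4, 1 / 4, 1 / 2] : Fin 3 → ℝ)).PosSemidef ∧
      (Matrix.diagonal (![1 / 4, 1 / 4, 1 / 2] : Fin 3 → ℝ)).trace = 1 ∧
      ballThreeLiftMap (Matrix.diagonal (![1 / 4, 1 / 4, 1 / 2] : Fin 3 → ℝ)) = 0 := by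
  refine ⟨PosSemidef.diagonal (fun i => by fin_cases i <;> simp), ?_, ?_⟩
  · simp [Matrix.trace, Fin.sum_univ_three]
    norm_num
  · set d : Fin 3 → ℝ := ![1 / 4, 1 / 4, 1 / 2] with hd
    have e02 : Matrix.diagonal d 0 2 = 0 := Matrix.diagonal_apply_ne d (by decide)
    have e12 : Matrix.diagonal d 1 2 = 0 := Matrix.diagonal_apply_ne d (by decide)
    have e00 : Matrix.diagonal d 0 0 = 1 / 4 := by rw [Matrix.diagonal_apply_eq]; rfl
    have e11 : Matrix.diagonal d 1 1 = 1 / 4 := by rw [Matrix.diagonal_apply_eq]; rfl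
    have e22 : Matrix.diagonal d 2 2 = 1 / 2 := by rw [Matrix.diagonal_apply_eq]; rfl
    rw [ballThreeLiftMap_apply, e02, e12, e00, e11, e22]
    funext i
    fin_cases i <;> norm_num

/-- **The unit ball of `ℝ³` is a shadow of the `3 × 3` spectraplex**:
`B³ = {(2X₀₂, 2X₁₂, X₂₂ − X₀₀ − X₁₁) : X ⪰ 0, Tr X = 1}`, a psd lift of size `3`. Indeed the
image lies in `B³` by the `2 × 2` minors (`(Tr X)² − |π X|² = 4(X₀₀X₂₂ − X₀₂²) + 4(X₁₁X₂₂ − X₁₂²)`),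
and `w ∈ B³` is the image of `X₁ + (1 − |w|)·diag(¼, ¼, ½)` with `X₁` as in the preimage lemma
(geometrically: the extreme points `v vᵀ`, `|v| = 1`, of the spectraplex are mapped ONTO the
sphere `S²` by the degree-two map `v ↦ (2v₀v₂, 2v₁v₂, v₂² − v₀² − v₁²)`). Together with
`three_le_of_hasPsdLift_euclideanBall_fin_three`, the least psd-lift size of `B³` is exactly `3`.
PROVED here (compare the size-`4` Frobenius/arrow lifts, which are what the generic constructions
give for `B³`). [cite: FawziEtAl2015, §9.1 Problem 9.1 (p24)] -/
theorem hasPsdLift_euclideanBall_fin_three : HasPsdLift {x : Fin 3 → ℝ | ∑ l, x l ^ 2 ≤ 1} 3 := by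
  let L : AffineSubspace ℝ (Matrix (Fin 3) (Fin 3) ℝ) :=
    { carrier := {M | M.trace = 1}
      smul_vsub_vadd_mem' := by
        intro c M₁ M₂ M₃ h₁ h₂ h₃
        simp only [Set.mem_setOf_eq] at h₁ h₂ h₃ ⊢
        rw [vsub_eq_sub, vadd_eq_add, Matrix.trace_add, Matrix.trace_smul, Matrix.trace_sub,
          h₁, h₂, h₃, sub_self, smul_zero, zero_add] }
  obtain ⟨hB, hBtr, hB0⟩ := ballThreeLiftMap_base
  refine ⟨L, ballThreeLiftMap, Set.ext fun w => ⟨fun hw => ?_, ?_⟩⟩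
  · -- a preimage of `w ∈ B³`
    obtain ⟨X₁, hX₁, htr, hmap⟩ := exists_posSemidef_ballThreeLiftMap_eq w
    set s : ℝ := Real.sqrt (∑ l, w l ^ 2) with hs
    have hw' : ∑ l, w l ^ 2 ≤ 1 := hw
    have hs1 : s ≤ 1 := by
      rw [hs]
      calc Real.sqrt (∑ l, w l ^ 2) ≤ Real.sqrt 1 := Real.sqrt_le_sqrt hw'
        _ = 1 := Real.sqrt_one
    refine ⟨X₁ + (1 - s) • Matrix.diagonal (![1 / 4, 1 / 4, 1 / 2] : Fin 3 → ℝ),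
      ⟨hX₁.add (hB.smul (by linarith)), ?_⟩, ?_⟩
    · change (X₁ + (1 - s) • Matrix.diagonal (![1 / 4, 1 / 4, 1 / 2] : Fin 3 → ℝ)).trace = 1
      rw [Matrix.trace_add, Matrix.trace_smul, htr, hBtr, smul_eq_mul, mul_one]
      ring
    · rw [map_add, map_smul, hmap, hB0, smul_zero, add_zero]
  · rintro ⟨X, ⟨hX, hXL⟩, rfl⟩
    have htr : X.trace = 1 := hXL
    have h := sum_sq_ballThreeLiftMap_le hX
    rw [htr, one_pow] at h
    exact h

/-- **The least psd-lift size of the unit ball of `ℝ³` is `3`** (`hasPsdLift_euclideanBall_fin_three`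
and `three_le_of_hasPsdLift_euclideanBall_fin_three`). [cite: FawziEtAl2015, §9.1 Problem 9.1 (p24)] -/
theorem isLeast_psdLiftSize_euclideanBall_fin_three :
    IsLeast {k : ℕ | HasPsdLift {x : Fin 3 → ℝ | ∑ l, x l ^ 2 ≤ 1} k} 3 :=
  ⟨hasPsdLift_euclideanBall_fin_three, fun _ hk => three_le_of_hasPsdLift_euclideanBall_fin_three hk⟩

/-- The linear map `X ↦ (2X₀₂, 2X₁₂, X₂₂ − X₀₀ − X₁₁, Tr X)` from `3 × 3` real matrices to `ℝ⁴`
(homogenisation of `ballThreeLiftMap`). [cite: FawziEtAl2022Lifting, §5.1.3 (p25)] -/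
def secondOrderConeThreeLiftMap : Matrix (Fin 3) (Fin 3) ℝ →ₗ[ℝ] (Fin 4 → ℝ) where
  toFun X := Fin.snoc (ballThreeLiftMap X) X.trace
  map_add' X Y := by
    ext i
    refine Fin.lastCases ?_ (fun j => ?_) i
    · rw [Pi.add_apply, Fin.snoc_last, Fin.snoc_last, Fin.snoc_last, Matrix.trace_add]
    · rw [Pi.add_apply, Fin.snoc_castSucc, Fin.snoc_castSucc, Fin.snoc_castSucc, map_add,
        Pi.add_apply]
  map_smul' c X := by
    ext i
    refine Fin.lastCases ?_ (fun j => ?_) i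
    · rw [RingHom.id_apply, Pi.smul_apply, Fin.snoc_last, Fin.snoc_last, Matrix.trace_smul]
    · rw [RingHom.id_apply, Pi.smul_apply, Fin.snoc_castSucc, Fin.snoc_castSucc, map_smul,
        Pi.smul_apply]

/-- **The `4`-dimensional second-order cone is a linear image of `S³_+`**:
`L⁴_+ = {(2X₀₂, 2X₁₂, X₂₂ − X₀₀ − X₁₁, Tr X) : X ⪰ 0}` — a psd lift of size `3` with `L` = all
matrices. (`⊆`: the `2 × 2` minors and `Tr X ≥ 0`; `⊇`: `(w, t)` with `|w| ≤ t` is the image of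
`X₁ + (t − |w|)·diag(¼, ¼, ½)`.) With `not_hasPsdLift_secondOrderCone` the least psd-lift size of
`L⁴_+` is `3`; for `L⁵_+` it is at least `4`. PROVED here. [cite: FawziEtAl2022Lifting, §5.1.3 (p25)] -/
theorem hasPsdLift_secondOrderCone_three : HasPsdLift (secondOrderConeSet 3) 3 := by
  obtain ⟨hB, hBtr, hB0⟩ := ballThreeLiftMap_base
  refine ⟨⊤, secondOrderConeThreeLiftMap, Set.ext fun y => ⟨fun hy => ?_, ?_⟩⟩
  · obtain ⟨hy, hy0⟩ := hy
    set w : Fin 3 → ℝ := fun j => y (Fin.castSucc j) with hw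
    set t : ℝ := y (Fin.last 3) with ht
    obtain ⟨X₁, hX₁, htr, hmap⟩ := exists_posSemidef_ballThreeLiftMap_eq w
    set s : ℝ := Real.sqrt (∑ l, w l ^ 2) with hs
    have hst : s ≤ t := by
      rw [hs]
      calc Real.sqrt (∑ l, w l ^ 2) ≤ Real.sqrt (t ^ 2) := Real.sqrt_le_sqrt hy
        _ = t := Real.sqrt_sq hy0
    refine ⟨X₁ + (t - s) • Matrix.diagonal (![1 / 4, 1 / 4, 1 / 2] : Fin 3 → ℝ),
      ⟨hX₁.add (hB.smul (by linarith)), AffineSubspace.mem_top ℝ _ _⟩, ?_⟩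
    change Fin.snoc (ballThreeLiftMap (X₁ + (t - s) • Matrix.diagonal ![1 / 4, 1 / 4, 1 / 2]))
      (X₁ + (t - s) • Matrix.diagonal (![1 / 4, 1 / 4, 1 / 2] : Fin 3 → ℝ)).trace = y
    rw [map_add, map_smul, hmap, hB0, smul_zero, add_zero, Matrix.trace_add, Matrix.trace_smul,
      htr, hBtr, smul_eq_mul, mul_one, show s + (t - s) = t by ring]
    funext i
    refine Fin.lastCases ?_ (fun j => ?_) i
    · rw [Fin.snoc_last]
    · rw [Fin.snoc_castSucc]
  · rintro ⟨X, ⟨hX, -⟩, rfl⟩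
    change ∑ j : Fin 3, (Fin.snoc (ballThreeLiftMap X) X.trace : Fin 4 → ℝ) (Fin.castSucc j) ^ 2 ≤
        (Fin.snoc (ballThreeLiftMap X) X.trace : Fin 4 → ℝ) (Fin.last 3) ^ 2 ∧
      0 ≤ (Fin.snoc (ballThreeLiftMap X) X.trace : Fin 4 → ℝ) (Fin.last 3)
    simp only [Fin.snoc_castSucc, Fin.snoc_last]
    exact ⟨sum_sq_ballThreeLiftMap_le hX, hX.trace_nonneg⟩

/-- **The least psd-lift size of the `4`-dimensional second-order cone is `3`**.
[cite: FawziEtAl2022Lifting, §5.1.3 (p25)] -/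
theorem isLeast_psdLiftSize_secondOrderCone_three :
    IsLeast {k : ℕ | HasPsdLift (secondOrderConeSet 3) k} 3 := by
  refine ⟨hasPsdLift_secondOrderCone_three, fun k hk => ?_⟩
  by_contra hlt
  push Not at hlt
  exact not_hasPsdLift_secondOrderCone (k := k) (n := 3) (by omega) (by omega) hk

/-! ### All sizes `k`: the dimension count `dim C ≤ C(k+1, 2)` is off by at least three -/

namespace SmallPsdLifts

variable {k : ℕ}

/-- Filling a symmetric matrix from upper-triangular data (a private copy of the plumbing of
`SquaredDistancePsdRank.lean`). [folklore] -/
private def symFill' (k : ℕ) : (Sym2 (Fin k) → ℝ) →ₗ[ℝ] Matrix (Fin k) (Fin k) ℝ where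
  toFun u := Matrix.of fun i j => u s(i, j)
  map_add' u v := by ext i j; rfl
  map_smul' c u := by ext i j; rfl

/-- A symmetric matrix is a fill. [folklore] -/
private theorem mem_range_symFill'_of_isHermitian {M : Matrix (Fin k) (Fin k) ℝ}
    (hM : M.IsHermitian) : M ∈ LinearMap.range (symFill' k) := by
  refine ⟨Sym2.lift ⟨fun i j => M i j, fun i j => ?_⟩, ?_⟩
  · simpa using hM.apply j i
  · ext i j
    simp [symFill']

/-- The symmetric `k × k` matrices span at most `C(k+1, 2)` dimensions. [folklore] -/
private theorem finrank_range_symFill'_le (k : ℕ) :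
    finrank ℝ (LinearMap.range (symFill' k)) ≤ (k + 1).choose 2 := by
  calc finrank ℝ (LinearMap.range (symFill' k))
      ≤ finrank ℝ (Sym2 (Fin k) → ℝ) := LinearMap.finrank_range_le _
    _ = (k + 1).choose 2 := by
        rw [Module.finrank_fintype_fun_eq_card, Sym2.card, Fintype.card_fin]

/-- `(u vᵀ) w = (v · w) u`. [folklore] -/
private theorem vecMulVec_mulVec' (u v w : Fin k → ℝ) :
    vecMulVec u v *ᵥ w = (v ⬝ᵥ w) • u := by
  ext i
  simp [vecMulVec_mulVec, mul_comm]

/-- For a symmetric `X`, `(X y) · w = y · (X w)`. [folklore] -/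
private theorem mulVec_dotProduct_of_isHermitian {X : Matrix (Fin k) (Fin k) ℝ} (hX : X.IsHermitian)
    (y w : Fin k → ℝ) : (X *ᵥ y) ⬝ᵥ w = y ⬝ᵥ (X *ᵥ w) := by
  have hT : Xᵀ = X := by
    have h := hX.eq
    rwa [conjTranspose_eq_transpose_of_trivial] at h
  rw [dotProduct_mulVec, ← vecMul_transpose, hT]

/-- **Rank-one extreme points, all sizes.** If `V` is a space of symmetric directions of `L` with
`dim V > C(k+1, 2) − 3`, every extreme point `X` of `S^k_+ ∩ L` is `v vᵀ`. For `rank X ≥ 2` pick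
independent `u₁, u₂ ∈ range X`; the three symmetric products `u₁u₁ᵀ, u₁u₂ᵀ + u₂u₁ᵀ, u₂u₂ᵀ` span a
`3`-space of symmetric matrices killing `ker X = (range X)^⊥`, which must meet `V` (both live in the
`C(k+1,2)`-space of symmetric matrices); a non-zero `D` in the intersection gives `X ± εD ∈ S^k_+ ∩ L`
(BPT Lemma 4.39), so `X` is not extreme. [cite: BlekhermanParriloThomas2012, Ch. 4 §4.6 Lemma 4.39
(held chunk p0182)] -/
theorem exists_eq_vecMulVec_of_mem_extremePoints_of_choose_lt
    {L : AffineSubspace ℝ (Matrix (Fin k) (Fin k) ℝ)} (V : Submodule ℝ (Matrix (Fin k) (Fin k) ℝ))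
    (hVL : V ≤ L.direction) (hVsym : ∀ D ∈ V, D.IsHermitian)
    (hdim : (k + 1).choose 2 < finrank ℝ V + 3)
    {X : Matrix (Fin k) (Fin k) ℝ} (hX : X ∈ (liftSet L).extremePoints ℝ) :
    ∃ v : Fin k → ℝ, X = vecMulVec v v := by
  classical
  have hXK : X ∈ liftSet L := hX.1
  have hpsd : X.PosSemidef := hXK.1
  by_cases hr : X.rank ≤ 1
  · exact exists_eq_vecMulVec_of_posSemidef_rank_le_one hpsd hr
  exfalso
  -- two independent vectors `u₁, u₂` in the range of `X`
  set Rg : Submodule ℝ (Fin k → ℝ) := LinearMap.range X.mulVecLin with hRg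
  have hrank : X.rank = finrank ℝ Rg := rfl
  have hRg1 : 1 < finrank ℝ Rg := by omega
  obtain ⟨x, hx0⟩ : ∃ x : Rg, x ≠ 0 :=
    (Module.finrank_pos_iff_exists_ne_zero (R := ℝ) (M := Rg)).mp (by omega)
  obtain ⟨y, hxy⟩ := exists_linearIndependent_pair_of_one_lt_finrank hRg1 hx0
  set u₁ : Fin k → ℝ := (x : Fin k → ℝ) with hu₁
  set u₂ : Fin k → ℝ := (y : Fin k → ℝ) with hu₂
  have hpair : ∀ s t : ℝ, s • u₁ + t • u₂ = 0 → s = 0 ∧ t = 0 := by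
    intro s t hst
    refine (LinearIndependent.pair_iff.mp hxy) s t ?_
    apply Subtype.ext
    simpa [hu₁, hu₂] using hst
  obtain ⟨y₁, hy₁⟩ := LinearMap.mem_range.mp x.2
  obtain ⟨y₂, hy₂⟩ := LinearMap.mem_range.mp y.2
  have hy₁' : X *ᵥ y₁ = u₁ := by simpa [mulVecLin_apply] using hy₁
  have hy₂' : X *ᵥ y₂ = u₂ := by simpa [mulVecLin_apply] using hy₂
  -- the three symmetric products
  set P₁ : Matrix (Fin k) (Fin k) ℝ := vecMulVec u₁ u₁ with hP₁
  set P₂ : Matrix (Fin k) (Fin k) ℝ := vecMulVec u₁ u₂ + vecMulVec u₂ u₁ with hP₂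
  set P₃ : Matrix (Fin k) (Fin k) ℝ := vecMulVec u₂ u₂ with hP₃
  let θ : (Fin 3 → ℝ) →ₗ[ℝ] Matrix (Fin k) (Fin k) ℝ :=
    { toFun := fun c => c 0 • P₁ + c 1 • P₂ + c 2 • P₃
      map_add' := fun c c' => by
        simp only [Pi.add_apply, add_smul]
        abel
      map_smul' := fun a c => by
        simp only [Pi.smul_apply, smul_eq_mul, RingHom.id_apply, smul_add, smul_smul] }
  have hθapply : ∀ c : Fin 3 → ℝ, θ c = c 0 • P₁ + c 1 • P₂ + c 2 • P₃ := fun c => rfl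
  -- `θ c` applied to a vector
  have hθmv : ∀ (c : Fin 3 → ℝ) (w : Fin k → ℝ), θ c *ᵥ w =
      (c 0 * (u₁ ⬝ᵥ w) + c 1 * (u₂ ⬝ᵥ w)) • u₁ + (c 1 * (u₁ ⬝ᵥ w) + c 2 * (u₂ ⬝ᵥ w)) • u₂ := by
    intro c w
    rw [hθapply, add_mulVec, add_mulVec, smul_mulVec, smul_mulVec, smul_mulVec, hP₁, hP₂, hP₃,
      add_mulVec, vecMulVec_mulVec', vecMulVec_mulVec', vecMulVec_mulVec', vecMulVec_mulVec',
      smul_add, smul_smul, smul_smul, smul_smul, smul_smul, add_smul, add_smul]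
    abel
  -- `θ` is injective
  have hθinj : Function.Injective θ := by
    rw [← LinearMap.ker_eq_bot, LinearMap.ker_eq_bot']
    intro c hc
    have hA : ∀ w, c 0 * (u₁ ⬝ᵥ w) + c 1 * (u₂ ⬝ᵥ w) = 0 ∧
        c 1 * (u₁ ⬝ᵥ w) + c 2 * (u₂ ⬝ᵥ w) = 0 := by
      intro w
      have h := hθmv c w
      rw [hc, zero_mulVec] at h
      exact hpair _ _ h.symm
    have hz : ∀ a b : ℝ, (∀ w, a * (u₁ ⬝ᵥ w) + b * (u₂ ⬝ᵥ w) = 0) → a = 0 ∧ b = 0 := by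
      intro a b hab
      apply hpair
      rw [← dotProduct_self_eq_zero]
      have h := hab (a • u₁ + b • u₂)
      rw [add_dotProduct, smul_dotProduct, smul_dotProduct, smul_eq_mul, smul_eq_mul]
      exact h
    obtain ⟨h0, h1⟩ := hz (c 0) (c 1) fun w => (hA w).1
    obtain ⟨-, h2⟩ := hz (c 1) (c 2) fun w => (hA w).2
    ext i
    fin_cases i
    · exact h0
    · exact h1
    · exact h2
  have hθrank : finrank ℝ (LinearMap.range θ) = 3 := by
    rw [LinearMap.finrank_range_of_inj hθinj, Module.finrank_fin_fun]
  -- both `V` and `range θ` consist of symmetric matrices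
  set SymR : Submodule ℝ (Matrix (Fin k) (Fin k) ℝ) := LinearMap.range (symFill' k) with hSymR
  have hVle : V ≤ SymR := fun D hD => mem_range_symFill'_of_isHermitian (hVsym D hD)
  have hPsym : ∀ c : Fin 3 → ℝ, (θ c).IsHermitian := by
    intro c
    rw [hθapply]
    have h1 : P₁.IsHermitian := by
      rw [hP₁]; unfold Matrix.IsHermitian
      rw [conjTranspose_eq_transpose_of_trivial, transpose_vecMulVec]
    have h3 : P₃.IsHermitian := by
      rw [hP₃]; unfold Matrix.IsHermitian
      rw [conjTranspose_eq_transpose_of_trivial, transpose_vecMulVec]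
    have h2 : P₂.IsHermitian := by
      rw [hP₂]; unfold Matrix.IsHermitian
      rw [conjTranspose_eq_transpose_of_trivial, transpose_add, transpose_vecMulVec,
        transpose_vecMulVec, add_comm]
    have hs : ∀ (a : ℝ) {P : Matrix (Fin k) (Fin k) ℝ}, P.IsHermitian → (a • P).IsHermitian :=
      fun a P hP => by
        unfold Matrix.IsHermitian at hP ⊢
        rw [conjTranspose_smul, hP, star_trivial]
    exact ((hs _ h1).add (hs _ h2)).add (hs _ h3)
  have hθle : LinearMap.range θ ≤ SymR := by
    rintro _ ⟨c, rfl⟩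
    exact mem_range_symFill'_of_isHermitian (hPsym c)
  -- dimension count inside the symmetric matrices
  have hsup : finrank ℝ ↥(V ⊔ LinearMap.range θ) ≤ (k + 1).choose 2 :=
    (Submodule.finrank_mono (sup_le hVle hθle)).trans (finrank_range_symFill'_le k)
  have hinf : 0 < finrank ℝ ↥(V ⊓ LinearMap.range θ) := by
    have h := Submodule.finrank_sup_add_finrank_inf_eq V (LinearMap.range θ)
    omega
  obtain ⟨Dsub, hD0⟩ := (Module.finrank_pos_iff_exists_ne_zero (R := ℝ)).mp hinf
  set D : Matrix (Fin k) (Fin k) ℝ := (Dsub : Matrix (Fin k) (Fin k) ℝ) with hD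
  have hDV : D ∈ V := (Submodule.mem_inf.mp Dsub.2).1
  obtain ⟨c, hc⟩ : D ∈ LinearMap.range θ := (Submodule.mem_inf.mp Dsub.2).2
  have hD0' : D ≠ 0 := fun h => hD0 (Subtype.ext h)
  -- `ker X ⊆ ker D`
  have hkerXD : ∀ w, X *ᵥ w = 0 → D *ᵥ w = 0 := by
    intro w hw
    have hu₁w : u₁ ⬝ᵥ w = 0 := by
      rw [← hy₁', mulVec_dotProduct_of_isHermitian hpsd.1, hw, dotProduct_zero]
    have hu₂w : u₂ ⬝ᵥ w = 0 := by
      rw [← hy₂', mulVec_dotProduct_of_isHermitian hpsd.1, hw, dotProduct_zero]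
    rw [← hc, hθmv, hu₁w, hu₂w]
    simp
  obtain ⟨ε, hε, hplus, hminus⟩ :=
    Literature.LinearAlgebra.Matrix.SpectrahedralConeExtremeRays.exists_posSemidef_add_sub_smul hpsd
      (hVsym D hDV) hkerXD
  exact not_mem_extremePoints_of_perturb hXK (hVL (V.smul_mem ε hDV)) (smul_ne_zero hε.ne' hD0')
    hplus hminus hX

/-- **Extreme points of a psd lift of size `k` come from rank-one matrices as soon as
`dim aff C > C(k+1, 2) − 3`.** [cite: BlekhermanParriloThomas2012, Ch. 4 §4.6 Lemma 4.39 (held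
chunk p0182)] -/
theorem extremePoints_subset_image_vecMulVec_of_choose_lt {E : Type*} [AddCommGroup E]
    [Module ℝ E] (L : AffineSubspace ℝ (Matrix (Fin k) (Fin k) ℝ))
    (π : Matrix (Fin k) (Fin k) ℝ →ₗ[ℝ] E)
    (hdim : (k + 1).choose 2 < finrank ℝ (vectorSpan ℝ (π '' liftSet L)) + 3) :
    (π '' liftSet L).extremePoints ℝ ⊆
      (fun v : Fin k → ℝ => π (vecMulVec v v)) '' {v | vecMulVec v v ∈ L} := by
  intro e he
  obtain ⟨X, hX, hXe⟩ := exists_mem_extremePoints_eq L π he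
  have hdim' : (k + 1).choose 2 < finrank ℝ (vectorSpan ℝ (liftSet L)) + 3 :=
    lt_of_lt_of_le hdim (by have := finrank_vectorSpan_image_le L π; omega)
  obtain ⟨v, rfl⟩ := exists_eq_vecMulVec_of_mem_extremePoints_of_choose_lt
    (vectorSpan ℝ (liftSet L)) (vectorSpan_liftSet_le_direction L)
    (fun D hD => isHermitian_of_mem_vectorSpan_liftSet L hD) hdim' hX
  exact ⟨v, hX.1.2, hXe⟩

end SmallPsdLifts

/-- **Psd lifts of size `k` with `dim aff C > C(k+1,2) − 3` have `μH[k]`-null extreme points**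
(all `k ≥ 1`; for `k ≤ 3` this is `hausdorffMeasure_extremePoints_eq_zero_of_hasPsdLift`, whose
hypothesis `dim aff C > k` is the same condition when `k = 3`). Same proof, with the all-sizes
rank-one lemma. PROVED here. [cite: BlekhermanParriloThomas2012, Ch. 4 §4.6 Lemma 4.39 (held chunk
p0182)] [cite: FawziEtAl2015, §9.1 Problem 9.1 (p24)] -/
theorem hausdorffMeasure_extremePoints_eq_zero_of_hasPsdLift_of_choose_lt {k n : ℕ} (hk : 0 < k)
    {C : Set (Fin n → ℝ)} (hC : HasPsdLift C k)
    (hdim : (k + 1).choose 2 < finrank ℝ (vectorSpan ℝ C) + 3) :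
    μH[(k : ℝ)] (C.extremePoints ℝ) = 0 := by
  classical
  obtain ⟨L, π, rfl⟩ := hC
  change μH[(k : ℝ)] ((π '' liftSet L).extremePoints ℝ) = 0
  change (k + 1).choose 2 < finrank ℝ (vectorSpan ℝ (π '' liftSet L)) + 3 at hdim
  by_cases hsym : ∃ S : Matrix (Fin k) (Fin k) ℝ, S.IsHermitian ∧ S ∉ L.direction
  · obtain ⟨S, hS, hSL⟩ := hsym
    exact measure_mono_null (extremePoints_subset_image_vecMulVec_of_choose_lt L π hdim)
      (hausdorffMeasure_image_vecMulVec_map_null π (volume_setOf_vecMulVec_mem_eq_zero L hS hSL))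
  · push Not at hsym
    have hsub : (π '' liftSet L).extremePoints ℝ ⊆ {0} := by
      intro e he
      obtain ⟨X, hX, hXe⟩ := he.1
      have h0L : (0 : Matrix (Fin k) (Fin k) ℝ) ∈ liftSet L := by
        refine ⟨PosSemidef.zero, ?_⟩
        have h := (AffineSubspace.vadd_mem_iff_mem_direction (-X) hX.2).2 (hsym _ hX.1.1.neg)
        simpa using h
      have h2L : (2 : ℝ) • X ∈ liftSet L := by
        refine ⟨hX.1.smul (by norm_num), ?_⟩
        have h := (AffineSubspace.vadd_mem_iff_mem_direction X hX.2).2 (hsym _ hX.1.1)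
        rw [vadd_eq_add, ← two_smul ℝ X] at h
        exact h
      by_contra hne
      have hseg : e ∈ openSegment ℝ (π 0) (π ((2 : ℝ) • X)) := by
        refine ⟨1 / 2, 1 / 2, by norm_num, by norm_num, by norm_num, ?_⟩
        rw [map_zero, map_smul, smul_zero, zero_add, smul_smul, hXe]
        norm_num
      have h := he.2 ⟨0, h0L, rfl⟩ ⟨_, h2L, rfl⟩ hseg
      rw [map_zero] at h
      exact hne h.symm
    haveI := Measure.nullSingletonClass_hausdorff (Fin n → ℝ) (d := (k : ℝ)) (by exact_mod_cast hk)
    exact measure_mono_null hsub (measure_singleton (0 : Fin n → ℝ))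

/-- **The dimension count is off by at least three for balls.** If the unit ball `Bⁿ` has a psd lift
of size `k < n`, then `C(k+1, 2) ≥ n + 3` (the plain count, `card_le_choose_of_hasPsdLift_euclideanBall`,
gives `C(k+1,2) ≥ n`). Equivalently `Bⁿ` has no `S^k_+`-lift for `C(k+1,2) − 2 ≤ n` (and `k < n`):
`k = 3`: `n = 4, 5, 6`; `k = 4`: `n = 8, 9, 10`; `k = 5`: `n = 13, 14, 15`; … PROVED here.
[cite: FawziEtAl2015, §9.1 Problem 9.1 (p24)] -/
theorem not_hasPsdLift_euclideanBall_of_choose_lt {k n : ℕ} (hkn : k < n)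
    (hcount : (k + 1).choose 2 < n + 3) : ¬ HasPsdLift {x : Fin n → ℝ | ∑ l, x l ^ 2 ≤ 1} k := by
  intro h
  rcases Nat.eq_zero_or_pos k with rfl | hk
  · have := card_le_choose_of_hasPsdLift_euclideanBall h
    simp at this
    omega
  have hdim : (k + 1).choose 2 < finrank ℝ (vectorSpan ℝ {x : Fin n → ℝ | ∑ l, x l ^ 2 ≤ 1}) + 3 := by
    rw [vectorSpan_euclideanBall_eq_top, finrank_top, Module.finrank_fin_fun]
    exact hcount
  have h0 := hausdorffMeasure_extremePoints_eq_zero_of_hasPsdLift_of_choose_lt hk h hdim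
  exact (SmallPsdLifts.hausdorffMeasure_sphere_pos_of_lt hkn).ne'
    (measure_mono_null (sphere_subset_extremePoints_euclideanBall n) h0)

/-- The same bound read as an inequality: a psd lift of `Bⁿ` of size `k < n` has
`C(k+1, 2) ≥ n + 3`. [cite: FawziEtAl2015, §9.1 Problem 9.1 (p24)] -/
theorem add_three_le_choose_of_hasPsdLift_euclideanBall {k n : ℕ}
    (h : HasPsdLift {x : Fin n → ℝ | ∑ l, x l ^ 2 ≤ 1} k) (hkn : k < n) :
    n + 3 ≤ (k + 1).choose 2 := by
  by_contra hlt
  push Not at hlt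
  exact not_hasPsdLift_euclideanBall_of_choose_lt hkn hlt h

/-- **Strictly convex bodies, all sizes.** A compact strictly convex `C ⊆ ℝⁿ` with non-empty interior
and a psd lift of size `k < n` has `C(k+1, 2) ≥ n + 3`. PROVED here.
[cite: FawziEtAl2015, §9.1 Problem 9.1 (p24)] -/
theorem add_three_le_choose_of_hasPsdLift_of_strictConvex {k n : ℕ} {C : Set (Fin n → ℝ)}
    (hC : IsCompact C) (hsc : StrictConvex ℝ C) (hint : (interior C).Nonempty)
    (h : HasPsdLift C k) (hkn : k < n) : n + 3 ≤ (k + 1).choose 2 := by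
  by_contra hlt
  push Not at hlt
  obtain ⟨m, rfl⟩ := Nat.exists_eq_add_one_of_ne_zero (by omega : n ≠ 0)
  have hspan : affineSpan ℝ C = ⊤ := (hsc.convex.interior_nonempty_iff_affineSpan_eq_top).mp hint
  have hfin : finrank ℝ (vectorSpan ℝ C) = m + 1 := by
    rw [← direction_affineSpan, hspan, AffineSubspace.direction_top, finrank_top,
      Module.finrank_fin_fun]
  rcases Nat.eq_zero_or_pos k with rfl | hk
  · -- a lift of size `0` makes `C` a point
    have hle := finrank_vectorSpan_le_of_hasPsdLift h
    rw [hfin] at hle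
    simp at hle
  have hdim : (k + 1).choose 2 < finrank ℝ (vectorSpan ℝ C) + 3 := by rw [hfin]; exact hlt
  have h0 := hausdorffMeasure_extremePoints_eq_zero_of_hasPsdLift_of_choose_lt hk h hdim
  have hfr := measure_mono_null
    (frontier_subset_extremePoints_of_strictConvex hC.isClosed hsc) h0
  have hpos : 0 < μH[(k : ℝ)] (frontier C) := by
    have hkm : (k : ℝ) ≤ (m : ℝ) := by exact_mod_cast (by omega : k ≤ m)
    exact lt_of_lt_of_le (hausdorffMeasure_frontier_pos hC hint)
      (Measure.hausdorffMeasure_mono hkm _)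
  exact hpos.ne' hfr

/-! ### Exact values for small balls: `B²`, `B³`, `B⁴` need exactly `2`, `3`, `4` -/

/-- The unit disc `B²` has a psd lift of size `2` (the tree's ellipse lift `hasPsdLift_ellipse`
with `A = I`, `c = 0`, `γ = −1`; "`S²_+` is the Lorentz cone", FGPRT §4 p13). [cite: FawziEtAl2015, §4 (p13)] -/
theorem hasPsdLift_euclideanBall_fin_two : HasPsdLift {x : Fin 2 → ℝ | ∑ l, x l ^ 2 ≤ 1} 2 := by
  have h := hasPsdLift_ellipse (1 : Matrix (Fin 2) (Fin 2) ℝ) 0 (-1) Matrix.PosDef.one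
  have hset : {y : Fin 2 → ℝ | y ⬝ᵥ ((1 : Matrix (Fin 2) (Fin 2) ℝ) *ᵥ y) + 2 * (0 ⬝ᵥ y) + (-1) ≤ 0}
      = {x : Fin 2 → ℝ | ∑ l, x l ^ 2 ≤ 1} := by
    ext y
    simp only [Set.mem_setOf_eq, Matrix.one_mulVec, zero_dotProduct, mul_zero, add_zero]
    simp only [dotProduct, sq]
    constructor
    · intro hy; linarith
    · intro hy; linarith
  rw [hset] at h
  exact h

/-- **The least psd-lift size of the unit disc `B²` is `2`** (sizes `0, 1` are excluded by
`not_hasPsdLift_euclideanBall`). [cite: FawziEtAl2015, §9.1 (p24)] -/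
theorem isLeast_psdLiftSize_euclideanBall_fin_two :
    IsLeast {k : ℕ | HasPsdLift {x : Fin 2 → ℝ | ∑ l, x l ^ 2 ≤ 1} k} 2 := by
  refine ⟨hasPsdLift_euclideanBall_fin_two, fun k hk => ?_⟩
  by_contra hlt
  push Not at hlt
  exact not_hasPsdLift_euclideanBall (by omega) (by omega) hk

/-! ### Homogenisation: cones over bounded lifted sets; the second-order cones `L³_+`, `L⁵_+` -/

/-- The cone over `B × {1}` inside `ℝ^{n+1}` (the scaling factor is the last coordinate):
`{(s x, s) : s ≥ 0, x ∈ B}`. [cite: FawziEtAl2022Lifting, §5.1.3 (p25)] -/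
def coneOver {n : ℕ} (B : Set (Fin n → ℝ)) : Set (Fin (n + 1) → ℝ) :=
  {y | ∃ s : ℝ, 0 ≤ s ∧ ∃ x ∈ B, y = Fin.snoc (s • x) s}

/-- Membership in `coneOver B`. [cite: FawziEtAl2022Lifting, §5.1.3 (p25)] -/
theorem mem_coneOver_iff {n : ℕ} {B : Set (Fin n → ℝ)} {y : Fin (n + 1) → ℝ} :
    y ∈ coneOver B ↔ ∃ s : ℝ, 0 ≤ s ∧ ∃ x ∈ B, y = Fin.snoc (s • x) s := Iff.rfl

/-- **Homogenisation keeps the psd-lift size.** If a bounded set `B ⊆ ℝⁿ` with at least two points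
has a psd lift `B = π(S^k_+ ∩ L)`, then the cone over `B × {1}` is `Π(S^k_+ ∩ W)` with
`W = ℝX₁ + dir L` (`X₁ ∈ S^k_+ ∩ L`) and `Π(Y) = (π Y, f Y)`, `f` a linear functional with
`f|_{dir L} = 0`, `f(X₁) = 1`. Two observations make this work: a psd direction `D ∈ dir L` has
`π D = 0` (else `π(X₁ + sD)` leaves the bounded `B`), and `S^k_+ ∩ W` contains no `Y` with
`f(Y) < 0` (else `Z = Y/f(Y) ⪯ 0` lies in `L` and `π X = π Z` for every `X ∈ S^k_+ ∩ L`, so `B`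
would be a point). PROVED here. [cite: FawziEtAl2022Lifting, §5.1.3 (p25)]
[cite: FawziEtAl2015, §3.1 eq. (3) (p09)] -/
theorem HasPsdLift.coneOver {n k : ℕ} {B : Set (Fin n → ℝ)} (h : HasPsdLift B k)
    (hbdd : Bornology.IsBounded B) (hB : B.Nontrivial) : HasPsdLift (coneOver B) k := by
  classical
  obtain ⟨L, π, rfl⟩ := h
  set K : Set (Matrix (Fin k) (Fin k) ℝ) := {M | M.PosSemidef ∧ M ∈ L} with hK
  obtain ⟨_, ⟨X₁, hX₁, rfl⟩, _, ⟨X₂, hX₂, rfl⟩, hne⟩ := hB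
  obtain ⟨R, hRpos, hR⟩ := hbdd.subset_closedBall_lt 0 (0 : Fin n → ℝ)
  -- psd directions of `L` are killed by `π`
  have hF3 : ∀ D ∈ L.direction, D.PosSemidef → π D = 0 := by
    intro D hD hDpsd
    by_contra hπD
    have hpos : 0 < ‖π D‖ := norm_pos_iff.mpr hπD
    set s : ℝ := (R + ‖π X₁‖ + 1) / ‖π D‖ with hs
    have hs0 : 0 ≤ s := by positivity
    have hmem : X₁ + s • D ∈ K := by
      refine ⟨hX₁.1.add (hDpsd.smul hs0), ?_⟩
      have := (AffineSubspace.vadd_mem_iff_mem_direction (s • D) hX₁.2).2 (L.direction.smul_mem s hD)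
      rwa [vadd_eq_add, add_comm] at this
    have hball := hR ⟨X₁ + s • D, hmem, rfl⟩
    rw [Metric.mem_closedBall, dist_zero_right, map_add, map_smul] at hball
    have h1 : ‖s • π D‖ ≤ ‖π X₁ + s • π D‖ + ‖π X₁‖ := by
      have := norm_sub_le (π X₁ + s • π D) (π X₁)
      simpa using this
    rw [norm_smul, Real.norm_eq_abs, abs_of_nonneg hs0] at h1
    have h2 : s * ‖π D‖ = R + ‖π X₁‖ + 1 := by
      rw [hs, div_mul_cancel₀ _ hpos.ne']
    linarith
  -- `X₁` is not a direction of `L` (else `B` would be a bounded cone, i.e. a point)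
  have hX₁dir : X₁ ∉ L.direction := by
    intro hX₁V
    -- then every `X ∈ K` has `π X = 0`... more precisely `π X₂ = π X₁ = 0`
    have h1 : π X₁ = 0 := hF3 X₁ hX₁V hX₁.1
    have hX₂V : X₂ ∈ L.direction := by
      have h := AffineSubspace.vsub_mem_direction hX₂.2 hX₁.2
      rw [vsub_eq_sub] at h
      have : X₂ = (X₂ - X₁) + X₁ := by abel
      rw [this]
      exact L.direction.add_mem h hX₁V
    have h2 : π X₂ = 0 := hF3 X₂ hX₂V hX₂.1
    exact hne (h1.trans h2.symm)
  -- the functional `f`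
  obtain ⟨f₀, hf₀X, hf₀V⟩ := Submodule.exists_dual_map_eq_bot_of_notMem hX₁dir inferInstance
  set f : Module.Dual ℝ (Matrix (Fin k) (Fin k) ℝ) := (f₀ X₁)⁻¹ • f₀ with hf
  have hfX₁ : f X₁ = 1 := by
    rw [hf, LinearMap.smul_apply, smul_eq_mul, inv_mul_cancel₀ hf₀X]
  have hfV : ∀ D ∈ L.direction, f D = 0 := fun D hD => by
    have h : f₀ D ∈ Submodule.map f₀ L.direction := Submodule.mem_map_of_mem hD
    rw [hf₀V] at h
    rw [hf, LinearMap.smul_apply, (Submodule.mem_bot ℝ).mp h, smul_zero]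
  have hfL : ∀ X ∈ L, f X = 1 := fun X hX => by
    have h := hfV _ (by
      have := AffineSubspace.vsub_mem_direction hX hX₁.2
      rwa [vsub_eq_sub] at this)
    rw [map_sub, hfX₁, sub_eq_zero] at h
    exact h
  -- the linear subspace `W = ℝ X₁ + dir L`
  set W : Submodule ℝ (Matrix (Fin k) (Fin k) ℝ) := (ℝ ∙ X₁) ⊔ L.direction with hW
  have hWdecomp : ∀ Y ∈ W, Y - f Y • X₁ ∈ L.direction := by
    intro Y hY
    obtain ⟨y, hy, z, hz, rfl⟩ := Submodule.mem_sup.mp hY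
    obtain ⟨a, rfl⟩ := Submodule.mem_span_singleton.mp hy
    have : f (a • X₁ + z) = a := by
      rw [map_add, map_smul, hfX₁, hfV z hz, smul_eq_mul, mul_one, add_zero]
    rw [this]
    simpa using hz
  have hLW : ∀ X ∈ L, X ∈ W := fun X hX => by
    have h : X = X₁ + (X - X₁) := by abel
    rw [h]
    refine W.add_mem (Submodule.mem_sup_left (Submodule.mem_span_singleton_self X₁))
      (Submodule.mem_sup_right ?_)
    have := AffineSubspace.vsub_mem_direction hX hX₁.2
    rwa [vsub_eq_sub] at this
  -- `Y ∈ W` with `f Y = t ≠ 0` rescales into `L`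
  have hrescale : ∀ Y ∈ W, f Y ≠ 0 → (f Y)⁻¹ • Y ∈ L := by
    intro Y hY ht
    have hD := hWdecomp Y hY
    have h : (f Y)⁻¹ • Y = ((f Y)⁻¹ • (Y - f Y • X₁)) +ᵥ X₁ := by
      rw [vadd_eq_add, smul_sub, smul_smul, inv_mul_cancel₀ ht, one_smul]
      abel
    rw [h]
    exact (AffineSubspace.vadd_mem_iff_mem_direction _ hX₁.2).2 (L.direction.smul_mem _ hD)
  -- no `Y ⪰ 0` in `W` has `f Y < 0`
  have hF4 : ∀ Y ∈ W, Y.PosSemidef → 0 ≤ f Y := by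
    intro Y hY hYpsd
    by_contra hneg
    push Not at hneg
    set Z : Matrix (Fin k) (Fin k) ℝ := (f Y)⁻¹ • Y with hZ
    have hZL : Z ∈ L := hrescale Y hY hneg.ne
    have hZneg : (-Z).PosSemidef := by
      rw [hZ, ← neg_smul]
      exact hYpsd.smul (by rw [neg_nonneg]; exact (inv_lt_zero.mpr hneg).le)
    have hπ : ∀ X ∈ K, π X = π Z := by
      intro X hX
      have hdir : X - Z ∈ L.direction := by
        have := AffineSubspace.vsub_mem_direction hX.2 hZL
        rwa [vsub_eq_sub] at this
      have hpsd : (X - Z).PosSemidef := by rw [sub_eq_add_neg]; exact hX.1.add hZneg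
      have := hF3 _ hdir hpsd
      rwa [map_sub, sub_eq_zero] at this
    exact hne ((hπ X₁ hX₁).trans (hπ X₂ hX₂).symm)
  -- the homogenised lift map
  let Pl : Matrix (Fin k) (Fin k) ℝ →ₗ[ℝ] (Fin (n + 1) → ℝ) :=
    { toFun := fun Y => Fin.snoc (π Y) (f Y)
      map_add' := fun Y Y' => by
        ext i
        refine Fin.lastCases ?_ (fun j => ?_) i
        · rw [Pi.add_apply, Fin.snoc_last, Fin.snoc_last, Fin.snoc_last, map_add]
        · rw [Pi.add_apply, Fin.snoc_castSucc, Fin.snoc_castSucc, Fin.snoc_castSucc, map_add,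
            Pi.add_apply]
      map_smul' := fun a Y => by
        ext i
        refine Fin.lastCases ?_ (fun j => ?_) i
        · rw [RingHom.id_apply, Pi.smul_apply, Fin.snoc_last, Fin.snoc_last, map_smul,
            smul_eq_mul]
        · rw [RingHom.id_apply, Pi.smul_apply, Fin.snoc_castSucc, Fin.snoc_castSucc, map_smul,
            Pi.smul_apply] }
  have hPl : ∀ Y, Pl Y = Fin.snoc (π Y) (f Y) := fun Y => rfl
  refine ⟨W.toAffineSubspace, Pl, Set.ext fun y => ⟨?_, ?_⟩⟩
  · -- cone ⊆ image
    rintro ⟨s, hs, _, ⟨X, hX, rfl⟩, rfl⟩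
    refine ⟨s • X, ⟨hX.1.smul hs, ?_⟩, ?_⟩
    · exact Submodule.mem_toAffineSubspace.mpr (W.smul_mem s (hLW X hX.2))
    · rw [hPl, map_smul, map_smul, hfL X hX.2, smul_eq_mul, mul_one]
  · -- image ⊆ cone
    rintro ⟨Y, ⟨hYpsd, hYW⟩, rfl⟩
    have hYW' : Y ∈ W := Submodule.mem_toAffineSubspace.mp hYW
    have ht := hF4 Y hYW' hYpsd
    rcases ht.eq_or_lt with ht0 | htpos
    · -- `f Y = 0`: `Y` is a psd direction, `π Y = 0`
      have hYdir : Y ∈ L.direction := by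
        have := hWdecomp Y hYW'
        rwa [← ht0, zero_smul, sub_zero] at this
      have hπY : π Y = 0 := hF3 Y hYdir hYpsd
      refine ⟨0, le_rfl, π X₁, ⟨X₁, hX₁, rfl⟩, ?_⟩
      rw [hPl, hπY, ← ht0, zero_smul]
    · -- `f Y = t > 0`: rescale into `L`
      set t : ℝ := f Y with htdef
      have hXL : t⁻¹ • Y ∈ L := hrescale Y hYW' htpos.ne'
      have hXpsd : (t⁻¹ • Y).PosSemidef := hYpsd.smul (inv_pos.mpr htpos).le
      refine ⟨t, htpos.le, π (t⁻¹ • Y), ⟨t⁻¹ • Y, ⟨hXpsd, hXL⟩, rfl⟩, ?_⟩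
      rw [hPl, map_smul, smul_smul, mul_inv_cancel₀ htpos.ne', one_smul]

/-- The cone over the unit ball `Bⁿ × {1}` is the second-order cone `L^{n+1}_+`.
[cite: FawziEtAl2022Lifting, §5.1.3 (p25)] -/
theorem coneOver_euclideanBall (n : ℕ) :
    coneOver {x : Fin n → ℝ | ∑ l, x l ^ 2 ≤ 1} = secondOrderConeSet n := by
  ext y
  rw [mem_coneOver_iff, mem_secondOrderConeSet_iff]
  constructor
  · rintro ⟨s, hs, x, hx, rfl⟩
    have hx' : ∑ l, x l ^ 2 ≤ 1 := hx
    simp only [Fin.snoc_castSucc, Fin.snoc_last, Pi.smul_apply, smul_eq_mul, mul_pow,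
      ← Finset.mul_sum]
    refine ⟨?_, hs⟩
    nlinarith [sq_nonneg s]
  · rintro ⟨hy, ht⟩
    set t : ℝ := y (Fin.last n) with htdef
    rcases ht.eq_or_lt with ht0 | htpos
    · -- `t = 0` forces `y = 0`
      have hsum0 : ∑ j : Fin n, y (Fin.castSucc j) ^ 2 = 0 :=
        le_antisymm (by rw [← ht0] at hy; simpa using hy) (Finset.sum_nonneg fun j _ => sq_nonneg _)
      have hyj : ∀ j : Fin n, y (Fin.castSucc j) = 0 := fun j => by
        have h := (Finset.sum_eq_zero_iff_of_nonneg fun j _ => sq_nonneg (y (Fin.castSucc j))).mp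
          hsum0 j (Finset.mem_univ j)
        exact pow_eq_zero_iff (n := 2) (by norm_num) |>.mp h
      refine ⟨0, le_rfl, 0, by simp, ?_⟩
      funext i
      refine Fin.lastCases ?_ (fun j => ?_) i
      · rw [Fin.snoc_last]; exact ht0.symm
      · rw [Fin.snoc_castSucc, hyj j]; simp
    · refine ⟨t, htpos.le, fun j => y (Fin.castSucc j) / t, ?_, ?_⟩
      · change ∑ l, (y (Fin.castSucc l) / t) ^ 2 ≤ 1
        simp only [div_pow, ← Finset.sum_div]
        rw [div_le_one (by positivity)]
        exact hy
      · funext i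
        refine Fin.lastCases ?_ (fun j => ?_) i
        · rw [Fin.snoc_last]
        · rw [Fin.snoc_castSucc, Pi.smul_apply, smul_eq_mul, mul_div_cancel₀ _ htpos.ne']

/-- **Psd lifts of the ball homogenise to the second-order cone**: `HasPsdLift Bⁿ k →
HasPsdLift L^{n+1}_+ k` (`n ≥ 1`). [cite: FawziEtAl2022Lifting, §5.1.3 (p25)] -/
theorem hasPsdLift_secondOrderCone_of_euclideanBall {n k : ℕ} (hn : 1 ≤ n)
    (h : HasPsdLift {x : Fin n → ℝ | ∑ l, x l ^ 2 ≤ 1} k) : HasPsdLift (secondOrderConeSet n) k := by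
  classical
  rw [← coneOver_euclideanBall]
  refine h.coneOver ?_ ?_
  · rw [Metric.isBounded_iff_subset_closedBall 0]
    refine ⟨1, fun x hx => ?_⟩
    have hx' : ∑ l, x l ^ 2 ≤ 1 := hx
    rw [Metric.mem_closedBall, dist_zero_right, pi_norm_le_iff_of_nonneg zero_le_one]
    intro l
    rw [Real.norm_eq_abs, abs_le]
    have h1 : x l ^ 2 ≤ ∑ l, x l ^ 2 :=
      Finset.single_le_sum (fun l _ => sq_nonneg (x l)) (Finset.mem_univ l)
    constructor <;> nlinarith
  · obtain ⟨m, rfl⟩ := Nat.exists_eq_add_one_of_ne_zero (by omega : n ≠ 0)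
    refine ⟨0, by simp, Pi.single 0 1, ?_, ?_⟩
    · change ∑ l, (Pi.single (0 : Fin (m + 1)) (1 : ℝ) : Fin (m + 1) → ℝ) l ^ 2 ≤ 1
      rw [Finset.sum_eq_single (0 : Fin (m + 1)) (fun l _ hl => by simp [hl]) (by simp)]
      simp
    · intro h0
      have := congrFun h0 0
      simp at this

/-- The second-order cone `L^{n+1}_+` has a psd lift of size `s + t` whenever `1 ≤ n ≤ s·t`
(homogenise the Frobenius-ball lift of the tree). [cite: FawziEtAl2022Lifting, §5.1.3 (p25)]
[cite: FawziEtAl2015, §9.1 Problem 9.1 (p24)] -/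
theorem hasPsdLift_secondOrderCone {n s t : ℕ} (hn : 1 ≤ n) (hst : n ≤ s * t) :
    HasPsdLift (secondOrderConeSet n) (s + t) :=
  hasPsdLift_secondOrderCone_of_euclideanBall hn (hasPsdLift_euclideanBall (σ := Fin n) (by simpa))

/-- **The least psd-lift size of the `3`-dimensional second-order cone `L³_+` is `2`**
(`L³_+ ≅ S²_+`; the disc lift homogenised, and sizes `≤ 1` excluded).
[cite: FawziEtAl2022Lifting, §5.1.3 (p25)] -/
theorem isLeast_psdLiftSize_secondOrderCone_two :
    IsLeast {k : ℕ | HasPsdLift (secondOrderConeSet 2) k} 2 := by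
  refine ⟨hasPsdLift_secondOrderCone_of_euclideanBall (by norm_num) hasPsdLift_euclideanBall_fin_two,
    fun k hk => ?_⟩
  by_contra hlt
  push Not at hlt
  exact not_hasPsdLift_secondOrderCone (k := k) (n := 2) (by omega) (by omega) hk

/-- **The least psd-lift size of the `5`-dimensional second-order cone `L⁵_+` is `4`** (the
Frobenius-ball lift of `B⁴` homogenised; sizes `≤ 3` excluded by `not_hasPsdLift_secondOrderCone`).
PROVED here. [cite: FawziEtAl2022Lifting, §5.1.3 (p25)] [cite: FawziEtAl2015, §9.1 Problem 9.1 (p24)] -/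
theorem isLeast_psdLiftSize_secondOrderCone_four :
    IsLeast {k : ℕ | HasPsdLift (secondOrderConeSet 4) k} 4 := by
  refine ⟨hasPsdLift_secondOrderCone (n := 4) (s := 2) (t := 2) (by norm_num) (by norm_num),
    fun k hk => ?_⟩
  by_contra hlt
  push Not at hlt
  exact not_hasPsdLift_secondOrderCone (k := k) (n := 4) (by omega) (by omega) hk

/-! ### Factorization form: the slack kernel `1 − ⟨x, y⟩` of the sphere has no `S^k_+`-factorization -/

/-- **Gouveia–Parrilo–Thomas Theorem 2.4, direction "factorization ⇒ lift", for the Euclidean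
ball.** If `A, B : S^{n−1} → S^k_+` (no regularity) satisfy `Tr(A(x)B(y)) = 1 − ⟨x, y⟩` for all
unit `x, y` — a `S^k_+`-factorization of the slack operator `S_C(x, y) = 1 − ⟨x, y⟩` of `C = Bⁿ`
on `ext(C) × ext(C°) = S^{n−1} × S^{n−1}` (GPT Def. 2.2) — then `Bⁿ = π(S^k_+ ∩ L)` with
`π(Z)_l = (Tr(Z B(−e_l)) − Tr(Z B(e_l)))/2` and `L = {Z : 1 − ⟨π Z, y⟩ = Tr(Z B(y)) ∀ unit y}`
(`⊆`: `Tr(Z B(y)) ≥ 0` gives `⟨πZ, y⟩ ≤ 1` for all unit `y`; `⊇`: `x = a u + b(−u)` lifts to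
`a A(u) + b A(−u)`); `n ≥ 1`. This is the printed "conversely, if `S_C` is `K`-factorizable then
`C` has a `K`-lift" with GPT's `L`, `π` written out for the ball.
[cite: GouveiaParriloThomas2013, Thm. 2.4 (§2, p05)] [cite: FawziEtAl2015, Thm. 3.3 (p09)] -/
theorem hasPsdLift_euclideanBall_of_psd_factorization {k n : ℕ} (hn : 0 < n)
    {A B : (Fin n → ℝ) → Matrix (Fin k) (Fin k) ℝ}
    (hA : ∀ x, ∑ l, x l ^ 2 = 1 → (A x).PosSemidef) (hB : ∀ y, ∑ l, y l ^ 2 = 1 → (B y).PosSemidef)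
    (hAB : ∀ x y, ∑ l, x l ^ 2 = 1 → ∑ l, y l ^ 2 = 1 → (A x * B y).trace = 1 - x ⬝ᵥ y) :
    HasPsdLift {x : Fin n → ℝ | ∑ l, x l ^ 2 ≤ 1} k := by
  classical
  -- unit vectors `± e_l`
  have hunit : ∀ (l : Fin n) (σ : ℝ), σ ^ 2 = 1 →
      ∑ l', (σ • (Pi.single l (1 : ℝ) : Fin n → ℝ)) l' ^ 2 = 1 := by
    intro l σ hσ
    rw [Finset.sum_eq_single l (fun m _ hm => by simp [hm]) (by simp)]
    simpa using hσ
  have hneg_unit : ∀ u : Fin n → ℝ, ∑ l, u l ^ 2 = 1 → ∑ l, (-u) l ^ 2 = 1 := fun u hu => by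
    simpa using hu
  -- the reading map `π`
  let π : Matrix (Fin k) (Fin k) ℝ →ₗ[ℝ] (Fin n → ℝ) :=
    { toFun := fun Z l =>
        ((Z * B (-(Pi.single l 1))).trace - (Z * B (Pi.single l 1)).trace) / 2
      map_add' := fun Z Z' => by
        funext l
        simp only [Pi.add_apply, Matrix.add_mul, Matrix.trace_add]
        ring
      map_smul' := fun c Z => by
        funext l
        simp only [Pi.smul_apply, Matrix.smul_mul, Matrix.trace_smul, smul_eq_mul,
          RingHom.id_apply]
        ring }
  have hπ : ∀ Z l, π Z l = ((Z * B (-(Pi.single l 1))).trace - (Z * B (Pi.single l 1)).trace) / 2 :=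
    fun Z l => rfl
  -- `π(A u) = u` for unit `u`
  have hπA : ∀ u : Fin n → ℝ, ∑ l, u l ^ 2 = 1 → π (A u) = u := by
    intro u hu
    funext l
    rw [hπ, hAB u _ hu (by simpa using hunit l (-1) (by norm_num)),
      hAB u _ hu (by simpa using hunit l 1 (by norm_num))]
    simp [dotProduct_neg, dotProduct_single]
  -- the affine subspace `L`
  let L : AffineSubspace ℝ (Matrix (Fin k) (Fin k) ℝ) :=
    { carrier := {Z | ∀ y : Fin n → ℝ, ∑ l, y l ^ 2 = 1 → 1 - π Z ⬝ᵥ y = (Z * B y).trace}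
      smul_vsub_vadd_mem' := by
        intro c Z₁ Z₂ Z₃ h₁ h₂ h₃ y hy
        have e₁ := h₁ y hy
        have e₂ := h₂ y hy
        have e₃ := h₃ y hy
        have f₁ : π Z₁ ⬝ᵥ y = 1 - (Z₁ * B y).trace := by linarith
        have f₂ : π Z₂ ⬝ᵥ y = 1 - (Z₂ * B y).trace := by linarith
        have f₃ : π Z₃ ⬝ᵥ y = 1 - (Z₃ * B y).trace := by linarith
        rw [vsub_eq_sub, vadd_eq_add, map_add, map_smul, map_sub, add_dotProduct, smul_dotProduct,
          sub_dotProduct, smul_eq_mul, Matrix.add_mul, Matrix.smul_mul, Matrix.sub_mul,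
          Matrix.trace_add, Matrix.trace_smul, Matrix.trace_sub, smul_eq_mul, f₁, f₂, f₃]
        ring }
  have hLmem : ∀ Z, Z ∈ L ↔ ∀ y : Fin n → ℝ, ∑ l, y l ^ 2 = 1 → 1 - π Z ⬝ᵥ y = (Z * B y).trace :=
    fun Z => Iff.rfl
  have hAL : ∀ u : Fin n → ℝ, ∑ l, u l ^ 2 = 1 → A u ∈ L := by
    intro u hu
    rw [hLmem]
    intro y hy
    rw [hπA u hu, hAB u y hu hy]
  refine ⟨L, π, Set.ext fun x => ⟨fun hx => ?_, ?_⟩⟩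
  · -- `x ∈ Bⁿ` is `a u + b (−u)` for a unit `u`
    have hx' : ∑ l, x l ^ 2 ≤ 1 := hx
    obtain ⟨m, rfl⟩ := Nat.exists_eq_add_one_of_ne_zero hn.ne'
    set s : ℝ := Real.sqrt (∑ l, x l ^ 2) with hs
    have hs0 : 0 ≤ s := Real.sqrt_nonneg _
    have hs1 : s ≤ 1 := by
      rw [hs]
      calc Real.sqrt (∑ l, x l ^ 2) ≤ Real.sqrt 1 := Real.sqrt_le_sqrt hx'
        _ = 1 := Real.sqrt_one
    have hs2 : s ^ 2 = ∑ l, x l ^ 2 := Real.sq_sqrt (Finset.sum_nonneg fun l _ => sq_nonneg _)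
    -- a unit vector `u` with `x = s • u`
    obtain ⟨u, hu, hxu⟩ : ∃ u : Fin (m + 1) → ℝ, ∑ l, u l ^ 2 = 1 ∧ x = s • u := by
      by_cases hs00 : s = 0
      · refine ⟨Pi.single 0 1, by simpa using hunit 0 1 (by norm_num), ?_⟩
        have hx0 : ∀ l, x l = 0 := fun l => by
          have hsum : ∑ l, x l ^ 2 = 0 := by rw [← hs2, hs00]; ring
          have h := (Finset.sum_eq_zero_iff_of_nonneg fun l _ => sq_nonneg (x l)).mp hsum l
            (Finset.mem_univ l)
          exact pow_eq_zero_iff (n := 2) (by norm_num) |>.mp h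
        funext l
        rw [hx0 l, hs00, zero_smul, Pi.zero_apply]
      · refine ⟨s⁻¹ • x, ?_, ?_⟩
        · simp only [Pi.smul_apply, smul_eq_mul, mul_pow, ← Finset.mul_sum, ← hs2]
          field_simp
        · rw [smul_smul, mul_inv_cancel₀ hs00, one_smul]
    set a : ℝ := (1 + s) / 2 with ha
    set b : ℝ := (1 - s) / 2 with hb
    have ha0 : 0 ≤ a := by rw [ha]; linarith
    have hb0 : 0 ≤ b := by rw [hb]; linarith
    have hab : a + b = 1 := by rw [ha, hb]; ring
    have hnu : ∑ l, (-u) l ^ 2 = 1 := hneg_unit u hu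
    refine ⟨a • A u + b • A (-u), ⟨((hA u hu).smul ha0).add ((hA (-u) hnu).smul hb0), ?_⟩, ?_⟩
    · exact L.convex (hAL u hu) (hAL (-u) hnu) ha0 hb0 hab
    · rw [map_add, map_smul, map_smul, hπA u hu, hπA (-u) hnu, hxu, smul_neg, ← sub_eq_add_neg,
        ← sub_smul]
      congr 1
      rw [ha, hb]
      ring
  · rintro ⟨Z, ⟨hZ, hZL⟩, rfl⟩
    -- `⟨π Z, y⟩ ≤ 1` for every unit `y`, hence `|π Z| ≤ 1`
    have hle : ∀ y : Fin n → ℝ, ∑ l, y l ^ 2 = 1 → π Z ⬝ᵥ y ≤ 1 := by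
      intro y hy
      have h := (hLmem Z).mp hZL y hy
      have hnn : 0 ≤ (Z * B y).trace :=
        Literature.LinearAlgebra.Matrix.NearestPositiveSemidefinite.trace_mul_nonneg hZ (hB y hy)
      linarith
    change ∑ l, π Z l ^ 2 ≤ 1
    set z : Fin n → ℝ := π Z with hz
    set s : ℝ := Real.sqrt (∑ l, z l ^ 2) with hs
    have hs0 : 0 ≤ s := Real.sqrt_nonneg _
    have hs2 : s ^ 2 = ∑ l, z l ^ 2 := Real.sq_sqrt (Finset.sum_nonneg fun l _ => sq_nonneg _)
    by_cases hs00 : s = 0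
    · rw [← hs2, hs00]; norm_num
    · have hspos : 0 < s := lt_of_le_of_ne hs0 (Ne.symm hs00)
      have hunit' : ∑ l, (s⁻¹ • z) l ^ 2 = 1 := by
        simp only [Pi.smul_apply, smul_eq_mul, mul_pow, ← Finset.mul_sum, ← hs2]
        field_simp
      have h := hle (s⁻¹ • z) hunit'
      rw [dotProduct_smul, smul_eq_mul] at h
      have hzz : z ⬝ᵥ z = s ^ 2 := by
        rw [hs2]
        simp only [dotProduct, sq]
      rw [hzz] at h
      have hs1 : s ≤ 1 := by
        have : s⁻¹ * s ^ 2 = s := by field_simp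
        linarith
      rw [← hs2]
      nlinarith

/-- **No psd factorization of size `k` of the sphere's slack kernel** (`k < n`, `C(k+1,2) < n + 3`;
e.g. `n = 4`, `k = 3`): there are no maps `A, B : S^{n−1} → S^k_+` — no regularity assumed — with
`Tr(A(x) B(y)) = 1 − ⟨x, y⟩` for all unit `x, y`. This is the "semidefinite representation of the
`3`-sphere" of [FawziEtAl2015, §9.1 p24] in the factorization language of FGPRT Thm 3.3 /
Def 2.2 (the matrices of Problems 9.1/9.2 and every sphere slack matrix
`hasPsdFactorization_sphereSlack` are finite submatrices of this kernel, all of psd rank `≤ 4` for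
`S³`). Proof: such `A, B` would give a psd lift `Bⁿ = π(S^k_+ ∩ L)` of size `k`
(`hasPsdLift_euclideanBall_of_psd_factorization`, the Gouveia–Parrilo–Thomas direction
"factorization ⇒ lift" written out for the ball), contradicting
`not_hasPsdLift_euclideanBall_of_choose_lt`. PROVED here.
[cite: FawziEtAl2015, Thm. 3.3 (p09) and §9.1 Problem 9.1 (p24)] -/
theorem not_exists_psd_factorization_sphere_slack {k n : ℕ} (hkn : k < n)
    (hcount : (k + 1).choose 2 < n + 3) :
    ¬ ∃ (A B : (Fin n → ℝ) → Matrix (Fin k) (Fin k) ℝ),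
        (∀ x, ∑ l, x l ^ 2 = 1 → (A x).PosSemidef) ∧ (∀ y, ∑ l, y l ^ 2 = 1 → (B y).PosSemidef) ∧
        ∀ x y, ∑ l, x l ^ 2 = 1 → ∑ l, y l ^ 2 = 1 → (A x * B y).trace = 1 - x ⬝ᵥ y := by
  rintro ⟨A, B, hA, hB, hAB⟩
  exact not_hasPsdLift_euclideanBall_of_choose_lt hkn hcount
    (hasPsdLift_euclideanBall_of_psd_factorization (by omega) hA hB hAB)

/-- **The case of the `3`-sphere** (`n = 4`, `k = 3`): no maps `A, B : S³ → S³_+` with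
`Tr(A(x)B(y)) = 1 − ⟨x, y⟩` — the slack kernel of `S³`, whose finite submatrices are the sphere
slack matrices of psd rank `≤ 4` (`hasPsdFactorization_sphereSlack`; Problems 9.1/9.2 ask for the
exact value on special configurations), has no size-`3` psd factorization.
[cite: FawziEtAl2015, §9.1 Problem 9.1 (p24)] -/
theorem not_exists_psd_factorization_sphere_slack_fin_four_three :
    ¬ ∃ (A B : (Fin 4 → ℝ) → Matrix (Fin 3) (Fin 3) ℝ),
        (∀ x, ∑ l, x l ^ 2 = 1 → (A x).PosSemidef) ∧ (∀ y, ∑ l, y l ^ 2 = 1 → (B y).PosSemidef) ∧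
        ∀ x y, ∑ l, x l ^ 2 = 1 → ∑ l, y l ^ 2 = 1 → (A x * B y).trace = 1 - x ⬝ᵥ y :=
  not_exists_psd_factorization_sphere_slack (by norm_num) (by decide)

/-- **Size-`(s+t)` psd factorizations of the sphere kernel exist when `n ≤ s·t`**: with the
Frobenius/squared-distance factorization of the tree (`hasPsdFactorization_sqDist`, applied to ALL
points of `ℝⁿ` as index set) and `1 − ⟨x, y⟩ = ½|x − y|²` on the unit sphere, there are
`A, B : ℝⁿ → S^{s+t}_+` with `Tr(A(x)B(y)) = 1 − ⟨x, y⟩` for unit `x, y`; for `S³`: size `4`.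
[cite: FawziEtAl2015, §9.1 Problem 9.1 (p24)] -/
theorem exists_psd_factorization_sphere_slack {n s t : ℕ} (hst : n ≤ s * t) :
    ∃ (A B : (Fin n → ℝ) → Matrix (Fin (s + t)) (Fin (s + t)) ℝ),
      (∀ x, ∑ l, x l ^ 2 = 1 → (A x).PosSemidef) ∧ (∀ y, ∑ l, y l ^ 2 = 1 → (B y).PosSemidef) ∧
      ∀ x y, ∑ l, x l ^ 2 = 1 → ∑ l, y l ^ 2 = 1 → (A x * B y).trace = 1 - x ⬝ᵥ y := by
  obtain ⟨A₀, B₀, hA₀, hB₀, hAB₀⟩ := hasPsdFactorization_sqDist (ι := Fin n → ℝ) (κ := Fin n → ℝ)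
    (σ := Fin n) (s := s) (t := t) (fun x => x) (fun y => y) (by simpa using hst)
  refine ⟨fun x => (1 / 2 : ℝ) • A₀ x, B₀, fun x _ => (hA₀ x).smul (by norm_num), fun y _ => hB₀ y,
    fun x y hx hy => ?_⟩
  rw [Matrix.smul_mul, Matrix.trace_smul, smul_eq_mul, ← hAB₀ x y]
  change 1 / 2 * ∑ l, (x l - y l) ^ 2 = 1 - x ⬝ᵥ y
  have hexp : ∑ l, (x l - y l) ^ 2 = ∑ l, x l ^ 2 + ∑ l, y l ^ 2 - 2 * (x ⬝ᵥ y) := by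
    rw [dotProduct, Finset.mul_sum, ← Finset.sum_add_distrib, ← Finset.sum_sub_distrib]
    exact Finset.sum_congr rfl fun l _ => by ring
  rw [hexp, hx, hy]
  ring

/-- **The slack kernel of the `3`-sphere has psd-factorization size exactly `4`**: size `4` exists
(`exists_psd_factorization_sphere_slack`, `4 ≤ 2·2`) and sizes `≤ 3` do not
(`not_exists_psd_factorization_sphere_slack`). Every finite submatrix (a sphere slack matrix) thus
has psd rank `≤ 4`, and FGPRT's Problems 9.1/9.2 ask where particular finite submatrices sit.
[cite: FawziEtAl2015, §9.1 Problem 9.1 (p24)] -/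
theorem isLeast_psdFactorizationSize_sphere_slack_fin_four :
    IsLeast {k : ℕ | ∃ (A B : (Fin 4 → ℝ) → Matrix (Fin k) (Fin k) ℝ),
      (∀ x, ∑ l, x l ^ 2 = 1 → (A x).PosSemidef) ∧ (∀ y, ∑ l, y l ^ 2 = 1 → (B y).PosSemidef) ∧
      ∀ x y, ∑ l, x l ^ 2 = 1 → ∑ l, y l ^ 2 = 1 → (A x * B y).trace = 1 - x ⬝ᵥ y} 4 := by
  refine ⟨exists_psd_factorization_sphere_slack (n := 4) (s := 2) (t := 2) (by norm_num),
    fun k hk => ?_⟩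
  by_contra hlt
  push Not at hlt
  exact not_exists_psd_factorization_sphere_slack (k := k) (n := 4) (by omega)
    (by interval_cases k <;> decide) hk

/-! ### Compactness: psd factorizations of bounded infinite matrices from their finite submatrices

The psd rank of a real matrix with infinitely many rows and columns and BOUNDED entries is
determined by its finite submatrices: normalise each finite factorization to the
Briët–Dadush–Pokutta form `M_{ij} = r²Δ·Tr(X_i Y_j)`, `0 ⪯ X_i, Y_j ⪯ I`
(`HasPsdFactorization.rescale_weak`), extend by `0`, and pass to a cluster point of the resulting
net in the compact product of "Loewner boxes" (Tychonoff). The same cluster-point device extends a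
normalised factorization of a separately continuous kernel from dense families of points to their
closures; for the sphere kernel `1 − ⟨u, v⟩` this turns `not_exists_psd_factorization_sphere_slack`
into statements about FINITE sphere slack matrices (FGPRT §9.1). -/

section PsdRankCompactness

open Filter

namespace SmallPsdLifts

/-- The Loewner box `{X : 0 ⪯ X ⪯ I}` of real `k × k` matrices. [folklore] -/
private def loewnerBox (k : ℕ) : Set (Matrix (Fin k) (Fin k) ℝ) :=
  {X | X.PosSemidef ∧ (1 - X).PosSemidef}

/-- Membership in the Loewner box, unfolded. [folklore] -/
private theorem mem_loewnerBox_iff {k : ℕ} {X : Matrix (Fin k) (Fin k) ℝ} :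
    X ∈ loewnerBox k ↔ X.PosSemidef ∧ (1 - X).PosSemidef := Iff.rfl

/-- `0 ∈ {0 ⪯ X ⪯ I}`. [folklore] -/
private theorem zero_mem_loewnerBox (k : ℕ) : (0 : Matrix (Fin k) (Fin k) ℝ) ∈ loewnerBox k :=
  ⟨PosSemidef.zero, by rw [sub_zero]; exact PosSemidef.one⟩

/-- The Loewner box is compact: closed, with entries bounded by `Tr X ≤ k`. [folklore] -/
private theorem isCompact_loewnerBox (k : ℕ) : IsCompact (loewnerBox k) := by
  have hcl : IsClosed (loewnerBox k) :=
    (isClosed_setOf_posSemidef k).inter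
      ((isClosed_setOf_posSemidef k).preimage (continuous_const.sub continuous_id))
  refine (isCompact_box k k).of_isClosed_subset hcl ?_
  rintro X ⟨hX, h1X⟩ a b
  refine (abs_apply_le_trace_of_posSemidef hX a b).trans ?_
  have h := h1X.trace_nonneg
  rw [trace_sub, trace_one, Fintype.card_fin] at h
  linarith

/-- A continuous function which tends to `c` along `u` and `l` takes the value `c` at every cluster
point of `u` along `l` (Hausdorff codomain). [folklore] -/
private theorem apply_eq_of_mapClusterPt_of_tendsto {α X Y : Type*} [TopologicalSpace X]
    [TopologicalSpace Y] [T2Space Y] {l : Filter α} {u : α → X} {p : X} {φ : X → Y} {c : Y}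
    (hφ : Continuous φ) (hp : MapClusterPt p l u) (hc : Tendsto (φ ∘ u) l (𝓝 c)) : φ p = c :=
  eq_of_nhds_neBot ((hp.continuousAt_comp hφ.continuousAt).clusterPt.mono hc).neBot

/-- **Cluster-point device.** A map `u` into a compact set `S`, along a proper filter `l`, has a
cluster point `a ∈ S` at which every continuous `φ_j` takes the limit value of `φ_j ∘ u` (for any
family of such `φ_j` having limits along `l`). [folklore] -/
private theorem exists_mem_forall_apply_eq_of_tendsto {α X J : Type*} [TopologicalSpace X] {S : Set X}
    (hS : IsCompact S) {l : Filter α} [l.NeBot] {u : α → X} (hu : ∀ i, u i ∈ S)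
    {φ : J → X → ℝ} (hφ : ∀ j, Continuous (φ j)) {c : J → ℝ}
    (hc : ∀ j, Tendsto (fun i => φ j (u i)) l (𝓝 (c j))) :
    ∃ a ∈ S, ∀ j, φ j a = c j := by
  obtain ⟨a, haS, ha⟩ := hS.exists_mapClusterPt (f := l) (u := u)
    (le_principal_iff.2 (mem_map.2 (univ_mem' hu)))
  exact ⟨a, haS, fun j => apply_eq_of_mapClusterPt_of_tendsto (hφ j) ha (hc j)⟩

/-- The pairing `(X, Y) ↦ c · Tr(X Y)` is continuous in `X`. [folklore] -/
private theorem continuous_const_mul_trace_mul_left {k : ℕ} (c : ℝ) (Y : Matrix (Fin k) (Fin k) ℝ) :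
    Continuous fun X : Matrix (Fin k) (Fin k) ℝ => c * (X * Y).trace :=
  continuous_const.mul (continuous_id.matrix_mul continuous_const).matrix_trace

/-- The pairing `(X, Y) ↦ c · Tr(X Y)` is continuous in `Y`. [folklore] -/
private theorem continuous_const_mul_trace_mul_right {k : ℕ} (c : ℝ) (X : Matrix (Fin k) (Fin k) ℝ) :
    Continuous fun Y : Matrix (Fin k) (Fin k) ℝ => c * (X * Y).trace :=
  continuous_const.mul (continuous_const.matrix_mul continuous_id).matrix_trace

/-- Along `comap x (𝓝 p)` the map `x` tends to `p`, and this filter is proper when `p` is in the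
closure of the range of `x`. [folklore] -/
private theorem comap_nhds_neBot_of_mem_closure_range {α P : Type*} [TopologicalSpace P] {x : α → P}
    {p : P} (hp : p ∈ closure (Set.range x)) : (comap x (𝓝 p)).NeBot :=
  comap_neBot fun t ht => by
    obtain ⟨_, hyt, ⟨i, rfl⟩⟩ := mem_closure_iff_nhds.1 hp t ht
    exact ⟨i, hyt⟩

/-- **Extension of a normalised factorization to the closure.** If a kernel `K : P × Q → ℝ`,
continuous in each variable, factors on the ranges of `x : α → P`, `y : β → Q` as
`K(x_i, y_j) = c · Tr(X_i Y_j)` with `X_i, Y_j` in the Loewner box, then it factors in the same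
form at all points of the closures of the two ranges: `A(p)` is a cluster point of `X` along
`comap x (𝓝 p)` (so `c·Tr(A(p) Y_j) = K(p, y_j)` by continuity of `K(·, y_j)`), then `B(q)` a
cluster point of `Y` along `comap y (𝓝 q)`. [folklore] -/
private theorem exists_factorization_on_closure {α β P Q : Type*} [TopologicalSpace P] [TopologicalSpace Q]
    {x : α → P} {y : β → Q} {K : P → Q → ℝ} (hK₁ : ∀ q, Continuous fun p => K p q)
    (hK₂ : ∀ p, Continuous (K p)) {r : ℕ} {c : ℝ} {X : α → Matrix (Fin r) (Fin r) ℝ}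
    {Y : β → Matrix (Fin r) (Fin r) ℝ} (hX : ∀ i, X i ∈ loewnerBox r) (hY : ∀ j, Y j ∈ loewnerBox r)
    (hXY : ∀ i j, K (x i) (y j) = c * (X i * Y j).trace) :
    ∃ (A : P → Matrix (Fin r) (Fin r) ℝ) (B : Q → Matrix (Fin r) (Fin r) ℝ),
      (∀ p ∈ closure (Set.range x), A p ∈ loewnerBox r) ∧
      (∀ q ∈ closure (Set.range y), B q ∈ loewnerBox r) ∧
      ∀ p ∈ closure (Set.range x), ∀ q ∈ closure (Set.range y), K p q = c * (A p * B q).trace := by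
  classical
  -- first variable
  have hA : ∀ p, ∃ a : Matrix (Fin r) (Fin r) ℝ, p ∈ closure (Set.range x) →
      a ∈ loewnerBox r ∧ ∀ j, c * (a * Y j).trace = K p (y j) := by
    intro p
    by_cases hp : p ∈ closure (Set.range x)
    · haveI := comap_nhds_neBot_of_mem_closure_range hp
      obtain ⟨a, ha, haj⟩ := exists_mem_forall_apply_eq_of_tendsto (isCompact_loewnerBox r)
        (l := comap x (𝓝 p)) hX (φ := fun j a => c * (a * Y j).trace)
        (fun j => continuous_const_mul_trace_mul_left c (Y j)) (c := fun j => K p (y j))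
        (fun j => by
          have h := ((hK₁ (y j)).tendsto p).comp (tendsto_comap (f := x) (x := 𝓝 p))
          refine h.congr fun i => ?_
          simp only [Function.comp_apply, hXY])
      exact ⟨a, fun _ => ⟨ha, haj⟩⟩
    · exact ⟨0, fun h => (hp h).elim⟩
  choose A hA using hA
  -- second variable
  have hB : ∀ q, ∃ b : Matrix (Fin r) (Fin r) ℝ, q ∈ closure (Set.range y) →
      b ∈ loewnerBox r ∧ ∀ p : closure (Set.range x), c * (A p * b).trace = K p q := by
    intro q
    by_cases hq : q ∈ closure (Set.range y)
    · haveI := comap_nhds_neBot_of_mem_closure_range hq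
      obtain ⟨b, hb, hbp⟩ := exists_mem_forall_apply_eq_of_tendsto (isCompact_loewnerBox r)
        (l := comap y (𝓝 q)) hY (φ := fun (p : closure (Set.range x)) b => c * (A p * b).trace)
        (fun p => continuous_const_mul_trace_mul_right c (A p)) (c := fun p => K p q)
        (fun p => by
          have h := ((hK₂ (p : P)).tendsto q).comp (tendsto_comap (f := y) (x := 𝓝 q))
          refine h.congr fun j => ?_
          simp only [Function.comp_apply, (hA p p.2).2 j])
      exact ⟨b, fun _ => ⟨hb, hbp⟩⟩
    · exact ⟨0, fun h => (hq h).elim⟩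
  choose B hB using hB
  exact ⟨A, B, fun p hp => (hA p hp).1, fun q hq => (hB q hq).1,
    fun p hp q hq => ((hB q hq).2 ⟨p, hp⟩).symm⟩

end SmallPsdLifts

open SmallPsdLifts

/-- **Compactness: Briët–Dadush–Pokutta normal form from the finite submatrices.** If every finite
submatrix of a real matrix `M` — arbitrary row and column index sets, entries `≤ Δ`, `0 < Δ` — has
a psd factorization of size `r`, then `M` itself has one in the normal form
`M_{ij} = r²Δ·Tr(X_i Y_j)`, `0 ⪯ X_i, Y_j ⪯ I` of the (weak, elementary) rescaling theorem
`HasPsdFactorization.rescale_weak`: the normalised finite factorizations, extended by `0`, form a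
net in the compact product of Loewner boxes indexed by the pairs of finite sets, and at a cluster
point every identity `M_{ij} = r²Δ·Tr(X_i Y_j)` (valid from the index `({i}, {j})` on) persists by
continuity. The printed theorem is the finite normal form; this compactness consequence is the
form in which it applies to matrices with infinitely many rows and columns (slack operators of
convex bodies). [cite: BrietDadushPokutta2014, Thm. 6 (§3, p. 7)] -/
theorem HasPsdFactorization.rescale_weak_of_finite {ι κ : Type*} {M : ι → κ → ℝ} {r : ℕ} {Δ : ℝ}
    (hΔ : 0 < Δ) (hM : ∀ i j, M i j ≤ Δ)
    (h : ∀ (s : Finset ι) (t : Finset κ), HasPsdFactorization (fun (i : s) (j : t) => M i j) r) :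
    ∃ (X : ι → Matrix (Fin r) (Fin r) ℝ) (Y : κ → Matrix (Fin r) (Fin r) ℝ),
      (∀ i, (X i).PosSemidef ∧ (1 - X i).PosSemidef) ∧
      (∀ j, (Y j).PosSemidef ∧ (1 - Y j).PosSemidef) ∧
      ∀ i j, M i j = (r : ℝ) ^ 2 * Δ * (X i * Y j).trace := by
  classical
  -- normalised factorizations of the finite submatrices, extended by `0`
  have hfin : ∀ d : Finset ι × Finset κ,
      ∃ F : (ι → Matrix (Fin r) (Fin r) ℝ) × (κ → Matrix (Fin r) (Fin r) ℝ),
        (∀ i, F.1 i ∈ loewnerBox r) ∧ (∀ j, F.2 j ∈ loewnerBox r) ∧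
        ∀ i ∈ d.1, ∀ j ∈ d.2, M i j = (r : ℝ) ^ 2 * Δ * (F.1 i * F.2 j).trace := by
    rintro ⟨s, t⟩
    obtain ⟨X, Y, hX, hY, hXY⟩ := HasPsdFactorization.rescale_weak
      (M := fun (i : s) (j : t) => M i j) hΔ (fun i j => hM i j) (h s t)
    refine ⟨(fun i => if hi : i ∈ s then X ⟨i, hi⟩ else 0,
      fun j => if hj : j ∈ t then Y ⟨j, hj⟩ else 0), fun i => ?_, fun j => ?_, fun i hi j hj => ?_⟩
    · dsimp only
      split_ifs with hi
      · exact hX _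
      · exact zero_mem_loewnerBox r
    · dsimp only
      split_ifs with hj
      · exact hY _
      · exact zero_mem_loewnerBox r
    · dsimp only
      rw [dif_pos hi, dif_pos hj]
      exact hXY ⟨i, hi⟩ ⟨j, hj⟩
  choose F hF₁ hF₂ hF₃ using hfin
  -- the compact product of Loewner boxes, and a cluster point of the net `F` along `atTop`
  have hSc : IsCompact ((Set.pi Set.univ fun _ : ι => loewnerBox r) ×ˢ
      (Set.pi Set.univ fun _ : κ => loewnerBox r)) :=
    (isCompact_univ_pi fun _ => isCompact_loewnerBox r).prod
      (isCompact_univ_pi fun _ => isCompact_loewnerBox r)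
  have hFS : ∀ d, F d ∈ (Set.pi Set.univ fun _ : ι => loewnerBox r) ×ˢ
      (Set.pi Set.univ fun _ : κ => loewnerBox r) :=
    fun d => ⟨fun i _ => hF₁ d i, fun j _ => hF₂ d j⟩
  have hφ : ∀ ij : ι × κ, Continuous fun q : (ι → Matrix (Fin r) (Fin r) ℝ) ×
      (κ → Matrix (Fin r) (Fin r) ℝ) => (r : ℝ) ^ 2 * Δ * (q.1 ij.1 * q.2 ij.2).trace :=
    fun ij => continuous_const.mul (((continuous_apply ij.1).comp continuous_fst).matrix_mul
      ((continuous_apply ij.2).comp continuous_snd)).matrix_trace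
  obtain ⟨p, hpS, hp⟩ := exists_mem_forall_apply_eq_of_tendsto hSc (l := atTop) hFS hφ
    (c := fun ij => M ij.1 ij.2) (fun ij => by
      refine EventuallyEq.tendsto ?_
      filter_upwards [eventually_ge_atTop (({ij.1}, {ij.2}) : Finset ι × Finset κ)] with d hd
      exact (hF₃ d ij.1 (Finset.singleton_subset_iff.1 hd.1) ij.2
        (Finset.singleton_subset_iff.1 hd.2)).symm)
  exact ⟨p.1, p.2, fun i => hpS.1 i (Set.mem_univ i), fun j => hpS.2 j (Set.mem_univ j),
    fun i j => (hp (i, j)).symm⟩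

/-- **The psd rank of a bounded matrix is determined by its finite submatrices**: if every finite
submatrix of `M` (entries bounded above) has a psd factorization of size `r`, so does `M`.
(The converse is `HasPsdFactorization.submatrix`.) Compactness consequence of
[cite: BrietDadushPokutta2014, Thm. 6 (§3, p. 7)]; see `HasPsdFactorization.rescale_weak_of_finite`. -/
theorem HasPsdFactorization.of_finite {ι κ : Type*} {M : ι → κ → ℝ} {r : ℕ} {Δ : ℝ}
    (hM : ∀ i j, M i j ≤ Δ)
    (h : ∀ (s : Finset ι) (t : Finset κ), HasPsdFactorization (fun (i : s) (j : t) => M i j) r) :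
    HasPsdFactorization M r := by
  have hΔ : 0 < max Δ 1 := lt_max_of_lt_right one_pos
  obtain ⟨X, Y, hX, hY, hXY⟩ := HasPsdFactorization.rescale_weak_of_finite hΔ
    (fun i j => (hM i j).trans (le_max_left _ _)) h
  refine ⟨fun i => ((r : ℝ) ^ 2 * max Δ 1) • X i, Y, fun i => (hX i).1.smul (by positivity),
    fun j => (hY j).1, fun i j => ?_⟩
  rw [Matrix.smul_mul, trace_smul, smul_eq_mul]
  exact hXY i j

/-- `rank_psd M ≤ r` iff every finite submatrix has `rank_psd ≤ r` (entries of `M` bounded above).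
Compactness consequence of [cite: BrietDadushPokutta2014, Thm. 6 (§3, p. 7)]. -/
theorem hasPsdFactorization_iff_finite {ι κ : Type*} {M : ι → κ → ℝ} {r : ℕ} {Δ : ℝ}
    (hM : ∀ i j, M i j ≤ Δ) :
    HasPsdFactorization M r ↔
      ∀ (s : Finset ι) (t : Finset κ), HasPsdFactorization (fun (i : s) (j : t) => M i j) r :=
  ⟨fun h s t => h.submatrix (fun i : s => (i : ι)) (fun j : t => (j : κ)),
    fun h => HasPsdFactorization.of_finite hM h⟩

/-! ### Finite sphere slack matrices of psd rank `> k` (FGPRT §9.1) -/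

/-- `1 − ⟨u, v⟩ ≤ 2` for unit vectors. [folklore] -/
private theorem one_sub_dotProduct_le_two {n : ℕ} {u v : Fin n → ℝ} (hu : ∑ l, u l ^ 2 = 1)
    (hv : ∑ l, v l ^ 2 = 1) : 1 - u ⬝ᵥ v ≤ 2 := by
  have h : 0 ≤ ∑ l, (u l + v l) ^ 2 := Finset.sum_nonneg fun l _ => sq_nonneg _
  have hexp : ∑ l, (u l + v l) ^ 2 = ∑ l, u l ^ 2 + ∑ l, v l ^ 2 + 2 * (u ⬝ᵥ v) := by
    rw [dotProduct, Finset.mul_sum, ← Finset.sum_add_distrib, ← Finset.sum_add_distrib]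
    exact Finset.sum_congr rfl fun l _ => by ring
  rw [hexp, hu, hv] at h
  linarith

/-- **Some finite sphere slack matrix has no size-`k` psd factorization** (`k < n`,
`C(k+1,2) < n+3`; e.g. `S³` and `k = 3`): there are finitely many unit vectors `u ∈ S^{n−1}`
whose slack matrix `(1 − ⟨u, v⟩)_{u,v}` — the slack of the inscribed polytope `conv(u)` against
its tangent half-spaces `⟨u, ·⟩ ≤ 1`, of psd rank `≤ s + t` whenever `n ≤ st`
(`hasPsdFactorization_sphereSlack`; `≤ 4` for `S³`) — has psd rank `> k`. Otherwise, by the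
compactness theorem `HasPsdFactorization.of_finite` for the bounded kernel `1 − ⟨u, v⟩ ≤ 2` on
`S^{n−1} × S^{n−1}`, the whole kernel would factor through `S^k_+`, contradicting
`not_exists_psd_factorization_sphere_slack`. FGPRT ask (Problems 9.1, 9.2) for the psd rank of
particular such configurations; this is the finite-submatrix form of "no smaller semidefinite
representation of the `3`-sphere". [cite: FawziEtAl2015, §9.1 Problem 9.1 (p24)] -/
theorem exists_finset_sphere_not_hasPsdFactorization {k n : ℕ} (hkn : k < n)
    (hcount : (k + 1).choose 2 < n + 3) :
    ∃ s : Finset (Fin n → ℝ), (∀ u ∈ s, ∑ l, u l ^ 2 = 1) ∧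
      ¬ HasPsdFactorization (fun u v : s => 1 - (u : Fin n → ℝ) ⬝ᵥ (v : Fin n → ℝ)) k := by
  classical
  by_contra hall
  push Not at hall
  apply not_exists_psd_factorization_sphere_slack hkn hcount
  -- the kernel on the subtype of unit vectors factors, by compactness
  set T := {u : Fin n → ℝ // ∑ l, u l ^ 2 = 1} with hT
  have hfac : HasPsdFactorization (fun u v : T => 1 - (u : Fin n → ℝ) ⬝ᵥ (v : Fin n → ℝ)) k := by
    refine HasPsdFactorization.of_finite (Δ := 2) (fun u v => one_sub_dotProduct_le_two u.2 v.2)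
      fun s t => ?_
    -- both index sets inside one finite set of unit vectors
    set S : Finset (Fin n → ℝ) := s.map (Function.Embedding.subtype _) ∪
      t.map (Function.Embedding.subtype _) with hS
    have hSunit : ∀ u ∈ S, ∑ l, u l ^ 2 = 1 := by
      intro u hu
      rcases Finset.mem_union.1 hu with hu | hu <;>
      · obtain ⟨w, _, rfl⟩ := Finset.mem_map.1 hu
        exact w.2
    have hs : ∀ u : s, ((u : T) : Fin n → ℝ) ∈ S := fun u =>
      Finset.mem_union_left _ (Finset.mem_map.2 ⟨u, u.2, rfl⟩)
    have ht : ∀ v : t, ((v : T) : Fin n → ℝ) ∈ S := fun v =>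
      Finset.mem_union_right _ (Finset.mem_map.2 ⟨v, v.2, rfl⟩)
    exact (hall S hSunit).submatrix (fun u : s => (⟨_, hs u⟩ : S)) (fun v : t => (⟨_, ht v⟩ : S))
  obtain ⟨A, B, hA, hB, hAB⟩ := hfac
  refine ⟨fun u => if hu : ∑ l, u l ^ 2 = 1 then A ⟨u, hu⟩ else 0,
    fun v => if hv : ∑ l, v l ^ 2 = 1 then B ⟨v, hv⟩ else 0, fun u hu => ?_, fun v hv => ?_,
    fun u v hu hv => ?_⟩
  · dsimp only
    rw [dif_pos hu]
    exact hA _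
  · dsimp only
    rw [dif_pos hv]
    exact hB _
  · dsimp only
    rw [dif_pos hu, dif_pos hv]
    exact (hAB ⟨u, hu⟩ ⟨v, hv⟩).symm

/-- **A finite configuration on `S³` whose tangential slack matrix has psd rank exactly `4`.**
Some finite set of unit vectors of `ℝ⁴` has slack matrix `(1 − ⟨u, v⟩)_{u,v}` of psd rank `4`:
no size-`3` factorization by `exists_finset_sphere_not_hasPsdFactorization` (and monotonicity of
factorization size), while EVERY configuration on `S³` has one of size `2 + 2`
(`exists_psd_factorization_sphere_slack`). FGPRT's Problem 9.1 asks whether the `10` vertices of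
the rectified `5`-cell (the matrix `|I ∩ J|`) already form such a configuration — open.
[cite: FawziEtAl2015, §9.1 Problem 9.1 (p24)] -/
theorem exists_finset_sphere_isLeast_psdRank_four :
    ∃ s : Finset (Fin 4 → ℝ), (∀ u ∈ s, ∑ l, u l ^ 2 = 1) ∧
      IsLeast {k : ℕ | HasPsdFactorization
        (fun u v : s => 1 - (u : Fin 4 → ℝ) ⬝ᵥ (v : Fin 4 → ℝ)) k} 4 := by
  obtain ⟨s, hs, hnot⟩ := exists_finset_sphere_not_hasPsdFactorization (k := 3) (n := 4)
    (by norm_num) (by decide)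
  obtain ⟨A, B, hA, hB, hAB⟩ := exists_psd_factorization_sphere_slack (n := 4) (s := 2) (t := 2)
    (by norm_num)
  refine ⟨s, hs, ⟨fun u : s => A u, fun v : s => B v, fun u => hA _ (hs _ u.2),
    fun v => hB _ (hs _ v.2), fun u v => (hAB _ _ (hs _ u.2) (hs _ v.2)).symm⟩, fun k hk => ?_⟩
  by_contra hlt
  push Not at hlt
  exact hnot (HasPsdFactorization.mono hk (by omega))

/-- **Dense sequences: all large leading blocks have psd rank `> k`.** If unit vectors
`x_0, x_1, … ∈ S^{n−1}` have range dense in the sphere (`k < n`, `C(k+1,2) < n+3`), then from some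
`N₀` on, the `N × N` slack matrices `(1 − ⟨x_i, x_j⟩)_{i,j<N}` have no psd factorization of size
`k` (for `S³`: the leading blocks of every dense sequence eventually have psd rank exactly `4`,
`exists_isLeast_psdRank_block_four_of_dense`). Proof: otherwise all finite submatrices of the
`ℕ × ℕ` kernel factor (each inside a large factorising block), so by compactness
(`HasPsdFactorization.rescale_weak_of_finite`) the whole sequence carries a normalised factorization
`1 − ⟨x_i, x_j⟩ = 2k²·Tr(X_i Y_j)`, `0 ⪯ X_i, Y_j ⪯ I`, which extends to the closure `⊇ S^{n−1}` of
the range by cluster points (`SmallPsdLifts.exists_factorization_on_closure`), contradicting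
`not_exists_psd_factorization_sphere_slack`. [cite: FawziEtAl2015, §9.1 Problem 9.1 (p24)] -/
theorem exists_not_hasPsdFactorization_sphereSlack_of_dense {k n : ℕ} (hkn : k < n)
    (hcount : (k + 1).choose 2 < n + 3) {x : ℕ → (Fin n → ℝ)} (hx : ∀ i, ∑ l, x i l ^ 2 = 1)
    (hdense : {u : Fin n → ℝ | ∑ l, u l ^ 2 = 1} ⊆ closure (Set.range x)) :
    ∃ N₀ : ℕ, ∀ N, N₀ ≤ N → ¬ HasPsdFactorization (fun i j : Fin N => 1 - x i ⬝ᵥ x j) k := by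
  classical
  by_contra hall
  push Not at hall
  apply not_exists_psd_factorization_sphere_slack hkn hcount
  -- all finite submatrices of the `ℕ × ℕ` kernel factor
  have hfin : ∀ s t : Finset ℕ,
      HasPsdFactorization (fun (i : s) (j : t) => 1 - x i ⬝ᵥ x j) k := by
    intro s t
    obtain ⟨N, hN, hfac⟩ := hall ((s ∪ t).sup id + 1)
    have hlt : ∀ i ∈ s ∪ t, i < N := fun i hi =>
      lt_of_lt_of_le (Nat.lt_succ_of_le (Finset.le_sup (f := id) hi)) hN
    exact hfac.submatrix (fun i : s => (⟨i, hlt i (Finset.mem_union_left t i.2)⟩ : Fin N))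
      (fun j : t => (⟨j, hlt j (Finset.mem_union_right s j.2)⟩ : Fin N))
  -- normalised factorization of the whole sequence
  obtain ⟨X, Y, hX, hY, hXY⟩ := HasPsdFactorization.rescale_weak_of_finite (Δ := 2) two_pos
    (fun i j => one_sub_dotProduct_le_two (hx i) (hx j)) hfin
  -- extension to the closure of the range, which contains the sphere
  have hK : Continuous fun pq : (Fin n → ℝ) × (Fin n → ℝ) => 1 - pq.1 ⬝ᵥ pq.2 :=
    continuous_const.sub (continuous_fst.dotProduct continuous_snd)
  obtain ⟨A, B, hA, hB, hAB⟩ := exists_factorization_on_closure (x := x) (y := x)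
    (K := fun p q : Fin n → ℝ => 1 - p ⬝ᵥ q)
    (fun q => hK.comp (continuous_id.prodMk continuous_const))
    (fun p => hK.comp (continuous_const.prodMk continuous_id)) hX hY hXY
  refine ⟨fun u => ((k : ℝ) ^ 2 * 2) • A u, B, fun u hu => ((hA u (hdense hu)).1).smul (by positivity),
    fun v hv => (hB v (hdense hv)).1, fun u v hu hv => ?_⟩
  rw [Matrix.smul_mul, trace_smul, smul_eq_mul]
  exact (hAB u (hdense hu) v (hdense hv)).symm

/-- **`S³`: the leading blocks of a dense sequence eventually have psd rank exactly `4`.** For unit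
vectors `x_i ∈ ℝ⁴` with range dense in `S³`, from some `N₀` on the `N × N` slack matrix
`(1 − ⟨x_i, x_j⟩)_{i,j<N}` has least psd-factorization size `4` (`≤ 4` for every `N` by the
size-`(2+2)` factorization of the kernel, `exists_psd_factorization_sphere_slack`).
[cite: FawziEtAl2015, §9.1 Problem 9.1 (p24)] -/
theorem exists_isLeast_psdRank_block_four_of_dense {x : ℕ → (Fin 4 → ℝ)}
    (hx : ∀ i, ∑ l, x i l ^ 2 = 1)
    (hdense : {u : Fin 4 → ℝ | ∑ l, u l ^ 2 = 1} ⊆ closure (Set.range x)) :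
    ∃ N₀ : ℕ, ∀ N, N₀ ≤ N →
      IsLeast {k : ℕ | HasPsdFactorization (fun i j : Fin N => 1 - x i ⬝ᵥ x j) k} 4 := by
  obtain ⟨N₀, hN₀⟩ := exists_not_hasPsdFactorization_sphereSlack_of_dense (k := 3) (n := 4)
    (by norm_num) (by decide) hx hdense
  obtain ⟨A, B, hA, hB, hAB⟩ := exists_psd_factorization_sphere_slack (n := 4) (s := 2) (t := 2)
    (by norm_num)
  refine ⟨N₀, fun N hN => ⟨⟨fun i => A (x i), fun j => B (x j), fun i => hA _ (hx i),
    fun j => hB _ (hx j), fun i j => (hAB _ _ (hx i) (hx j)).symm⟩, fun k hk => ?_⟩⟩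
  by_contra hlt
  push Not at hlt
  exact hN₀ N hN (HasPsdFactorization.mono hk (by omega))

end PsdRankCompactness

/-! ### A polytope pair around the sphere with no sandwiched `S^k_+`-lift (FGPRT Thm 3.3 reading) -/

section SpherePair

/-- The signed coordinate vectors `± e_l` are unit vectors. [folklore] -/
private theorem sum_sq_signedSingle {n : ℕ} (l : Fin n) (c : Bool) :
    ∑ l', ((if c then (1 : ℝ) else -1) • (Pi.single l (1 : ℝ) : Fin n → ℝ)) l' ^ 2 = 1 := by
  rw [Finset.sum_eq_single l (fun m _ hm => by simp [hm]) (by simp)]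
  cases c <;> simp

/-- The unit ball `{Σ x_l² ≤ 1}` of `ℝⁿ` is convex (`a x² + b y² − (a x + b y)² = ab (x − y)²`).
[folklore] -/
private theorem convex_setOf_sum_sq_le_one (n : ℕ) :
    Convex ℝ {x : Fin n → ℝ | ∑ l, x l ^ 2 ≤ 1} := by
  intro x hx y hy a b ha hb hab
  simp only [Set.mem_setOf_eq, Pi.add_apply, Pi.smul_apply, smul_eq_mul] at hx hy ⊢
  have h : ∀ l, (a * x l + b * y l) ^ 2 ≤ a * x l ^ 2 + b * y l ^ 2 := fun l => by
    have key : a * x l ^ 2 + b * y l ^ 2 - (a * x l + b * y l) ^ 2 = a * b * (x l - y l) ^ 2 := by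
      have hb' : b = 1 - a := by linarith
      rw [hb']
      ring
    nlinarith [mul_nonneg (mul_nonneg ha hb) (sq_nonneg (x l - y l))]
  calc ∑ l, (a * x l + b * y l) ^ 2 ≤ ∑ l, (a * x l ^ 2 + b * y l ^ 2) :=
        Finset.sum_le_sum fun l _ => h l
    _ = a * ∑ l, x l ^ 2 + b * ∑ l, y l ^ 2 := by
        rw [Finset.sum_add_distrib, Finset.mul_sum, Finset.mul_sum]
    _ ≤ a * 1 + b * 1 := by gcongr
    _ = 1 := by rw [mul_one, mul_one, hab]

/-- `⟨x, y⟩ ≤ 1` for `x` on the unit sphere and `y` in the unit ball (Cauchy–Schwarz). [folklore] -/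
private theorem dotProduct_le_one_of_sum_sq {n : ℕ} {x y : Fin n → ℝ} (hx : ∑ l, x l ^ 2 = 1)
    (hy : ∑ l, y l ^ 2 ≤ 1) : x ⬝ᵥ y ≤ 1 := by
  have hcs := Finset.sum_mul_sq_le_sq_mul_sq Finset.univ x y
  rw [hx, one_mul] at hcs
  have h1 : (x ⬝ᵥ y) ^ 2 ≤ 1 := hcs.trans hy
  nlinarith [h1, sq_nonneg (x ⬝ᵥ y - 1)]

/-- Finite configurations of unit vectors enlarged by the signed coordinate vectors `± e_l` and
enumerated: all points unit, the tangent polyhedron `{⟨x_j, ·⟩ ≤ 1}` bounded (`|y_l| ≤ 1`).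
[folklore] -/
private theorem exists_enum_supset {n : ℕ} (s : Finset (Fin n → ℝ))
    (hs : ∀ u ∈ s, ∑ l, u l ^ 2 = 1) :
    ∃ (v : ℕ) (x : Fin v → (Fin n → ℝ)), (∀ i, ∑ l, x i l ^ 2 = 1) ∧ (∀ u ∈ s, ∃ i, x i = u) ∧
      (∀ (l : Fin n) (c : Bool), ∃ i, x i = (if c then (1 : ℝ) else -1) • Pi.single l 1) ∧
      Bornology.IsBounded {y : Fin n → ℝ | ∀ j, x j ⬝ᵥ y ≤ 1} := by
  classical
  set E : Finset (Fin n → ℝ) := Finset.univ.image fun p : Fin n × Bool =>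
    (if p.2 then (1 : ℝ) else -1) • (Pi.single p.1 (1 : ℝ) : Fin n → ℝ) with hE
  set s' : Finset (Fin n → ℝ) := s ∪ E with hs'
  have hs'unit : ∀ u ∈ s', ∑ l, u l ^ 2 = 1 := by
    intro u hu
    rcases Finset.mem_union.1 hu with hu | hu
    · exact hs u hu
    · obtain ⟨p, _, rfl⟩ := Finset.mem_image.1 hu
      exact sum_sq_signedSingle p.1 p.2
  have hEmem : ∀ (l : Fin n) (c : Bool),
      (if c then (1 : ℝ) else -1) • (Pi.single l (1 : ℝ) : Fin n → ℝ) ∈ s' := fun l c =>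
    Finset.mem_union_right _ (Finset.mem_image.2 ⟨(l, c), Finset.mem_univ _, rfl⟩)
  set x : Fin s'.card → (Fin n → ℝ) := fun i => (s'.equivFin.symm i : Fin n → ℝ) with hx
  have hxmem : ∀ i, x i ∈ s' := fun i => (s'.equivFin.symm i).2
  have hxsurj : ∀ u ∈ s', ∃ i, x i = u := fun u hu =>
    ⟨s'.equivFin ⟨u, hu⟩, by simp [hx]⟩
  refine ⟨s'.card, x, fun i => hs'unit _ (hxmem i), fun u hu => hxsurj u (Finset.mem_union_left _ hu),
    fun l c => hxsurj _ (hEmem l c), ?_⟩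
  refine (Metric.isBounded_closedBall (x := (0 : Fin n → ℝ)) (r := 1)).subset fun y hy => ?_
  rw [mem_closedBall_zero_iff, pi_norm_le_iff_of_nonneg zero_le_one]
  intro l
  rw [Real.norm_eq_abs, abs_le]
  obtain ⟨i₁, hi₁⟩ := hxsurj _ (hEmem l true)
  obtain ⟨i₂, hi₂⟩ := hxsurj _ (hEmem l false)
  have h₁ := hy i₁
  have h₂ := hy i₂
  rw [hi₁] at h₁
  rw [hi₂] at h₂
  simp only [ite_true, one_smul, single_dotProduct, one_mul] at h₁
  simp only [Bool.false_eq_true, ite_false, smul_dotProduct, single_dotProduct, one_mul,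
    smul_eq_mul, neg_mul, one_mul] at h₂
  constructor <;> linarith

/-- **A finite configuration on the sphere with no sandwiched psd lift of size `k`** (`k < n`,
`C(k+1,2) < n+3`; e.g. `S³` and `k = 3`): there are finitely many unit vectors
`x_1, …, x_v ∈ S^{n−1}` — the `± e_l` among them, so that the tangent polyhedron
`Q = {y : ⟨x_j, y⟩ ≤ 1 ∀ j}` is bounded — whose pair slack matrix `(1 − ⟨x_i, x_j⟩)_{ij}` (the slack
of the inscribed polytope `P = conv{x_i}` against the circumscribed `Q`) has NO psd factorization
of size `k`, equivalently (FGPRT Thm. 3.3, the tree's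
`HasPsdLift.hasPsdFactorization_pairSlackMatrix`) such that NO convex set `C` with `P ⊆ C ⊆ Q` has a
psd lift of size `k`. The ball `Bⁿ` is one such `C`; so this sharpens
`not_hasPsdLift_euclideanBall_of_choose_lt` from the ball to ONE polytope pair. For `S³`, FGPRT
remark (p24) that `rank_psd = 4` for the rectified-`5`-cell pair WOULD give the `B⁴` statement;
conversely SOME inscribed/circumscribed pair with `rank_psd = 4` is hereby shown to exist
(`exists_finset_sphere_not_hasPsdFactorization` + compactness).
[cite: FawziEtAl2015, Thm. 3.3 (p09) and §9.1 Problem 9.1 (p24)] -/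
theorem exists_sphere_pair_not_hasPsdLift_between {k n : ℕ} (hkn : k < n)
    (hcount : (k + 1).choose 2 < n + 3) :
    ∃ (v : ℕ) (x : Fin v → (Fin n → ℝ)), (∀ i, ∑ l, x i l ^ 2 = 1) ∧
      Bornology.IsBounded {y : Fin n → ℝ | ∀ j, x j ⬝ᵥ y ≤ 1} ∧
      ¬ HasPsdFactorization (fun i j => 1 - x i ⬝ᵥ x j) k ∧
      ∀ C : Set (Fin n → ℝ), convexHull ℝ (Set.range x) ⊆ C → C ⊆ {y | ∀ j, x j ⬝ᵥ y ≤ 1} →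
        ¬ HasPsdLift C k := by
  classical
  obtain ⟨s, hs, hnot⟩ := exists_finset_sphere_not_hasPsdFactorization hkn hcount
  obtain ⟨v, x, hxunit, hxs, hxe, hQ⟩ := exists_enum_supset s hs
  choose ι hι using hxs
  -- no psd factorization of size `k` (the `s × s` submatrix has none)
  have hnot' : ¬ HasPsdFactorization (fun i j => 1 - x i ⬝ᵥ x j) k := by
    intro hfac
    apply hnot
    have h := hfac.submatrix (fun u : s => ι u u.2) (fun w : s => ι w w.2)
    have hfun : (fun u w : s => 1 - x (ι u u.2) ⬝ᵥ x (ι w w.2)) =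
        fun u w : s => 1 - (u : Fin n → ℝ) ⬝ᵥ (w : Fin n → ℝ) := by
      funext u w
      simp only [hι]
    rw [hfun] at h
    exact h
  refine ⟨v, x, hxunit, hQ, hnot', fun C hPC hCQ hlift => ?_⟩
  have hxC : ∀ i, x i ∈ C := fun i => hPC (subset_convexHull ℝ _ (Set.mem_range_self i))
  rcases Nat.eq_zero_or_pos k with rfl | hk
  · -- a psd lift of size `0` is contained in `{0}`, but the `x_i` are unit vectors
    obtain ⟨L, π, hC⟩ := hlift
    obtain ⟨i, hi⟩ := hxe ⟨0, hkn⟩ true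
    have hmem := hxC i
    rw [hC] at hmem
    obtain ⟨M, _, hM⟩ := hmem
    have hM0 : M = 0 := Subsingleton.elim _ _
    rw [hM0, map_zero] at hM
    have h1 := hxunit i
    rw [← hM] at h1
    simp at h1
  · apply hnot'
    exact (HasPsdLift.hasPsdFactorization_pairSlackMatrix (x := x) (a := x) (b := fun _ => 1)
      hk hlift hxC hCQ hQ).transpose

/-- **`S³`: an inscribed/circumscribed polytope pair whose sandwiched sets need psd lifts of size
`4`, i.e. whose slack matrix has psd rank exactly `4`.** For some unit vectors
`x_1, …, x_v ∈ S³` (tangent polyhedron `Q` bounded), the least `k` such that SOME convex `C` with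
`conv{x_i} ⊆ C ⊆ Q = {⟨x_j, ·⟩ ≤ 1}` has an `S^k_+`-lift is `4` (attained by `C = B⁴`,
`hasPsdLift_euclideanBall_fin_four`), and the least psd-factorization size of the pair slack matrix
`(1 − ⟨x_i, x_j⟩)` is `4` (FGPRT Thm. 3.3; size `2 + 2` by `exists_psd_factorization_sphere_slack`).
FGPRT's Problem 9.1 asks whether the `10` vertices of the rectified `5`-cell are such a
configuration. [cite: FawziEtAl2015, Thm. 3.3 (p09) and §9.1 Problem 9.1 (p24)] -/
theorem exists_sphere_pair_isLeast_four :
    ∃ (v : ℕ) (x : Fin v → (Fin 4 → ℝ)), (∀ i, ∑ l, x i l ^ 2 = 1) ∧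
      Bornology.IsBounded {y : Fin 4 → ℝ | ∀ j, x j ⬝ᵥ y ≤ 1} ∧
      IsLeast {k : ℕ | ∃ C : Set (Fin 4 → ℝ), convexHull ℝ (Set.range x) ⊆ C ∧
        C ⊆ {y | ∀ j, x j ⬝ᵥ y ≤ 1} ∧ HasPsdLift C k} 4 ∧
      IsLeast {k : ℕ | HasPsdFactorization (fun i j => 1 - x i ⬝ᵥ x j) k} 4 := by
  obtain ⟨v, x, hx, hQ, hnot, hC⟩ := exists_sphere_pair_not_hasPsdLift_between (k := 3) (n := 4)
    (by norm_num) (by decide)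
  refine ⟨v, x, hx, hQ, ⟨⟨{y | ∑ l, y l ^ 2 ≤ 1}, ?_, ?_, isLeast_psdLiftSize_euclideanBall_fin_four.1⟩,
    fun k hk => ?_⟩, ⟨?_, fun k hk => ?_⟩⟩
  · exact convexHull_min (by rintro _ ⟨i, rfl⟩; exact (hx i).le) (convex_setOf_sum_sq_le_one 4)
  · exact fun y hy j => dotProduct_le_one_of_sum_sq (hx j) hy
  · obtain ⟨C, hPC, hCQ, hlift⟩ := hk
    by_contra hlt
    push Not at hlt
    exact hC C hPC hCQ (hlift.mono (by omega))
  · obtain ⟨A, B, hA, hB, hAB⟩ := exists_psd_factorization_sphere_slack (n := 4) (s := 2) (t := 2)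
      (by norm_num)
    exact ⟨fun i => A (x i), fun j => B (x j), fun i => hA _ (hx i), fun j => hB _ (hx j),
      fun i j => (hAB _ _ (hx i) (hx j)).symm⟩
  · by_contra hlt
    push Not at hlt
    exact hnot (HasPsdFactorization.mono hk (by omega))

end SpherePair

/-! ### Gouveia–Parrilo–Thomas Theorem 2.4 for the Euclidean ball: lifts ↔ factorizations of the
slack operator -/

section BallSlackOperator

/-- A nonempty subset of a one-point space has psd lifts of all sizes (`L = ⊤`, `π = 0`).
[folklore] -/
private theorem hasPsdLift_of_subsingleton {F : Type*} [AddCommGroup F] [Module ℝ F]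
    [Subsingleton F] {C : Set F} (hC : C.Nonempty) (k : ℕ) : HasPsdLift C k := by
  obtain ⟨y₀, hy₀⟩ := hC
  refine ⟨⊤, 0, Set.ext fun y => ⟨fun _ => ⟨0, ⟨PosSemidef.zero, AffineSubspace.mem_top ℝ _ 0⟩,
    Subsingleton.elim _ _⟩, fun _ => ?_⟩⟩
  rwa [Subsingleton.elim y y₀]

/-- **Gouveia–Parrilo–Thomas Theorem 2.4 with Corollary 2.6 (`S^k_+` is nice), direction
"lift ⇒ factorization", for the Euclidean ball.** If `Bⁿ = π(S^k_+ ∩ L)` — ANY psd lift, proper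
or not — then the slack operator `S(x, y) = 1 − ⟨x, y⟩` on `S^{n−1} × S^{n−1} = ext(Bⁿ) × ext((Bⁿ)°)`
is `S^k_+`-factorizable: there are `A, B : S^{n−1} → S^k_+` with `Tr(A(x)B(y)) = 1 − ⟨x, y⟩`.
Proof here (instead of conic duality for the infinite slack operator): every FINITE configuration
of unit vectors, enlarged by `± e_l`, is an inscribed polytope with bounded tangent polyhedron
sandwiching `Bⁿ`, so its pair slack matrix factorizes through `S^k_+` by the tree's FGPRT Thm 3.3
(`HasPsdLift.hasPsdFactorization_pairSlackMatrix`, facial reduction included); hence all finite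
submatrices of the bounded kernel `1 − ⟨x, y⟩ ≤ 2` on the sphere factorize, and compactness
(`HasPsdFactorization.of_finite`) gives the factorization of the whole operator.
[cite: GouveiaParriloThomas2013, Thm. 2.4 and Cor. 2.6 (§2, p05–p06)] [cite: FawziEtAl2015, Thm. 3.3 (p09)] -/
theorem exists_psd_factorization_of_hasPsdLift_euclideanBall {k n : ℕ}
    (h : HasPsdLift {x : Fin n → ℝ | ∑ l, x l ^ 2 ≤ 1} k) :
    ∃ (A B : (Fin n → ℝ) → Matrix (Fin k) (Fin k) ℝ),
      (∀ x, ∑ l, x l ^ 2 = 1 → (A x).PosSemidef) ∧ (∀ y, ∑ l, y l ^ 2 = 1 → (B y).PosSemidef) ∧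
      ∀ x y, ∑ l, x l ^ 2 = 1 → ∑ l, y l ^ 2 = 1 → (A x * B y).trace = 1 - x ⬝ᵥ y := by
  classical
  rcases Nat.eq_zero_or_pos n with rfl | hn
  · refine ⟨fun _ => 0, fun _ => 0, fun x hx => absurd hx (by simp), fun y hy => absurd hy (by simp),
      fun x y hx => absurd hx (by simp)⟩
  rcases Nat.eq_zero_or_pos k with rfl | hk
  · -- a lift of size `0` is contained in `{0}`, but `e_0 ∈ Bⁿ`
    exfalso
    obtain ⟨L, π, hC⟩ := h
    have hmem : (Pi.single (⟨0, hn⟩ : Fin n) (1 : ℝ) : Fin n → ℝ) ∈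
        {x : Fin n → ℝ | ∑ l, x l ^ 2 ≤ 1} := by
      have h1 := sum_sq_signedSingle (⟨0, hn⟩ : Fin n) true
      simp only [ite_true, one_smul] at h1
      exact h1.le
    rw [hC] at hmem
    obtain ⟨M, _, hM⟩ := hmem
    have hM0 : M = 0 := Subsingleton.elim _ _
    rw [hM0, map_zero] at hM
    have h1 := congr_fun hM ⟨0, hn⟩
    simp at h1
  -- `k, n ≥ 1`: Thm 3.3 on enlarged finite configurations, then compactness
  set T := {u : Fin n → ℝ // ∑ l, u l ^ 2 = 1} with hT
  have hfac : HasPsdFactorization (fun u v : T => 1 - (u : Fin n → ℝ) ⬝ᵥ (v : Fin n → ℝ)) k := by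
    refine HasPsdFactorization.of_finite (Δ := 2) (fun u v => one_sub_dotProduct_le_two u.2 v.2)
      fun s t => ?_
    set S : Finset (Fin n → ℝ) := s.map (Function.Embedding.subtype _) ∪
      t.map (Function.Embedding.subtype _) with hS
    have hSunit : ∀ u ∈ S, ∑ l, u l ^ 2 = 1 := by
      intro u hu
      rcases Finset.mem_union.1 hu with hu | hu <;>
      · obtain ⟨w, _, rfl⟩ := Finset.mem_map.1 hu
        exact w.2
    have hsS : ∀ u : s, ((u : T) : Fin n → ℝ) ∈ S := fun u =>
      Finset.mem_union_left _ (Finset.mem_map.2 ⟨u, u.2, rfl⟩)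
    have htS : ∀ w : t, ((w : T) : Fin n → ℝ) ∈ S := fun w =>
      Finset.mem_union_right _ (Finset.mem_map.2 ⟨w, w.2, rfl⟩)
    obtain ⟨v, x, hxunit, hxs, -, hQ⟩ := exists_enum_supset S hSunit
    choose ι hι using hxs
    have hxC : ∀ i, x i ∈ {y : Fin n → ℝ | ∑ l, y l ^ 2 ≤ 1} := fun i => (hxunit i).le
    have hCQ : {y : Fin n → ℝ | ∑ l, y l ^ 2 ≤ 1} ⊆ {y | ∀ j, x j ⬝ᵥ y ≤ 1} :=
      fun y hy j => dotProduct_le_one_of_sum_sq (hxunit j) hy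
    have hpair := (HasPsdLift.hasPsdFactorization_pairSlackMatrix (x := x) (a := x)
      (b := fun _ => (1 : ℝ)) hk h hxC hCQ hQ).transpose
    have h' := hpair.submatrix (fun u : s => ι _ (hsS u)) (fun w : t => ι _ (htS w))
    have hfun : (fun (u : s) (w : t) => (fun j i => pairSlackMatrix x x (fun _ => (1 : ℝ)) i j)
        (ι _ (hsS u)) (ι _ (htS w))) =
        fun (u : s) (w : t) => 1 - ((u : T) : Fin n → ℝ) ⬝ᵥ ((w : T) : Fin n → ℝ) := by
      funext u w
      simp only [pairSlackMatrix, hι]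
    rw [hfun] at h'
    exact h'
  obtain ⟨A, B, hA, hB, hAB⟩ := hfac
  refine ⟨fun u => if hu : ∑ l, u l ^ 2 = 1 then A ⟨u, hu⟩ else 0,
    fun v => if hv : ∑ l, v l ^ 2 = 1 then B ⟨v, hv⟩ else 0, fun u hu => ?_, fun v hv => ?_,
    fun u v hu hv => ?_⟩
  · dsimp only
    rw [dif_pos hu]
    exact hA _
  · dsimp only
    rw [dif_pos hv]
    exact hB _
  · dsimp only
    rw [dif_pos hu, dif_pos hv]
    exact (hAB ⟨u, hu⟩ ⟨v, hv⟩).symm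

/-- **Gouveia–Parrilo–Thomas Theorem 2.4 / Corollary 2.6 for the Euclidean ball, as an
equivalence** (all `n`, `k`): `Bⁿ` has a psd lift of size `k` iff the slack operator
`1 − ⟨x, y⟩` on `S^{n−1} × S^{n−1}` has an `S^k_+`-factorization — "If `C` has a proper `K`-lift
then `S_C` is `K`-factorizable. Conversely, if `S_C` is `K`-factorizable then `C` has a `K`-lift"
(Thm. 2.4), "If `K` is a nice cone, then whenever `C` has a `K`-lift (not necessarily proper),
`S_C` has a `K`-factorization" (Cor. 2.6), specialised to `C = Bⁿ`, `K = S^k_+`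
(`ext(Bⁿ) = ext((Bⁿ)°) = S^{n−1}`). In particular the least psd-lift size of `Bⁿ` equals the
least psd-factorization size of the sphere kernel (`4` for `n = 4`:
`isLeast_psdLiftSize_euclideanBall_fin_four` = `isLeast_psdFactorizationSize_sphere_slack_fin_four`).
[cite: GouveiaParriloThomas2013, Thm. 2.4 and Cor. 2.6 (§2, p05–p06)] -/
theorem hasPsdLift_euclideanBall_iff_exists_psd_factorization {k n : ℕ} :
    HasPsdLift {x : Fin n → ℝ | ∑ l, x l ^ 2 ≤ 1} k ↔
      ∃ (A B : (Fin n → ℝ) → Matrix (Fin k) (Fin k) ℝ),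
        (∀ x, ∑ l, x l ^ 2 = 1 → (A x).PosSemidef) ∧ (∀ y, ∑ l, y l ^ 2 = 1 → (B y).PosSemidef) ∧
        ∀ x y, ∑ l, x l ^ 2 = 1 → ∑ l, y l ^ 2 = 1 → (A x * B y).trace = 1 - x ⬝ᵥ y := by
  refine ⟨exists_psd_factorization_of_hasPsdLift_euclideanBall, fun ⟨A, B, hA, hB, hAB⟩ => ?_⟩
  rcases Nat.eq_zero_or_pos n with rfl | hn
  · exact hasPsdLift_of_subsingleton ⟨0, by simp⟩ k
  · exact hasPsdLift_euclideanBall_of_psd_factorization hn hA hB hAB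

/-- The psd-lift sizes of `Bⁿ` are exactly the psd-factorization sizes of the sphere kernel
`1 − ⟨x, y⟩`. [cite: GouveiaParriloThomas2013, Thm. 2.4 and Cor. 2.6 (§2, p05–p06)] -/
theorem setOf_hasPsdLift_euclideanBall_eq (n : ℕ) :
    {k : ℕ | HasPsdLift {x : Fin n → ℝ | ∑ l, x l ^ 2 ≤ 1} k} =
      {k : ℕ | ∃ (A B : (Fin n → ℝ) → Matrix (Fin k) (Fin k) ℝ),
        (∀ x, ∑ l, x l ^ 2 = 1 → (A x).PosSemidef) ∧ (∀ y, ∑ l, y l ^ 2 = 1 → (B y).PosSemidef) ∧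
        ∀ x y, ∑ l, x l ^ 2 = 1 → ∑ l, y l ^ 2 = 1 → (A x * B y).trace = 1 - x ⬝ᵥ y} :=
  Set.ext fun _ => hasPsdLift_euclideanBall_iff_exists_psd_factorization

end BallSlackOperator

/-! ### GPT Example 2.7: the explicit `S²_+`-factorization of the disk's slack operator; exact
factorization sizes of the sphere kernels for `n = 2, 3` -/

section DiskExample

/-- A symmetric `2 × 2` real matrix `[[p,q],[q,r]]` with `p, r ≥ 0` and `q² ≤ pr` is psd. [folklore] -/
private theorem posSemidef_fin_two' {p q r : ℝ} (hp : 0 ≤ p) (hr : 0 ≤ r) (hq : q ^ 2 ≤ p * r) :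
    (!![p, q; q, r] : Matrix (Fin 2) (Fin 2) ℝ).PosSemidef := by
  refine PosSemidef.of_dotProduct_mulVec_nonneg ?_ fun x => ?_
  · ext i j
    fin_cases i <;> fin_cases j <;> simp
  · have hform : star x ⬝ᵥ (!![p, q; q, r] *ᵥ x) =
        p * x 0 ^ 2 + 2 * q * x 0 * x 1 + r * x 1 ^ 2 := by
      simp [Matrix.mulVec, dotProduct, Fin.sum_univ_two]
      ring
    rw [hform]
    by_cases hp0 : p = 0
    · have hq0 : q = 0 := by
        have : q ^ 2 ≤ 0 := by simpa [hp0] using hq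
        exact pow_eq_zero_iff (n := 2) (by norm_num) |>.mp (le_antisymm this (sq_nonneg q))
      rw [hp0, hq0]
      nlinarith [sq_nonneg (x 1)]
    · have hpos : 0 < p := lt_of_le_of_ne hp (Ne.symm hp0)
      have key : p * (p * x 0 ^ 2 + 2 * q * x 0 * x 1 + r * x 1 ^ 2) =
          (p * x 0 + q * x 1) ^ 2 + (p * r - q ^ 2) * x 1 ^ 2 := by ring
      have hnn : 0 ≤ p * (p * x 0 ^ 2 + 2 * q * x 0 * x 1 + r * x 1 ^ 2) := by
        rw [key]
        nlinarith [sq_nonneg (p * x 0 + q * x 1), sq_nonneg (x 1)]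
      exact nonneg_of_mul_nonneg_right hnn hpos

/-- GPT's first factor for the unit disk: `A(x₁, y₁) = [[1 + x₁, y₁], [y₁, 1 − x₁]]` (the pencil
of the spectrahedral description `C = {(x, y) : [[1 + x, y], [y, 1 − x]] ⪰ 0}` of the disk).
[cite: GouveiaParriloThomas2013, Ex. 2.7 (§2, p06)] -/
def diskSlackFactorA (u : Fin 2 → ℝ) : Matrix (Fin 2) (Fin 2) ℝ :=
  !![1 + u 0, u 1; u 1, 1 - u 0]

/-- GPT's second factor for the unit disk: `B(x₂, y₂) = ½ [[1 − x₂, −y₂], [−y₂, 1 + x₂]]`.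
[cite: GouveiaParriloThomas2013, Ex. 2.7 (§2, p06)] -/
def diskSlackFactorB (v : Fin 2 → ℝ) : Matrix (Fin 2) (Fin 2) ℝ :=
  !![(1 - v 0) / 2, -v 1 / 2; -v 1 / 2, (1 + v 0) / 2]

/-- `A(x₁, y₁) ⪰ 0` on the unit circle (`det = 1 − x₁² − y₁² = 0`, diagonal `1 ± x₁ ≥ 0`): "can
easily be checked to be positive semidefinite in their domains".
[cite: GouveiaParriloThomas2013, Ex. 2.7 (§2, p06)] -/
theorem posSemidef_diskSlackFactorA {u : Fin 2 → ℝ} (hu : ∑ l, u l ^ 2 = 1) :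
    (diskSlackFactorA u).PosSemidef := by
  rw [Fin.sum_univ_two] at hu
  refine posSemidef_fin_two' ?_ ?_ ?_ <;> nlinarith [sq_nonneg (u 0), sq_nonneg (u 1)]

/-- `B(x₂, y₂) ⪰ 0` on the unit circle. [cite: GouveiaParriloThomas2013, Ex. 2.7 (§2, p06)] -/
theorem posSemidef_diskSlackFactorB {v : Fin 2 → ℝ} (hv : ∑ l, v l ^ 2 = 1) :
    (diskSlackFactorB v).PosSemidef := by
  rw [Fin.sum_univ_two] at hv
  refine posSemidef_fin_two' ?_ ?_ ?_ <;> nlinarith [sq_nonneg (v 0), sq_nonneg (v 1)]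

/-- `⟨A(x₁,y₁), B(x₂,y₂)⟩ = 1 − x₁x₂ − y₁y₂` (identically, for all points of `ℝ²`).
[cite: GouveiaParriloThomas2013, Ex. 2.7 (§2, p06)] -/
theorem trace_diskSlackFactorA_mul_diskSlackFactorB (u v : Fin 2 → ℝ) :
    (diskSlackFactorA u * diskSlackFactorB v).trace = 1 - u ⬝ᵥ v := by
  simp only [diskSlackFactorA, diskSlackFactorB, Matrix.trace_fin_two, Matrix.mul_apply,
    Fin.sum_univ_two, dotProduct, Matrix.cons_val', Matrix.cons_val_zero, Matrix.cons_val_one,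
    Matrix.empty_val', Matrix.cons_val_fin_one, Matrix.of_apply]
  ring

/-- **GPT Example 2.7** (p06, verbatim): "Let `C` be the unit disk in `ℝ²` … This means that `S_C`
must have a `PSD²` factorization. Since `C° = C`, `ext(C) = ext(C°) = ∂C`, and so we have to find
maps `A, B : ext(C) → PSD²` such that … `⟨A(x₁,y₁), B(x₂,y₂)⟩ = 1 − x₁x₂ − y₁y₂`. But this is
accomplished by the maps" `diskSlackFactorA`, `diskSlackFactorB`: an `S²_+`-factorization of the
slack operator of the disk (the `n = 2`, size-`2` companion of `exists_psd_factorization_sphere_slack`,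
whose Frobenius construction needs size `1 + 2 = 3` here). [cite: GouveiaParriloThomas2013, Ex. 2.7 (§2, p06)] -/
theorem GouveiaParriloThomas2013_ex27 :
    ∃ (A B : (Fin 2 → ℝ) → Matrix (Fin 2) (Fin 2) ℝ),
      (∀ x, ∑ l, x l ^ 2 = 1 → (A x).PosSemidef) ∧ (∀ y, ∑ l, y l ^ 2 = 1 → (B y).PosSemidef) ∧
      ∀ x y, ∑ l, x l ^ 2 = 1 → ∑ l, y l ^ 2 = 1 → (A x * B y).trace = 1 - x ⬝ᵥ y :=
  ⟨diskSlackFactorA, diskSlackFactorB, fun _ hx => posSemidef_diskSlackFactorA hx,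
    fun _ hy => posSemidef_diskSlackFactorB hy,
    fun x y _ _ => trace_diskSlackFactorA_mul_diskSlackFactorB x y⟩

/-- GPT Example 2.7 read through Theorem 2.4: the disk has a psd lift of size `2` (the tree's
`hasPsdLift_euclideanBall_fin_two` obtains this from the ellipse pencil directly).
[cite: GouveiaParriloThomas2013, Ex. 2.7 and Thm. 2.4 (§2, p05–p06)] -/
theorem hasPsdLift_euclideanBall_fin_two' : HasPsdLift {x : Fin 2 → ℝ | ∑ l, x l ^ 2 ≤ 1} 2 :=
  hasPsdLift_euclideanBall_iff_exists_psd_factorization.2 GouveiaParriloThomas2013_ex27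

/-- **The slack operator of the circle has psd-factorization size exactly `2`**: size `2` by GPT
Example 2.7, no size `≤ 1` by `not_exists_psd_factorization_sphere_slack` (`k < 2`,
`C(k+1,2) < 5`). [cite: GouveiaParriloThomas2013, Ex. 2.7 (§2, p06)] -/
theorem isLeast_psdFactorizationSize_sphere_slack_fin_two :
    IsLeast {k : ℕ | ∃ (A B : (Fin 2 → ℝ) → Matrix (Fin k) (Fin k) ℝ),
      (∀ x, ∑ l, x l ^ 2 = 1 → (A x).PosSemidef) ∧ (∀ y, ∑ l, y l ^ 2 = 1 → (B y).PosSemidef) ∧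
      ∀ x y, ∑ l, x l ^ 2 = 1 → ∑ l, y l ^ 2 = 1 → (A x * B y).trace = 1 - x ⬝ᵥ y} 2 := by
  refine ⟨GouveiaParriloThomas2013_ex27, fun k hk => ?_⟩
  by_contra hlt
  push Not at hlt
  exact not_exists_psd_factorization_sphere_slack (k := k) (n := 2) (by omega)
    (by interval_cases k <;> decide) hk

/-- **The slack operator of `S²` has psd-factorization size exactly `3`** — transported from the
least psd-lift size `3` of `B³` (`isLeast_psdLiftSize_euclideanBall_fin_three`: the spectraplex
shadow and the `k ≤ 2` exclusion) through GPT Theorem 2.4 for the ball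
(`setOf_hasPsdLift_euclideanBall_eq`). [cite: GouveiaParriloThomas2013, Thm. 2.4 and Cor. 2.6 (§2, p05–p06)] -/
theorem isLeast_psdFactorizationSize_sphere_slack_fin_three :
    IsLeast {k : ℕ | ∃ (A B : (Fin 3 → ℝ) → Matrix (Fin k) (Fin k) ℝ),
      (∀ x, ∑ l, x l ^ 2 = 1 → (A x).PosSemidef) ∧ (∀ y, ∑ l, y l ^ 2 = 1 → (B y).PosSemidef) ∧
      ∀ x y, ∑ l, x l ^ 2 = 1 → ∑ l, y l ^ 2 = 1 → (A x * B y).trace = 1 - x ⬝ᵥ y} 3 := by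
  rw [← setOf_hasPsdLift_euclideanBall_eq 3]
  exact isLeast_psdLiftSize_euclideanBall_fin_three

end DiskExample

end Literature.Combinatorics.Optimization
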